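/-
Copyright: cell `langlands-arthur-audit` (papers/Langlands/langlands-arthur-audit), unit `pub-arthur-down-g58`
(downstream tracer, gen 58).  Fifteenth file of the exact-support certificates of the downstream register (module M274 of the cell's MODULE-MAP — CLAIMed in
`lean/MODULE-MAP3.md` 2026-08-25).  `DownstreamSupport.lean` … `DownstreamSupport13.lean` are full or CLOSED and `DownstreamSupport14.lean` (sections 115–120,
module M233) stops at the hundred-and-seventeenth tranche (`Downstream34.lean` v3); the supports of the register from tranche 118 on (`Downstream35.lean` ff.)
were deferred by units `pub-arthur-down-g51` … `g57` while the hub's olean store was frozen (ops-buildfix B18-3) and start here, APPEND-ONLY in the same conventions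
and the same namespace `…Arthur2013.Downstream.Support`; this file imports `…DownstreamSupport14` (through it every earlier support file: the canonical readings
`canon`, `canon₂`, …, `canon₁₁₇`, the tops `νtop` / `μtop` / `κtop`, `bookInputs_top` / `mokInputs_top` / `kmswInputs_top`, `not_B_cm` / `not_M_cm`, `κnoMok`, the
Basic-Assumption line's `baLine_open_leaves` / `baLine_weighted_leaves` of section 54, the countermodel lemmas) and `…Downstream35` (the thirty-fifth register file,
module M254, tranches 118–124).
v1 = section 121, the supports of the hundred-and-eighteenth tranche (`Downstream35.lean` v1, unit `pub-arthur-down-g51`: THE SECOND-HAND RESIDUE READ FIRST-HAND —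
row C174 M. Hanzer, Monatsh. Math. 177 (2015) (`HanzerBorel`, premise-free; `HanzerUnipotentSp` ⇐ the book at every rank), class row B82's members I. Matić,
Proc. AMS 145 (2017) (`MaticSPAubert` ⇐ book ∧ E41 `Consumers50.MoeglinHalfInt`), I. Matić, Pacific J. Math. 289 (2017) (`MaticLQAubert` ⇐ book ∧ E41 ∧ the
Mœglin – Tadić classification `Consumers51.MoeglinTadicDS`), C. Jantzen, Represent. Theory 22 (2018) (`JantzenHalfIntDual` ⇐ (BA) ∧ the classification, with the
supply edge `E_BasicAssumptionJ18` ⇐ book ∧ E41); `canon₁₁₈`, `canon_implications₁₁₈`, `hundredeighteenth_holds_top`, `c118_book_cm`, `c118_open_leaves`,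
`c118_weighted_leaves`, `c118_mok_cm`, `c118_kmsw`, `c118_regraded`); section 122, the supports of the hundred-and-nineteenth tranche (`Downstream35.lean` v2,
unit `pub-arthur-down-g51`: THE VERSIONS OF RECORD, I — row C66 Ichino – Prasanna, Forum Math. Pi 11 (2023) (`IchinoPrasannaHodgeVoR_i` premise-free; node
`KottwitzGUHyp`; `IchinoPrasannaHodgeVoR_ii` ⇐ the node), row B54 Bertoloni Meli – Youcis, Represent. Theory 27 (2023) (`BMYCharacterizationVoR` ⇐ Mok ∧ tranche
61's node `BMYScholzeShin`), row B3 Atobe – Gan, Represent. Theory 21 (2017) (`AtobeGanQSVoR` ⇐ the book); `canon₁₁₉W` / `canon₁₁₉` / `canon₁₁₉noK`,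
`canon_implications₁₁₉W` / `₁₁₉` / `₁₁₉noK`, `hundrednineteenth_holds_top`, `c119_partsI_II_granted`, `c119_node_denied`, `c119_book_cm`, `c119_mok_cm`, `c119_kmsw`,
`c119_regraded`); section 123, the support of the hundred-and-twentieth tranche (`Downstream35.lean` v3, unit `pub-arthur-down-g52`: THE VERSIONS OF RECORD, II —
row C248 Pitale – Saha – Schmidt, Ann. Math. Québec 45 (2021), the version-of-record edge `E_PSSdeg5VoR` ⇐ row C180 alone on tranche 99's fields;
`canon_implications₁₂₀` / `₁₂₀noC180`, `hundredtwentieth_holds_top`, `c120_book_cm`, `c120_C180_denied_top`, `c120_mok_cm`, `c120_kmsw`, `c120_regraded`).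
v2 (same unit) = sections 124–127 APPENDED, the supports of the hundred-and-twenty-first … hundred-and-twenty-fourth tranches (`Downstream35.lean` v4, v5, v7, v8; units
`pub-arthur-down-g52` / `g53` / `g54`: THE LATEST arXiv TEXT STATES I–IV — C291 v2 / C70 v2 / C276 v3 (section 124); B107 v2 with the NEW edge B14 → B107 and B100 v4
(section 125); C104 Disegni v2 (section 126); B12 v3 node + theorem, B48 v2, B115 Theorem 11.1, C35 v7 (section 127)); v1 untouched.
v3 (same unit) = sections 128–130 APPENDED, the supports of the hundred-and-twenty-fifth … hundred-and-twenty-seventh tranches (`Downstream36.lean` v1 – v3, module M261; units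
`pub-arthur-down-g54` / `g55`: THE LATEST arXiv TEXT STATES V–VII — B31 v2, B44 v2, C16's Theorem 5.1 = B.2 with its unitary instance, C36 v3 (section 128); C62 v4's Theorem C,
node, instance, corollary and Theorem 7.3.5 (section 129); C270 v2's Theorems 1.4 / 2.5 with the node `HYmultOneD` and C82 v5's Theorems 1.1 / 1.2 (section 130)); the file now
also imports `…Downstream36`; v1 / v2 untouched.  The file CLOSES here (the gate's 200,000-byte bound); the supports of tranches 128 ff. (`Downstream37.lean`, `Downstream38.lean`)
continue in `DownstreamSupport16.lean`.
v4 (unit `pub-arthur-down-g59`) = ERRATUM, docstring wording only — no declaration, statement or proof changed: the referee's D-REF-g229-1 (section 124's `c121_rows_denied_top`: the C291 ⇐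
C99 locators are `p0002:L39-40`, `p0022:L11-14` of Huang et al. v2, as in `Downstream35.lean`, not `p0015:L24-27`), D-REF-g229-2 (Hanzer's §4 cites the book as « Arthur’s Theorem 2.2.1 of
[1] » (her p0030:L1-2) — the string « 1.5.2 » is not in her text), D-REF-g230-1 (the hypothesis of Zhu's arXiv v3 Chapter 9 is Hypothesis 9.1.2 (v3 p0250:L6-9) = tranche 69's node
`ZhuHyp202`, named after the 2018 thesis text's « Hypothesis 202 » — « 2.0.2 » is neither text's label) and D-REF-g230-2 (Jiang – Zhang 2020 cites the book numerically, as « [3] » (arXiv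
v4 p0087:L40); « [Ar13] » is row C99's form) are corrected in this docstring and at sections 121, 124, 128 and 129 (`HOME/pub-arthur-ref-g229/R233.md`, `HOME/pub-arthur-ref-g230/R234.md`).
-/
import HarnessLib
import Literature.NumberTheory.Automorphic.Arthur2013.DownstreamSupport14
import Literature.NumberTheory.Automorphic.Arthur2013.Downstream35
import Literature.NumberTheory.Automorphic.Arthur2013.Downstream36

/-!
# Downstream of Arthur (2013): exact leaf support of the downstream register, fifteenth file (sections ≥ 121)

**Source reproduced.**  Nothing beyond what `Downstream.lean` … `Downstream35.lean` transcribe (the downstream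
authors' own sentences, cited there chunk by chunk) and what the three leaf-support modules certify
(`Arthur2013/LeafSupport.lean`, `Mok2015/LeafSupport.lean`, `KMSW2014/LeafSupport.lean`: for every leaf a
kernel-checked countermodel of the DAG as typed).  As in the first fourteen files: a CANONICAL READING assigns to each
typed downstream statement the conjunction of DAG outputs its edge receives, the tranche's edges are shown to hold in
that reading for arbitrary node assignments, and the countermodels then give the [read: only if] half of each support —
which leaves are load-bearing for which downstream theorem, in the register AS TYPED (a statement about the cell's
transcription, not about the mathematics).  [cite: Arthur2013, §1.5 with AGIKMS2024 l.380-382 (the conditional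
reading whose supports are certified)]

**v1 (section 121; unit `pub-arthur-down-g58`, gen 58): what is added.**  The hundred-and-eighteenth tranche
(`Downstream35.lean` v1) types row C174 (M. Hanzer 2015: the §3 realisation `HanzerBorel` with NO premise; the §4
realisation `HanzerUnipotentSp` from « Arthur’s Theorem 2.2.1 of [1] » = the book at every rank) and three members of class
row B82 — Matić 2017a (`MaticSPAubert` ⇐ book ∧ E41's Théorème 3.1.1 `Consumers50.MoeglinHalfInt`), Matić 2017b
(`MaticLQAubert` ⇐ book ∧ E41 ∧ the Mœglin – Tadić classification `Consumers51.MoeglinTadicDS`) and Jantzen 2018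
(`JantzenHalfIntDual` ⇐ (BA) ∧ the classification; the supply edge `E_BasicAssumptionJ18`: (BA) ⇐ book ∧ E41).
Certified here, in the canonical reading over section 17's `canon₁₄`, section 53's `canon₅₀` and section 54's
`canon₅₁` (`canon₁₁₈ ν`: each statement := the conjunction its edge receives, written out): all five hold at the top
(`hundredeighteenth_holds_top`); in the book countermodel of ANY of the 24 leaves the four book-dependent statements
FAIL and `HanzerBorel` HOLDS, every edge of tranches 14 / 50 / 51 / 118 valid (`c118_book_cm`); on the seven
2024–2026 PREPRINT leaves E41's Théorème 3.1.1 HOLDS (section 54's `baLine_open_leaves`) while Matić's two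
statements and Jantzen's FAIL — their failure runs through « [1] » / (BA), not through E41 (`c118_open_leaves`); on
the two unwritten weighted fundamental lemmas E41 fails too (`c118_weighted_leaves`); in every Mok countermodel and
every KMSW leaf countermodel all five hold (`c118_mok_cm`, `c118_kmsw`: no unitary group occurs).  In one statement
(`c118_regraded`): support(`HanzerBorel`) = ∅; support(`HanzerUnipotentSp`) = support(`MaticSPAubert`) =
support(`MaticLQAubert`) = support(`JantzenHalfIntDual`) = ALL 24 leaves of the book's DAG and NO Mok / KMSW leaf —
the census's « second-hand » B82 members and its « plausible control » C174 §4 inherit, as typed, the 2024–2026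
preprint layer and the two unwritten weighted fundamental lemmas (the kernel form of GAPS G-DN-483 / 484).

**v1, sections 122–123: what is added.**  The hundred-and-nineteenth tranche (`Downstream35.lean` v2) types three VERSIONS OF RECORD that differ from the
register's arXiv-state rows at the typed statement: C66 Ichino – Prasanna 2023 (Theorem 1 (i) `IchinoPrasannaHodgeVoR_i` with NO premise; Theorem 1 (ii)
`IchinoPrasannaHodgeVoR_ii` ⇐ the NEW node `KottwitzGUHyp`, outside the three DAGs), B54 Bertoloni Meli – Youcis 2023 (`BMYCharacterizationVoR` ⇐ Mok ∧
tranche 61's node `BMYScholzeShin` — KMSW no longer cited), B3 Atobe – Gan 2017 (`AtobeGanQSVoR` ⇐ the book).  Certified in section 122, in the parametrised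
reading `canon₁₁₉W ν μ k s` (k, s the values of the two nodes; canonical instance `canon₁₁₉` = both granted, `canon₁₁₉noK` = Kottwitz's node denied): all four
hold at the top (`hundrednineteenth_holds_top`); Theorem 1 (i), (ii) hold for EVERY assignment with the node granted (`c119_partsI_II_granted`) and (ii) fails,
every edge valid, with it denied (`c119_node_denied`); in the book countermodel of any leaf only B3's clauses fail (`c119_book_cm`); in every Mok countermodel
only B54's Theorem 4.2 fails (`c119_mok_cm`); in EVERY KMSW leaf countermodel — `MokMain` included — all four hold (`c119_kmsw`).  In one statement
(`c119_regraded`): support(VoR (i)) = ∅; support(VoR (ii)) = the node alone; support(`BMYCharacterizationVoR`) = all 29 Mok leaves ∧ the Scholze–Shin node,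
NO KMSW leaf (against tranche 61's Mok ∧ KMSW-scope ∧ node, section 64); support(`AtobeGanQSVoR`) = all 24 book leaves.  The hundred-and-twentieth tranche
(`Downstream35.lean` v3) adds ONE edge on tranche 99's fields, the version-of-record form of row C248 Pitale – Saha – Schmidt 2021 (`E_PSSdeg5VoR`: Theorem 1.1 ⇐
row C180 `Consumers19.SchmidtParamodular` alone).  Section 123 certifies that the edge holds in section 102's canonical reading `canon₉₉` over section 22's
`canon₁₉` with no new reading (`canon_implications₁₂₀`; over the C180-denied `canon₁₉noC180` vacuously, `canon_implications₁₂₀noC180`), that both C248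
statements hold at the top by the tranche's own `pssVoR_of_leaves` (`hundredtwentieth_holds_top`), fail in every book countermodel (`c120_book_cm`) and with C180
denied at the top (`c120_C180_denied_top`), and hold in every Mok / KMSW countermodel (`c120_mok_cm`, `c120_kmsw`): support(`PSSdeg5`) = support(`PSSsym4`) =
all 24 book leaves THROUGH C180 on either text state — the version of record changes the order of the citation, not the set of leaves (`c120_regraded`).

**v2, sections 124–127 (same unit): what is added.**  The supports of the four LATEST-arXiv-TEXT-STATE tranches of `Downstream35.lean`.  Section 124 (tranche 121:
`Consumers121`, rows C291 v2 / C70 v2 / C276 v3 over `canon₂` / `canon₂₈`): supports UNCHANGED by the rewrites — `HLMYpicardOneV2` = all 24 book leaves through C99,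
`HWangLevelLoweringV3` = all 24 through C191, `HMYBallQuotientsV2` = all 29 Mok leaves ∧ all 14 KMSW leaves (sequels included), with the row-denied separations
(`c121_rows_denied_top` over section 113's `c₂noBLMM` and section 31's `canon₂₈noC191`).  Section 125 (tranche 122: `Consumers122`, B107 v2 and B100 v4 over nine cited
tranches): all five statements = all 24 book leaves; row B14 is load-bearing for `LiuShahidiLargeP` (the NEW edge of v2, `c122_rows_denied_top` (a) over `c₄₀noB14`), row
C168 for B100's two (`c₅₄noC168`); Theorem 1.13 v2 inherits Mok's leaves through B26's quasi-split node exactly as v1's Theorem 1.14 did (section 45's artefact,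
`c122_mok_cm`).  Section 126 (tranche 123: C104 Disegni v2 over `canon` / `canon₂` / `canon₅` / `canon₃₃` / `canon₃₅`): support = all 29 Mok leaves ∧ KMSW's eleven
proved-scope leaves, no book leaf, not the sequels (`c123_kmsw_cm_iff`) — the same as the v1 field.  Section 127 (tranche 124: B12 v3 node / theorem, B48 v2, B115, C35
v7 over `canon₄₅` / `canon₅₆`, parametrised by the node's value): `AtobeFJv3` = the node alone; `XuJordIrreducible` = all 24 book leaves; `OiUliftV2` = all 29 Mok
leaves ∧ the book's five published leaves through E43, NO open book leaf (`c124_book_cm` with section 48's `moeglinUnitaryDS_cm_holds` / `_fails`); `HaanGGPv7` = all 29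
Mok leaves ∧ KMSW's proved scope (`c124_kmsw_cm_iff`).

**Deliberately not here.**  Any claim about the content or truth of a downstream statement; no new named fact (every
canonical value is written out); no Mathlib, no `axiom`, no `sorry`, no `opaque`.
-/

set_option autoImplicit false

namespace Literature.NumberTheory.Automorphic.Arthur2013

namespace Downstream

namespace Support

/-! ## 121. Hundred-and-eighteenth tranche (v1 of this file, after `Downstream35.lean` v1; unit `pub-arthur-down-g58`): supports of row C174 Hanzer 2015
(`HanzerBorel`, `HanzerUnipotentSp`) and of class row B82's members Matić 2017a (`MaticSPAubert`), Matić 2017b (`MaticLQAubert`), Jantzen 2018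
(`JantzenHalfIntDual`); see the module docstring for the summary of what is certified. -/

section Canon118

variable (ν : Nodes)

/-- The canonical reading of the hundred-and-eighteenth tranche: Hanzer's §3 statement := `True` (its edge has no premise); her §4 statement := everything the book
establishes at every rank; Matić 2017a := that ∧ E41's seven premises (the value section 53's `canon₅₀` gives `MoeglinHalfInt`); Matić 2017b := that ∧ E41's
premises ∧ the classification's value in section 54's `canon₅₁` (again everything the book establishes); Jantzen 2018 := (BA)'s value ∧ the classification's value
(both everything the book establishes, `canon₅₁`). [cite: Hanzer2015UnipotentSp, §§3–4; Matic2017AubertSP, §2; Matic2017LanglandsQuotients, §2; Jantzen2018DualityHalfIntegral, §1 (canonical model; bookkeeping)] -/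
abbrev canon₁₁₈ : Consumers118 where
  HanzerBorel := True
  HanzerUnipotentSp := ∀ N, ν.Everything N
  MaticSPAubert := (∀ N, ν.Everything N) ∧ (ν.A11_twisted ∧ ν.TWFL ∧ ν.WFL_nonstandard ∧ ν.FL ∧ ν.TwistedTF ∧ ν.MW_Stab ∧ ν.LLC_GLN)
  MaticLQAubert := (∀ N, ν.Everything N) ∧ (ν.A11_twisted ∧ ν.TWFL ∧ ν.WFL_nonstandard ∧ ν.FL ∧ ν.TwistedTF ∧ ν.MW_Stab ∧ ν.LLC_GLN) ∧ (∀ N, ν.Everything N)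
  JantzenHalfIntDual := (∀ N, ν.Everything N) ∧ (∀ N, ν.Everything N)

/-- Every hundred-and-eighteenth-tranche edge — the five consumer edges and the supply edge `E_BasicAssumptionJ18` — holds in the canonical reading over `canon₅₀` /
`canon₅₁`, for arbitrary ν. [cite: Hanzer2015UnipotentSp, §§3–4; Matic2017AubertSP, §2; Matic2017LanglandsQuotients, §2; Jantzen2018DualityHalfIntegral, §1 (bookkeeping proved here)] -/
theorem canon_implications₁₁₈ : Implications118 ν (canon₅₀ ν) (canon₅₁ ν) (canon₁₁₈ ν) where
  hanzerBorel := True.intro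
  hanzer := fun h => h
  maticSP := fun h m => ⟨h, m⟩
  maticLQ := fun h m d => ⟨h, m, d⟩
  baJ18 := fun h _ => h
  jantzen := fun b d => ⟨b, d⟩

end Canon118

/-- At the top (every input of the book's DAG) all five statements hold — through the tranche's own `hundredeighteenth_of_inputs` fed by section 54's
`canon_implications₅₁`, section 53's `canon_implications₅₀`, section 17's `canon_implications₁₄` and `bookInputs_top`. [cite: Hanzer2015UnipotentSp, §§3–4; Matic2017AubertSP, §2; Matic2017LanglandsQuotients, §2; Jantzen2018DualityHalfIntegral, §1 (bookkeeping proved here)] -/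
theorem hundredeighteenth_holds_top :
    (canon₁₁₈ νtop).HanzerBorel ∧ (canon₁₁₈ νtop).HanzerUnipotentSp ∧ (canon₁₁₈ νtop).MaticSPAubert ∧ (canon₁₁₈ νtop).MaticLQAubert ∧
      (canon₁₁₈ νtop).JantzenHalfIntDual :=
  hundredeighteenth_of_inputs (canon_implications₁₁₈ νtop) (canon_implications₅₁ νtop) (canon_implications₅₀ νtop) (canon_implications₁₄ νtop) bookInputs_top

/-- BOOK SIDE, EXACT SUPPORT AS TYPED: in the book countermodel of ANY of the 24 leaves `l` (every edge of tranches 14 / 50 / 51 / 118 valid in the canonical reading,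
the other 23 leaves true, `l` false) the four book-dependent statements — Hanzer §4, Matić 2017a, Matić 2017b, Jantzen 2018 — all FAIL (each receives « everything the
book establishes », false there by the first support file's `not_B_cm`) and Hanzer's §3 statement HOLDS: ALL 24 leaves are load-bearing for the four, none for the
fifth. [cite: Hanzer2015UnipotentSp, proof of Prop. 4.5 (p0030:L1-4); Matic2017AubertSP, §2 (p0004:L33-34); Matic2017LanglandsQuotients, §2 (p0009:L19-22); Jantzen2018DualityHalfIntegral, §1 (p0004:L26-27) (bookkeeping proved here)] -/
theorem c118_book_cm (l : LeafSupport.Leaf) :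
    ¬ (LeafSupport.mkN (LeafSupport.cm l)).leaf l ∧
      Implications118 (LeafSupport.mkN (LeafSupport.cm l)) (canon₅₀ (LeafSupport.mkN (LeafSupport.cm l))) (canon₅₁ (LeafSupport.mkN (LeafSupport.cm l)))
        (canon₁₁₈ (LeafSupport.mkN (LeafSupport.cm l))) ∧
      Implications51 (LeafSupport.mkN (LeafSupport.cm l)) (canon₄₅ (LeafSupport.mkN (LeafSupport.cm l))) (canon₅₀ (LeafSupport.mkN (LeafSupport.cm l)))
        (canon₅₁ (LeafSupport.mkN (LeafSupport.cm l))) ∧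
      Implications50 (canon₁₄ (LeafSupport.mkN (LeafSupport.cm l))) (canon₅₀ (LeafSupport.mkN (LeafSupport.cm l))) ∧
      Implications14 (LeafSupport.mkN (LeafSupport.cm l)) (canon₁₄ (LeafSupport.mkN (LeafSupport.cm l))) ∧
      (¬ (canon₁₁₈ (LeafSupport.mkN (LeafSupport.cm l))).HanzerUnipotentSp ∧ ¬ (canon₁₁₈ (LeafSupport.mkN (LeafSupport.cm l))).MaticSPAubert ∧
        ¬ (canon₁₁₈ (LeafSupport.mkN (LeafSupport.cm l))).MaticLQAubert ∧ ¬ (canon₁₁₈ (LeafSupport.mkN (LeafSupport.cm l))).JantzenHalfIntDual) ∧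
      (canon₁₁₈ (LeafSupport.mkN (LeafSupport.cm l))).HanzerBorel :=
  have cmod := LeafSupport.countermodel l
  have n := not_B_cm l
  ⟨cmod.2.2.1, canon_implications₁₁₈ _, canon_implications₅₁ _, canon_implications₅₀ _, canon_implications₁₄ _,
    ⟨n, fun h => n h.1, fun h => n h.1, fun h => n h.1⟩, True.intro⟩

/-- THE TRANCHE ON THE SEVEN PREPRINT LEAVES: in the book countermodel of each 2024–2026 preprint leaf (AGIKMS Thm 1.8.1 / 1.9.1 / 1.10.5 / Cor. D.2.1 / App. E,
[KM26], [CK26]) E41's Théorème 3.1.1 `MoeglinHalfInt` HOLDS (section 54's `baLine_open_leaves`: its seven premises are other leaves or derived from them) while Matić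
2017a, Matić 2017b and Jantzen 2018 FAIL — as typed, their dependence on the preprint layer runs through « [1] » (the book by number) and through (BA), not through the
half-integrality theorem they also cite. [cite: Matic2017AubertSP, §2 (p0004:L33-34); Matic2017LanglandsQuotients, §2 (p0009:L19-22); Jantzen2018DualityHalfIntegral, §1 (p0004:L26-27); Moeglin2014Stable, Théorème 3.1.1 (bookkeeping proved here)] -/
theorem c118_open_leaves (l : LeafSupport.Leaf)
    (hl : l = .AGIKMS_181 ∨ l = .AGIKMS_191 ∨ l = .AGIKMS_1105 ∨ l = .AGIKMS_D21 ∨ l = .AGIKMS_AppE ∨ l = .KM26 ∨ l = .CK26) :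
    (canon₅₀ (LeafSupport.mkN (LeafSupport.cm l))).MoeglinHalfInt ∧
      ¬ (canon₁₁₈ (LeafSupport.mkN (LeafSupport.cm l))).MaticSPAubert ∧ ¬ (canon₁₁₈ (LeafSupport.mkN (LeafSupport.cm l))).MaticLQAubert ∧
      ¬ (canon₁₁₈ (LeafSupport.mkN (LeafSupport.cm l))).JantzenHalfIntDual ∧ ¬ (LeafSupport.mkN (LeafSupport.cm l)).leaf l :=
  have c := baLine_open_leaves l hl
  have n := not_B_cm l
  ⟨c.2.2.1.1, fun h => n h.1, fun h => n h.1, fun h => n h.1, c.2.2.2.2⟩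

/-- THE TRANCHE ON THE TWO UNWRITTEN WEIGHTED FUNDAMENTAL LEMMAS: in the book countermodel of `WFL_general` and in that of `WFL_nonstandard` E41's Théorème 3.1.1 FAILS
too (section 54's `baLine_weighted_leaves`), with Matić 2017a / 2017b, Jantzen 2018 and Hanzer §4 — both premises of Matić's edges fail there. [cite: Moeglin2014Stable, p0005:L30; Matic2017AubertSP, §2; Hanzer2015UnipotentSp, §4 (bookkeeping proved here)] -/
theorem c118_weighted_leaves (l : LeafSupport.Leaf) (hl : l = .WFL_general ∨ l = .WFL_nonstandard) :
    ¬ (canon₅₀ (LeafSupport.mkN (LeafSupport.cm l))).MoeglinHalfInt ∧ ¬ (canon₁₁₈ (LeafSupport.mkN (LeafSupport.cm l))).MaticSPAubert ∧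
      ¬ (canon₁₁₈ (LeafSupport.mkN (LeafSupport.cm l))).MaticLQAubert ∧ ¬ (canon₁₁₈ (LeafSupport.mkN (LeafSupport.cm l))).JantzenHalfIntDual ∧
      ¬ (canon₁₁₈ (LeafSupport.mkN (LeafSupport.cm l))).HanzerUnipotentSp ∧ (∀ l', l' ≠ l → (LeafSupport.mkN (LeafSupport.cm l)).leaf l') :=
  have c := baLine_weighted_leaves l hl
  have n := not_B_cm l
  ⟨c.2.2.1.1, fun h => n h.1, fun h => n h.1, fun h => n h.1, n, c.2.2.2⟩

/-- MOK SIDE: in the Mok countermodel of ANY of the 29 leaves `l` (book at the top) every edge of tranches 50 / 51 / 118 holds and all five statements HOLD — no Mok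
premise anywhere in the tranche (symplectic and odd-orthogonal p-adic groups; Sp_{2n}(𝔸) for Hanzer). [cite: Hanzer2015UnipotentSp, §§3–4; Matic2017AubertSP, p0001:L10-13; Matic2017LanglandsQuotients, p0002:L14-15; Jantzen2018DualityHalfIntegral, §1 (bookkeeping proved here)] -/
theorem c118_mok_cm (l : Mok2015.LeafSupport.Leaf) :
    ¬ (Mok2015.LeafSupport.mkN (Mok2015.LeafSupport.cm l)).leaf l ∧
      Implications118 νtop (canon₅₀ νtop) (canon₅₁ νtop) (canon₁₁₈ νtop) ∧ Implications51 νtop (canon₄₅ νtop) (canon₅₀ νtop) (canon₅₁ νtop) ∧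
      ((canon₁₁₈ νtop).HanzerBorel ∧ (canon₁₁₈ νtop).HanzerUnipotentSp ∧ (canon₁₁₈ νtop).MaticSPAubert ∧ (canon₁₁₈ νtop).MaticLQAubert ∧
        (canon₁₁₈ νtop).JantzenHalfIntDual) :=
  have cmod := Mok2015.LeafSupport.countermodel l
  ⟨cmod.2.2.1, canon_implications₁₁₈ _, canon_implications₅₁ _, hundredeighteenth_holds_top⟩

/-- KMSW SIDE: in KMSW's countermodel of ANY leaf `l'` (book and Mok at the top) every edge holds and all five statements HOLD — no KMSW premise in the tranche. [cite: Hanzer2015UnipotentSp, §§3–4; Matic2017AubertSP, §2; Matic2017LanglandsQuotients, §2; Jantzen2018DualityHalfIntegral, §1 (bookkeeping proved here)] [claim: KalethaMinguezShinWhite2014, under-review] -/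
theorem c118_kmsw (l' : KMSW2014.LeafSupport.Leaf) :
    ¬ (KMSW2014.LeafSupport.mkN (KMSW2014.LeafSupport.cm l')).leaf l' ∧
      Implications118 νtop (canon₅₀ νtop) (canon₅₁ νtop) (canon₁₁₈ νtop) ∧
      ((canon₁₁₈ νtop).HanzerBorel ∧ (canon₁₁₈ νtop).HanzerUnipotentSp ∧ (canon₁₁₈ νtop).MaticSPAubert ∧ (canon₁₁₈ νtop).MaticLQAubert ∧
        (canon₁₁₈ νtop).JantzenHalfIntDual) :=
  have cmod := KMSW2014.LeafSupport.countermodel l'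
  ⟨cmod.2.2.1, canon_implications₁₁₈ _, hundredeighteenth_holds_top⟩

/-- THE HUNDRED-AND-EIGHTEENTH TRANCHE REGRADED, in one statement: (i) at the top all five statements hold; (ii) in the book countermodel of ANY of the 24 leaves the
four book-dependent statements fail and Hanzer's §3 statement holds, every edge valid; (iii) on the seven preprint leaves E41's Théorème 3.1.1 holds while Matić 2017a /
2017b and Jantzen 2018 fail; (iv) on the two unwritten weighted lemmas E41 fails with them; (v) in every Mok countermodel and (vi) in every KMSW leaf countermodel all
five hold.  Supports: support(`HanzerBorel`) = ∅; support(`HanzerUnipotentSp`) = support(`MaticSPAubert`) = support(`MaticLQAubert`) = support(`JantzenHalfIntDual`)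
= ALL 24 leaves of the book's DAG (Everything at every rank — « Arthur’s Theorem 2.2.1 of [1] », « [1] », « [Art] (see [Mœ4]) ») and NO Mok / KMSW leaf: the census's second-hand
B82 members and its control C174 §4 are, as typed, conditional in 2026 on the seven 2024–2026 preprint leaves and the two unwritten weighted fundamental lemmas,
exactly like (BA) and the Basic-Assumption line of section 54. [cite: Hanzer2015UnipotentSp, §§3–4; Matic2017AubertSP, §2; Matic2017LanglandsQuotients, §2; Jantzen2018DualityHalfIntegral, §1 (bookkeeping proved here)] [claim: KalethaMinguezShinWhite2014, under-review] -/
theorem c118_regraded :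
    ((canon₁₁₈ νtop).HanzerBorel ∧ (canon₁₁₈ νtop).HanzerUnipotentSp ∧ (canon₁₁₈ νtop).MaticSPAubert ∧ (canon₁₁₈ νtop).MaticLQAubert ∧
        (canon₁₁₈ νtop).JantzenHalfIntDual) ∧
      (∀ l : LeafSupport.Leaf, ¬ (LeafSupport.mkN (LeafSupport.cm l)).leaf l ∧
        Implications118 (LeafSupport.mkN (LeafSupport.cm l)) (canon₅₀ (LeafSupport.mkN (LeafSupport.cm l))) (canon₅₁ (LeafSupport.mkN (LeafSupport.cm l)))
          (canon₁₁₈ (LeafSupport.mkN (LeafSupport.cm l))) ∧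
        ¬ (canon₁₁₈ (LeafSupport.mkN (LeafSupport.cm l))).HanzerUnipotentSp ∧ ¬ (canon₁₁₈ (LeafSupport.mkN (LeafSupport.cm l))).MaticSPAubert ∧
        ¬ (canon₁₁₈ (LeafSupport.mkN (LeafSupport.cm l))).MaticLQAubert ∧ ¬ (canon₁₁₈ (LeafSupport.mkN (LeafSupport.cm l))).JantzenHalfIntDual ∧
        (canon₁₁₈ (LeafSupport.mkN (LeafSupport.cm l))).HanzerBorel) ∧
      (∀ l : LeafSupport.Leaf, l = .AGIKMS_181 ∨ l = .AGIKMS_191 ∨ l = .AGIKMS_1105 ∨ l = .AGIKMS_D21 ∨ l = .AGIKMS_AppE ∨ l = .KM26 ∨ l = .CK26 →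
        (canon₅₀ (LeafSupport.mkN (LeafSupport.cm l))).MoeglinHalfInt ∧ ¬ (canon₁₁₈ (LeafSupport.mkN (LeafSupport.cm l))).MaticSPAubert ∧
          ¬ (canon₁₁₈ (LeafSupport.mkN (LeafSupport.cm l))).JantzenHalfIntDual) ∧
      (∀ l : LeafSupport.Leaf, l = .WFL_general ∨ l = .WFL_nonstandard →
        ¬ (canon₅₀ (LeafSupport.mkN (LeafSupport.cm l))).MoeglinHalfInt ∧ ¬ (canon₁₁₈ (LeafSupport.mkN (LeafSupport.cm l))).MaticSPAubert) ∧
      (∀ l : Mok2015.LeafSupport.Leaf, ¬ (Mok2015.LeafSupport.mkN (Mok2015.LeafSupport.cm l)).leaf l ∧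
        (canon₁₁₈ νtop).HanzerUnipotentSp ∧ (canon₁₁₈ νtop).MaticLQAubert ∧ (canon₁₁₈ νtop).JantzenHalfIntDual) ∧
      (∀ l' : KMSW2014.LeafSupport.Leaf, ¬ (KMSW2014.LeafSupport.mkN (KMSW2014.LeafSupport.cm l')).leaf l' ∧
        (canon₁₁₈ νtop).HanzerUnipotentSp ∧ (canon₁₁₈ νtop).MaticLQAubert ∧ (canon₁₁₈ νtop).JantzenHalfIntDual) :=
  ⟨hundredeighteenth_holds_top,
    fun l => have h := c118_book_cm l
      ⟨h.1, h.2.1, h.2.2.2.2.2.1.1, h.2.2.2.2.2.1.2.1, h.2.2.2.2.2.1.2.2.1, h.2.2.2.2.2.1.2.2.2, h.2.2.2.2.2.2⟩,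
    fun l hl => have h := c118_open_leaves l hl
      ⟨h.1, h.2.1, h.2.2.2.1⟩,
    fun l hl => have h := c118_weighted_leaves l hl
      ⟨h.1, h.2.1⟩,
    fun l => have h := c118_mok_cm l
      ⟨h.1, h.2.2.2.2.1, h.2.2.2.2.2.2.1, h.2.2.2.2.2.2.2⟩,
    fun l' => have h := c118_kmsw l'
      ⟨h.1, h.2.2.2.1, h.2.2.2.2.2.1, h.2.2.2.2.2.2⟩⟩


/-! ## 122. Hundred-and-nineteenth tranche (v1 of this file, after `Downstream35.lean` v2; unit `pub-arthur-down-g51`'s VERSIONS OF RECORD, I): supports of row C66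
Ichino – Prasanna, Forum Math. Pi 11 (2023) (`IchinoPrasannaHodgeVoR_i` premise-free, node `KottwitzGUHyp`, `IchinoPrasannaHodgeVoR_ii` ⇐ the node), row B54
Bertoloni Meli – Youcis, Represent. Theory 27 (2023) (`BMYCharacterizationVoR` ⇐ Mok ∧ tranche 61's node `BMYScholzeShin`), row B3 Atobe – Gan, Represent. Theory 21
(2017) (`AtobeGanQSVoR` ⇐ the book), in the two readings of section 9's pattern for the node (granted / denied). -/

section Canon119

variable (ν : Nodes) (μ : Mok2015.Nodes) (κ : KMSW2014.Nodes)

/-- The parametrised canonical reading of the hundred-and-nineteenth tranche: `k` is the value given to the node `KottwitzGUHyp` (outside the three DAGs: no supplier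
edge in the register), `s` the value of tranche 61's node `BMYScholzeShin`; Theorem 1 (i) := `True` (no premise); Theorem 1 (ii) := `k`; B54's Theorem 4.2 := Mok's
`Everything` at every rank ∧ `s`; B3's version-of-record clauses := everything the book establishes. [cite: IchinoPrasanna2023Hodge, Thm 1 (i), (ii); BertoloniMeliYoucis2023Characterization, Thm 4.2; AtobeGan2017RT, Thm 3.17, Cor. 3.18, Thms 4.4, 4.7, §7 (canonical model; bookkeeping)] -/
abbrev canon₁₁₉W (k s : Prop) : Consumers119 where
  IchinoPrasannaHodgeVoR_i := True
  KottwitzGUHyp := k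
  IchinoPrasannaHodgeVoR_ii := k
  BMYCharacterizationVoR := (∀ N, μ.Everything N) ∧ s
  AtobeGanQSVoR := ∀ N, ν.Everything N

/-- The canonical instance: both nodes GRANTED (`True`), as section 64's `canon₆₁` grants `BMYScholzeShin`. [cite: IchinoPrasanna2023Hodge, Remark 1.4; BertoloniMeliYoucis2023Characterization, Thm 4.2 (canonical model; bookkeeping)] -/
abbrev canon₁₁₉ : Consumers119 := canon₁₁₉W ν μ True True

/-- The NODE-DENIED reading: `KottwitzGUHyp` := `False` (and Theorem 1 (ii) with it), everything else canonical. [cite: IchinoPrasanna2023Hodge, Thm 1 (ii) hypothesis, Remark 1.4 (separating model; bookkeeping)] -/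
abbrev canon₁₁₉noK : Consumers119 := canon₁₁₉W ν μ False True

/-- Every hundred-and-nineteenth-tranche edge holds in the parametrised reading over ANY tranche-61 assignment whose node has the value `s`, for arbitrary ν, μ and
every `k`. [cite: IchinoPrasanna2023Hodge, Thm 1; BertoloniMeliYoucis2023Characterization, Thm 4.2; AtobeGan2017RT, Thm 3.17 (bookkeeping proved here)] -/
theorem canon_implications₁₁₉W (k s : Prop) (c₆₁ : Consumers61) (hs : c₆₁.BMYScholzeShin ↔ s) : Implications119 ν μ c₆₁ (canon₁₁₉W ν μ k s) where
  ichinoPrasannaVoR_i := True.intro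
  ichinoPrasannaVoR_ii := fun h => h
  bmyVoR := fun m n => ⟨m, hs.1 n⟩
  atobeGanQSVoR := fun b => b

/-- The edges hold in the canonical instance over section 64's `canon₆₁`, for arbitrary ν, μ, κ. [cite: IchinoPrasanna2023Hodge, Thm 1; BertoloniMeliYoucis2023Characterization, Thm 4.2; AtobeGan2017RT, Thm 3.17 (bookkeeping proved here)] -/
theorem canon_implications₁₁₉ : Implications119 ν μ (canon₆₁ ν μ κ) (canon₁₁₉ ν μ) :=
  canon_implications₁₁₉W ν μ True True _ Iff.rfl

/-- The edges hold in the node-denied reading too (Theorem 1 (ii)'s edge vacuously). [cite: IchinoPrasanna2023Hodge, Thm 1 (ii) (bookkeeping proved here)] -/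
theorem canon_implications₁₁₉noK : Implications119 ν μ (canon₆₁ ν μ κ) (canon₁₁₉noK ν μ) :=
  canon_implications₁₁₉W ν μ False True _ Iff.rfl

end Canon119

/-- At the top (every input of the book's and Mok's DAGs; both nodes granted) all four statements hold — through the tranche's own `hundrednineteenth_of_inputs`. [cite: IchinoPrasanna2023Hodge, Thm 1; BertoloniMeliYoucis2023Characterization, Thm 4.2; AtobeGan2017RT, Thm 3.17 (bookkeeping proved here)] -/
theorem hundrednineteenth_holds_top :
    (canon₁₁₉ νtop μtop).IchinoPrasannaHodgeVoR_i ∧ (canon₁₁₉ νtop μtop).IchinoPrasannaHodgeVoR_ii ∧ (canon₁₁₉ νtop μtop).BMYCharacterizationVoR ∧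
      (canon₁₁₉ νtop μtop).AtobeGanQSVoR :=
  hundrednineteenth_of_inputs (canon_implications₁₁₉ νtop μtop κtop) bookInputs_top mokInputs_top True.intro True.intro

/-- FIRST READING (the node granted): for EVERY assignment of the book's and Mok's nodes, Theorem 1 (i) and Theorem 1 (ii) HOLD — neither consumes a leaf of the three
DAGs as printed in the version of record (the 2018 arXiv state, tranche 67's `IchinoPrasannaHodge`, consumed Mok, KMSW in full and a Galois node: section 70). [cite: IchinoPrasanna2023Hodge, Thm 1 (i), (ii), Remark 1.3 (bookkeeping proved here)] -/
theorem c119_partsI_II_granted (ν : Nodes) (μ : Mok2015.Nodes) :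
    (canon₁₁₉ ν μ).IchinoPrasannaHodgeVoR_i ∧ (canon₁₁₉ ν μ).IchinoPrasannaHodgeVoR_ii :=
  ⟨True.intro, True.intro⟩

/-- SECOND READING (the node denied): with `KottwitzGUHyp` false, Theorem 1 (ii) FAILS and Theorem 1 (i) HOLDS for every assignment, every edge valid — the node is the
whole support of part (ii) as typed. [cite: IchinoPrasanna2023Hodge, Thm 1 (ii) hypothesis, Remark 1.4 (separating model; bookkeeping proved here)] -/
theorem c119_node_denied (ν : Nodes) (μ : Mok2015.Nodes) (κ : KMSW2014.Nodes) :
    Implications119 ν μ (canon₆₁ ν μ κ) (canon₁₁₉noK ν μ) ∧ ¬ (canon₁₁₉noK ν μ).IchinoPrasannaHodgeVoR_ii ∧ (canon₁₁₉noK ν μ).IchinoPrasannaHodgeVoR_i :=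
  ⟨canon_implications₁₁₉noK ν μ κ, fun h => h, True.intro⟩

/-- BOOK SIDE, EXACT SUPPORT AS TYPED: in the book countermodel of ANY of the 24 leaves `l` (Mok at the top, nodes granted, every edge valid) B3's version-of-record
clauses FAIL (the book's `Everything`, `not_B_cm`) while Theorem 1 (i), (ii) and B54's Theorem 4.2 HOLD: ALL 24 leaves are load-bearing for `AtobeGanQSVoR`, none for
the three others. [cite: AtobeGan2017RT, §3.2 with Thm 3.17 (p0023:L4-8); IchinoPrasanna2023Hodge, Remark 1.3; BertoloniMeliYoucis2023Characterization, Thm 4.2 (bookkeeping proved here)] -/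
theorem c119_book_cm (l : LeafSupport.Leaf) :
    ¬ (LeafSupport.mkN (LeafSupport.cm l)).leaf l ∧
      Implications119 (LeafSupport.mkN (LeafSupport.cm l)) μtop (canon₆₁ (LeafSupport.mkN (LeafSupport.cm l)) μtop κtop) (canon₁₁₉ (LeafSupport.mkN (LeafSupport.cm l)) μtop) ∧
      ¬ (canon₁₁₉ (LeafSupport.mkN (LeafSupport.cm l)) μtop).AtobeGanQSVoR ∧
      ((canon₁₁₉ (LeafSupport.mkN (LeafSupport.cm l)) μtop).IchinoPrasannaHodgeVoR_i ∧ (canon₁₁₉ (LeafSupport.mkN (LeafSupport.cm l)) μtop).IchinoPrasannaHodgeVoR_ii ∧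
        (canon₁₁₉ (LeafSupport.mkN (LeafSupport.cm l)) μtop).BMYCharacterizationVoR) :=
  have cmod := LeafSupport.countermodel l
  ⟨cmod.2.2.1, canon_implications₁₁₉ _ _ _, not_B_cm l, ⟨True.intro, True.intro, ⟨mokInputs_top.everything, True.intro⟩⟩⟩

/-- MOK SIDE, EXACT SUPPORT AS TYPED: in the Mok countermodel of ANY of the 29 leaves `l` (book at the top, nodes granted, every edge valid) B54's Theorem 4.2 FAILS
(« as in [Mok15, Theorem 2.5.1] »: Mok's `Everything`, `not_M_cm`) while Theorem 1 (i), (ii) and B3's clauses HOLD: ALL 29 Mok leaves are load-bearing for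
`BMYCharacterizationVoR`, none for the others. [cite: BertoloniMeliYoucis2023Characterization, Thm 4.2 (p0008:L17-27); IchinoPrasanna2023Hodge, Remark 1.3 (bookkeeping proved here)] -/
theorem c119_mok_cm (l : Mok2015.LeafSupport.Leaf) :
    ¬ (Mok2015.LeafSupport.mkN (Mok2015.LeafSupport.cm l)).leaf l ∧
      Implications119 νtop (Mok2015.LeafSupport.mkN (Mok2015.LeafSupport.cm l)) (canon₆₁ νtop (Mok2015.LeafSupport.mkN (Mok2015.LeafSupport.cm l)) κtop)
        (canon₁₁₉ νtop (Mok2015.LeafSupport.mkN (Mok2015.LeafSupport.cm l))) ∧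
      ¬ (canon₁₁₉ νtop (Mok2015.LeafSupport.mkN (Mok2015.LeafSupport.cm l))).BMYCharacterizationVoR ∧
      ((canon₁₁₉ νtop (Mok2015.LeafSupport.mkN (Mok2015.LeafSupport.cm l))).IchinoPrasannaHodgeVoR_i ∧
        (canon₁₁₉ νtop (Mok2015.LeafSupport.mkN (Mok2015.LeafSupport.cm l))).IchinoPrasannaHodgeVoR_ii ∧
        (canon₁₁₉ νtop (Mok2015.LeafSupport.mkN (Mok2015.LeafSupport.cm l))).AtobeGanQSVoR) :=
  have cmod := Mok2015.LeafSupport.countermodel l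
  ⟨cmod.2.2.1, canon_implications₁₁₉ _ _ _, fun h => not_M_cm l h.1, ⟨True.intro, True.intro, bookInputs_top.everything⟩⟩

/-- KMSW SIDE: in KMSW's countermodel of ANY leaf `l'` — `MokMain` INCLUDED — with book and Mok at the top, every edge valid, ALL FOUR statements HOLD: KMSW does not
occur in the versions of record (B54's printed Theorem 4.2 is for unramified unitary groups and Mok's correspondence; C66's 2023 text keeps KMSW only as an alternative
route) — where tranche 61's `BMYCharacterization` and tranche 67's `IchinoPrasannaHodge` consumed KMSW's proved scope, resp. KMSW in full (sections 64 / 70). [cite: BertoloniMeliYoucis2023Characterization, Thm 4.2; IchinoPrasanna2023Hodge, Remark 1.3, §11.1 (bookkeeping proved here)] [claim: KalethaMinguezShinWhite2014, under-review] -/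
theorem c119_kmsw (l' : KMSW2014.LeafSupport.Leaf) :
    ¬ (KMSW2014.LeafSupport.mkN (KMSW2014.LeafSupport.cm l')).leaf l' ∧
      Implications119 νtop μtop (canon₆₁ νtop μtop (KMSW2014.LeafSupport.mkN (KMSW2014.LeafSupport.cm l'))) (canon₁₁₉ νtop μtop) ∧
      ((canon₁₁₉ νtop μtop).IchinoPrasannaHodgeVoR_i ∧ (canon₁₁₉ νtop μtop).IchinoPrasannaHodgeVoR_ii ∧ (canon₁₁₉ νtop μtop).BMYCharacterizationVoR ∧
        (canon₁₁₉ νtop μtop).AtobeGanQSVoR) :=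
  have cmod := KMSW2014.LeafSupport.countermodel l'
  ⟨cmod.2.2.1, canon_implications₁₁₉ _ _ _, hundrednineteenth_holds_top⟩

/-- THE HUNDRED-AND-NINETEENTH TRANCHE REGRADED, in one statement: (i) at the top all four hold; (ii) node granted: Theorem 1 (i), (ii) hold for every assignment; (iii)
node denied: Theorem 1 (ii) fails, (i) holds, every edge valid; (iv) in the book countermodel of any of the 24 leaves B3's clauses fail, the three others hold; (v) in
every Mok countermodel B54's Theorem 4.2 fails, the three others hold; (vi) in every KMSW leaf countermodel all four hold.  Supports (versions of record):
support(`IchinoPrasannaHodgeVoR_i`) = ∅; support(`IchinoPrasannaHodgeVoR_ii`) = the node `KottwitzGUHyp` alone, no leaf of the three DAGs; support(`BMYCharacterizationVoR`)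
= all 29 leaves of Mok's memoir ∧ the node `BMYScholzeShin`, NO KMSW leaf (tranche 61's arXiv-state field: Mok ∧ KMSW's proved scope ∧ the node);
support(`AtobeGanQSVoR`) = all 24 leaves of the book's DAG (as tranche 6's `AtobeGanEvenQS`). [cite: IchinoPrasanna2023Hodge, Thm 1; BertoloniMeliYoucis2023Characterization, Thm 4.2; AtobeGan2017RT, Thm 3.17 (bookkeeping proved here)] [claim: KalethaMinguezShinWhite2014, under-review] -/
theorem c119_regraded :
    ((canon₁₁₉ νtop μtop).IchinoPrasannaHodgeVoR_i ∧ (canon₁₁₉ νtop μtop).IchinoPrasannaHodgeVoR_ii ∧ (canon₁₁₉ νtop μtop).BMYCharacterizationVoR ∧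
        (canon₁₁₉ νtop μtop).AtobeGanQSVoR) ∧
      (∀ (ν : Nodes) (μ : Mok2015.Nodes), (canon₁₁₉ ν μ).IchinoPrasannaHodgeVoR_i ∧ (canon₁₁₉ ν μ).IchinoPrasannaHodgeVoR_ii) ∧
      (∀ (ν : Nodes) (μ : Mok2015.Nodes) (κ : KMSW2014.Nodes),
        Implications119 ν μ (canon₆₁ ν μ κ) (canon₁₁₉noK ν μ) ∧ ¬ (canon₁₁₉noK ν μ).IchinoPrasannaHodgeVoR_ii ∧ (canon₁₁₉noK ν μ).IchinoPrasannaHodgeVoR_i) ∧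
      (∀ l : LeafSupport.Leaf, ¬ (LeafSupport.mkN (LeafSupport.cm l)).leaf l ∧ ¬ (canon₁₁₉ (LeafSupport.mkN (LeafSupport.cm l)) μtop).AtobeGanQSVoR ∧
        (canon₁₁₉ (LeafSupport.mkN (LeafSupport.cm l)) μtop).BMYCharacterizationVoR) ∧
      (∀ l : Mok2015.LeafSupport.Leaf, ¬ (Mok2015.LeafSupport.mkN (Mok2015.LeafSupport.cm l)).leaf l ∧
        ¬ (canon₁₁₉ νtop (Mok2015.LeafSupport.mkN (Mok2015.LeafSupport.cm l))).BMYCharacterizationVoR ∧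
        (canon₁₁₉ νtop (Mok2015.LeafSupport.mkN (Mok2015.LeafSupport.cm l))).AtobeGanQSVoR) ∧
      (∀ l' : KMSW2014.LeafSupport.Leaf, ¬ (KMSW2014.LeafSupport.mkN (KMSW2014.LeafSupport.cm l')).leaf l' ∧ (canon₁₁₉ νtop μtop).BMYCharacterizationVoR) :=
  ⟨hundrednineteenth_holds_top,
    c119_partsI_II_granted,
    c119_node_denied,
    fun l => have h := c119_book_cm l
      ⟨h.1, h.2.2.1, h.2.2.2.2.2⟩,
    fun l => have h := c119_mok_cm l
      ⟨h.1, h.2.2.1, h.2.2.2.2.2⟩,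
    fun l' => have h := c119_kmsw l'
      ⟨h.1, h.2.2.2.2.1⟩⟩

/-! ## 123. Hundred-and-twentieth tranche (v1 of this file, after `Downstream35.lean` v3; unit `pub-arthur-down-g52`'s VERSIONS OF RECORD, II): support of row C248
Pitale – Saha – Schmidt, Ann. Math. Québec 45 (2021) through the version-of-record edge `E_PSSdeg5VoR` (Theorem 1.1 ⇐ row C180 `Consumers19.SchmidtParamodular` ALONE,
on tranche 99's existing fields). -/

section Canon120

variable (ν : Nodes) (μ : Mok2015.Nodes) (κ : KMSW2014.Nodes)

/-- The version-of-record edge holds in section 102's canonical reading `canon₉₉` of tranche 99 over section 22's `canon₁₉` (there C180 := everything the book establishes,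
and C248's Theorem 1.1 := that ∧ C180), for arbitrary ν, μ, κ: no new reading is needed — the VoR edge has FEWER premises than tranche 99's `E_PSSdeg5`, and in the
canonical reading its one premise already carries the book. [cite: PitaleSahaSchmidt2021StandardL, Thm 1.1, §7.1 (version of record); Schmidt2018Packet, Thm 2.6 (bookkeeping proved here)] -/
theorem canon_implications₁₂₀ : Implications120 (canon₁₉ ν μ κ) (canon₉₉ ν μ κ) where
  pssDeg5VoR := fun s => ⟨s, s⟩

/-- The edge also holds over the C180-DENIED reading `canon₁₉noC180` of section 31 (Theorem 1.1 := book ∧ `False`), vacuously. [cite: PitaleSahaSchmidt2021StandardL, §7.1 citing [49] (separating model; bookkeeping proved here)] -/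
theorem canon_implications₁₂₀noC180 : Implications120 (canon₁₉noC180 μ κ) (canon₉₉W ν (canon₁₉noC180 μ κ) (canon₂₂ ν μ κ)) where
  pssDeg5VoR := fun s => s.elim

end Canon120

/-- At the top both C248 statements hold through the version-of-record route — the tranche's own `pssVoR_of_leaves` fed by sections 102 / 22's canonical edges and
`bookInputs_top`. [cite: PitaleSahaSchmidt2021StandardL, Thms 1.1, 1.5 (bookkeeping proved here)] -/
theorem hundredtwentieth_holds_top : (canon₉₉ νtop μtop κtop).PSSdeg5 ∧ (canon₉₉ νtop μtop κtop).PSSsym4 :=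
  pssVoR_of_leaves (canon_implications₁₂₀ νtop μtop κtop) (canon_implications₉₉ νtop μtop κtop) (canon_implications₁₉ νtop μtop κtop) bookInputs_top

/-- BOOK SIDE, EXACT SUPPORT AS TYPED (unchanged by the version of record): in the book countermodel of ANY of the 24 leaves `l` every edge of tranches 19 / 99 / 120
holds and BOTH C248 statements FAIL — through C180's own dependence on the book (section 22: `SchmidtParamodular` := everything the book establishes). [cite: PitaleSahaSchmidt2021StandardL, §7.1 (p0034:L40-48); Schmidt2018Packet, §1 (bookkeeping proved here)] -/
theorem c120_book_cm (l : LeafSupport.Leaf) :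
    ¬ (LeafSupport.mkN (LeafSupport.cm l)).leaf l ∧
      Implications120 (canon₁₉ (LeafSupport.mkN (LeafSupport.cm l)) μtop κtop) (canon₉₉ (LeafSupport.mkN (LeafSupport.cm l)) μtop κtop) ∧
      Implications99 (LeafSupport.mkN (LeafSupport.cm l)) (canon₁₉ (LeafSupport.mkN (LeafSupport.cm l)) μtop κtop) (canon₂₂ (LeafSupport.mkN (LeafSupport.cm l)) μtop κtop)
        (canon₉₉ (LeafSupport.mkN (LeafSupport.cm l)) μtop κtop) ∧
      Implications19 (LeafSupport.mkN (LeafSupport.cm l)) μtop κtop (canon₁₉ (LeafSupport.mkN (LeafSupport.cm l)) μtop κtop) ∧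
      ¬ (canon₉₉ (LeafSupport.mkN (LeafSupport.cm l)) μtop κtop).PSSdeg5 ∧ ¬ (canon₉₉ (LeafSupport.mkN (LeafSupport.cm l)) μtop κtop).PSSsym4 :=
  have cmod := LeafSupport.countermodel l
  have n := not_B_cm l
  ⟨cmod.2.2.1, canon_implications₁₂₀ _ _ _, canon_implications₉₉ _ _ _, canon_implications₁₉ _ _ _, fun h => n h.1, fun h => n h.1⟩

/-- ROW C180 DENIED AT THE TOP (book, Mok, KMSW all at the top; every edge of tranches 99 / 120 valid over `canon₁₉noC180`): BOTH C248 statements FAIL — on the version of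
record C180 is the ONLY printed premise of Theorem 1.1, and it is load-bearing as typed. [cite: PitaleSahaSchmidt2021StandardL, §7.1 citing [49] = Schmidt, Trans. AMS 370 (2018) (separating model; bookkeeping proved here)] -/
theorem c120_C180_denied_top :
    Implications120 (canon₁₉noC180 μtop κtop) (canon₉₉W νtop (canon₁₉noC180 μtop κtop) (canon₂₂ νtop μtop κtop)) ∧
      Implications99 νtop (canon₁₉noC180 μtop κtop) (canon₂₂ νtop μtop κtop) (canon₉₉W νtop (canon₁₉noC180 μtop κtop) (canon₂₂ νtop μtop κtop)) ∧
      ¬ (canon₉₉W νtop (canon₁₉noC180 μtop κtop) (canon₂₂ νtop μtop κtop)).PSSdeg5 ∧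
      ¬ (canon₉₉W νtop (canon₁₉noC180 μtop κtop) (canon₂₂ νtop μtop κtop)).PSSsym4 :=
  ⟨canon_implications₁₂₀noC180 _ _ _, canon_implications₉₉W _ _ _, fun h => h.2, fun h => h.2⟩

/-- MOK SIDE: in the Mok countermodel of ANY of the 29 leaves (book and KMSW at the top) every edge holds and both statements HOLD — no Mok premise on either text state.
[cite: PitaleSahaSchmidt2021StandardL, Thm 1.1 (bookkeeping proved here)] -/
theorem c120_mok_cm (l : Mok2015.LeafSupport.Leaf) :
    ¬ (Mok2015.LeafSupport.mkN (Mok2015.LeafSupport.cm l)).leaf l ∧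
      Implications120 (canon₁₉ νtop (Mok2015.LeafSupport.mkN (Mok2015.LeafSupport.cm l)) κtop) (canon₉₉ νtop (Mok2015.LeafSupport.mkN (Mok2015.LeafSupport.cm l)) κtop) ∧
      (canon₉₉ νtop (Mok2015.LeafSupport.mkN (Mok2015.LeafSupport.cm l)) κtop).PSSdeg5 ∧ (canon₉₉ νtop (Mok2015.LeafSupport.mkN (Mok2015.LeafSupport.cm l)) κtop).PSSsym4 :=
  have cmod := Mok2015.LeafSupport.countermodel l
  have b : ∀ N, νtop.Everything N := bookInputs_top.everything
  ⟨cmod.2.2.1, canon_implications₁₂₀ _ _ _, ⟨b, b⟩, ⟨b, b⟩⟩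

/-- KMSW SIDE: in KMSW's countermodel of ANY leaf (book and Mok at the top) every edge holds and both statements HOLD — no KMSW premise. [cite: PitaleSahaSchmidt2021StandardL, Thm 1.1 (bookkeeping proved here)] [claim: KalethaMinguezShinWhite2014, under-review] -/
theorem c120_kmsw (l' : KMSW2014.LeafSupport.Leaf) :
    ¬ (KMSW2014.LeafSupport.mkN (KMSW2014.LeafSupport.cm l')).leaf l' ∧
      Implications120 (canon₁₉ νtop μtop (KMSW2014.LeafSupport.mkN (KMSW2014.LeafSupport.cm l'))) (canon₉₉ νtop μtop (KMSW2014.LeafSupport.mkN (KMSW2014.LeafSupport.cm l'))) ∧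
      (canon₉₉ νtop μtop (KMSW2014.LeafSupport.mkN (KMSW2014.LeafSupport.cm l'))).PSSdeg5 ∧
      (canon₉₉ νtop μtop (KMSW2014.LeafSupport.mkN (KMSW2014.LeafSupport.cm l'))).PSSsym4 :=
  have cmod := KMSW2014.LeafSupport.countermodel l'
  have b : ∀ N, νtop.Everything N := bookInputs_top.everything
  ⟨cmod.2.2.1, canon_implications₁₂₀ _ _ _, ⟨b, b⟩, ⟨b, b⟩⟩

/-- THE HUNDRED-AND-TWENTIETH TRANCHE REGRADED, in one statement: (i) at the top both C248 statements hold by the version-of-record route; (ii) in the book countermodel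
of ANY of the 24 leaves both fail, every edge of tranches 19 / 99 / 120 valid; (iii) C180 denied at the top: both fail, every edge valid; (iv) in every Mok countermodel
and (v) every KMSW leaf countermodel both hold.  Support (either text state): support(`PSSdeg5`) = support(`PSSsym4`) = ALL 24 leaves of the book's DAG, reached through
row C180 — on the arXiv text also directly (« [arthur-book, ralf-packets] »), on the version of record ONLY through C180 (section 102's verdict for tranche 99 stands;
what the version of record changes is the order of the citation, not the set of leaves). [cite: PitaleSahaSchmidt2021StandardL, Thms 1.1, 1.5, Remark 1.2 (arXiv) vs §7.1 (VoR) (bookkeeping proved here)] [claim: KalethaMinguezShinWhite2014, under-review] -/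
theorem c120_regraded :
    ((canon₉₉ νtop μtop κtop).PSSdeg5 ∧ (canon₉₉ νtop μtop κtop).PSSsym4) ∧
      (∀ l : LeafSupport.Leaf, ¬ (LeafSupport.mkN (LeafSupport.cm l)).leaf l ∧
        Implications120 (canon₁₉ (LeafSupport.mkN (LeafSupport.cm l)) μtop κtop) (canon₉₉ (LeafSupport.mkN (LeafSupport.cm l)) μtop κtop) ∧
        ¬ (canon₉₉ (LeafSupport.mkN (LeafSupport.cm l)) μtop κtop).PSSdeg5 ∧ ¬ (canon₉₉ (LeafSupport.mkN (LeafSupport.cm l)) μtop κtop).PSSsym4) ∧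
      (¬ (canon₉₉W νtop (canon₁₉noC180 μtop κtop) (canon₂₂ νtop μtop κtop)).PSSdeg5 ∧
        ¬ (canon₉₉W νtop (canon₁₉noC180 μtop κtop) (canon₂₂ νtop μtop κtop)).PSSsym4) ∧
      (∀ l : Mok2015.LeafSupport.Leaf, ¬ (Mok2015.LeafSupport.mkN (Mok2015.LeafSupport.cm l)).leaf l ∧
        (canon₉₉ νtop (Mok2015.LeafSupport.mkN (Mok2015.LeafSupport.cm l)) κtop).PSSdeg5) ∧
      (∀ l' : KMSW2014.LeafSupport.Leaf, ¬ (KMSW2014.LeafSupport.mkN (KMSW2014.LeafSupport.cm l')).leaf l' ∧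
        (canon₉₉ νtop μtop (KMSW2014.LeafSupport.mkN (KMSW2014.LeafSupport.cm l'))).PSSdeg5) :=
  ⟨hundredtwentieth_holds_top,
    fun l => have h := c120_book_cm l
      ⟨h.1, h.2.1, h.2.2.2.2.1, h.2.2.2.2.2⟩,
    ⟨c120_C180_denied_top.2.2.1, c120_C180_denied_top.2.2.2⟩,
    fun l => have h := c120_mok_cm l
      ⟨h.1, h.2.2.1⟩,
    fun l' => have h := c120_kmsw l'
      ⟨h.1, h.2.2.1⟩⟩


/-! ## 124. Hundred-and-twenty-first tranche (v2 of this file, after `Downstream35.lean` v4; unit `pub-arthur-down-g52`'s LATEST arXiv TEXT STATES, I): supports of the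
rewritten statements of row C291 Huang – Li – Müller – Ye v2 (`HLMYpicardOneV2` ⇐ row C99 `Consumers2.BLMM`), row C70 Horinaga – Maeda – Yamauchi v2 (`HMYBallQuotientsV2`
⇐ Mok ∧ KMSW in full) and row C276 H. Wang v3 (`HWangLevelLoweringV3` ⇐ row C191 `Consumers28.MokGSp4`). -/

section Canon121

variable (ν : Nodes) (μ : Mok2015.Nodes) (κ : KMSW2014.Nodes)

/-- The parametrised canonical reading of the hundred-and-twenty-first tranche: the assignments `c₂` of tranche 2 and `c₂₈` of tranche 28 are the parameters; C291 v2 := the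
value of row C99 `c₂.BLMM`; C70 v2 := Mok's `Everything` at every rank ∧ KMSW's starred statements in full at every rank; C276 v3 := the value of row C191 `c₂₈.MokGSp4`.
[cite: HuangEtAl2024BailyBorel, Thm 1.2 (v2); HorinagaMaedaYamauchi2025Kodaira, Thm 1.1 (v2); HWang2019LevelLowering, Thms 1-2 (v3) (canonical model; bookkeeping)] [claim: KalethaMinguezShinWhite2014, under-review] -/
abbrev canon₁₂₁W (c₂ : Consumers2) (c₂₈ : Consumers28) : Consumers121 where
  HLMYpicardOneV2 := c₂.BLMM
  HMYBallQuotientsV2 := (∀ N, μ.Everything N) ∧ (∀ N, κ.Full N)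
  HWangLevelLoweringV3 := c₂₈.MokGSp4

/-- The canonical instance over the first support file's `canon₂` (C99 := everything the book establishes) and section 31's `canon₂₈` (C191 := that ∧ row A4's value).
[cite: BergeronEtAl2016, Thm 1.5; Mok2014Compositio, Thm 4.14 (canonical model; bookkeeping)] -/
abbrev canon₁₂₁ : Consumers121 := canon₁₂₁W μ κ (canon₂ ν μ κ) (canon₂₈ ν μ κ)

/-- Every hundred-and-twenty-first-tranche edge holds in the parametrised reading, for arbitrary μ, κ and EVERY assignment of tranches 2 / 28. [cite: HuangEtAl2024BailyBorel, Thm 1.2; HorinagaMaedaYamauchi2025Kodaira, Thm 1.1; HWang2019LevelLowering, Thms 1-2 (bookkeeping proved here)] [claim: KalethaMinguezShinWhite2014, under-review] -/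
theorem canon_implications₁₂₁W (c₂ : Consumers2) (c₂₈ : Consumers28) : Implications121 μ κ c₂ c₂₈ (canon₁₂₁W μ κ c₂ c₂₈) where
  hlmyV2 := fun h => h
  hmyV2 := fun m f => ⟨m, f⟩
  hwangV3 := fun h => h

/-- The edges hold in the canonical instance, for arbitrary ν, μ, κ. [cite: HuangEtAl2024BailyBorel, Thm 1.2; HorinagaMaedaYamauchi2025Kodaira, Thm 1.1; HWang2019LevelLowering, Thms 1-2 (bookkeeping proved here)] [claim: KalethaMinguezShinWhite2014, under-review] -/
theorem canon_implications₁₂₁ : Implications121 μ κ (canon₂ ν μ κ) (canon₂₈ ν μ κ) (canon₁₂₁ ν μ κ) :=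
  canon_implications₁₂₁W μ κ _ _

end Canon121

/-- At the top (every input of the three DAGs, KMSW's two sequels included) all three rewritten statements hold — through the tranche's own `hundredtwentyfirst_of_inputs` fed by
the first support file's `canon_implications` / `canon_implications₂`, section 31's `canon_implications₂₈`, `bookInputs_top`, `mokInputs_top`, `kmswInputs_top`. [cite: HuangEtAl2024BailyBorel, Thm 1.2; HorinagaMaedaYamauchi2025Kodaira, Thm 1.1; HWang2019LevelLowering, Thms 1-2 (bookkeeping proved here)] [claim: KalethaMinguezShinWhite2014, under-review] -/
theorem hundredtwentyfirst_holds_top :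
    (canon₁₂₁ νtop μtop κtop).HLMYpicardOneV2 ∧ (canon₁₂₁ νtop μtop κtop).HMYBallQuotientsV2 ∧ (canon₁₂₁ νtop μtop κtop).HWangLevelLoweringV3 :=
  have KQ := kmswInputs_top μtop
  hundredtwentyfirst_of_inputs (canon_implications₁₂₁ νtop μtop κtop) (canon_implications νtop μtop κtop) (canon_implications₂ νtop μtop κtop)
    (canon_implications₂₈ νtop μtop κtop) bookInputs_top mokInputs_top KQ.1 KQ.2

/-- BOOK SIDE, EXACT SUPPORT AS TYPED: in the book countermodel of ANY of the 24 leaves `l` (Mok and KMSW at the top; tranches 1 / 2 / 28 / 121 read canonically, every edge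
valid) C291 v2 and C276 v3 FAIL (through C99, resp. C191: everything the book establishes, `not_B_cm`) and C70 v2 HOLDS (Mok ∧ KMSW in full, both at the top): ALL 24 book
leaves are load-bearing for `HLMYpicardOneV2` and `HWangLevelLoweringV3`, none for `HMYBallQuotientsV2`. [cite: HuangEtAl2024BailyBorel, Thm 1.2 with BergeronEtAl2016 Thm 1.5; HWang2019LevelLowering, Thms 1-2 with Mok2014Compositio Thm 4.14; HorinagaMaedaYamauchi2025Kodaira, Thm 1.1 (bookkeeping proved here)] [claim: KalethaMinguezShinWhite2014, under-review] -/
theorem c121_book_cm (l : LeafSupport.Leaf) :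
    ¬ (LeafSupport.mkN (LeafSupport.cm l)).leaf l ∧
      Implications121 μtop κtop (canon₂ (LeafSupport.mkN (LeafSupport.cm l)) μtop κtop) (canon₂₈ (LeafSupport.mkN (LeafSupport.cm l)) μtop κtop)
        (canon₁₂₁ (LeafSupport.mkN (LeafSupport.cm l)) μtop κtop) ∧
      Implications28 (LeafSupport.mkN (LeafSupport.cm l)) μtop κtop (canon (LeafSupport.mkN (LeafSupport.cm l)) μtop κtop)
        (canon₁₉ (LeafSupport.mkN (LeafSupport.cm l)) μtop κtop) (canon₂₈ (LeafSupport.mkN (LeafSupport.cm l)) μtop κtop) ∧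
      (¬ (canon₁₂₁ (LeafSupport.mkN (LeafSupport.cm l)) μtop κtop).HLMYpicardOneV2 ∧ ¬ (canon₁₂₁ (LeafSupport.mkN (LeafSupport.cm l)) μtop κtop).HWangLevelLoweringV3) ∧
      (canon₁₂₁ (LeafSupport.mkN (LeafSupport.cm l)) μtop κtop).HMYBallQuotientsV2 :=
  have cmod := LeafSupport.countermodel l
  have n := not_B_cm l
  have KQ := kmswInputs_top μtop
  have f : ∀ N, κtop.Full N := KQ.1.full mokInputs_top KQ.2
  ⟨cmod.2.2.1, canon_implications₁₂₁W _ _ _ _, canon_implications₂₈ _ _ _, ⟨n, fun h => n h.1⟩, ⟨mokInputs_top.everything, f⟩⟩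

/-- THE TYPED PREMISES ARE LOAD-BEARING EXACTLY AS TYPED (reading-level separation at the top): (a) ROW C99 DENIED (section 113's `c₂noBLMM`; C191 at its top value) ⇒ C291 v2
FAILS, C276 v3 and C70 v2 HOLD, every edge valid; (b) ROW C191 DENIED (section 31's `canon₂₈noC191`; C99 at its top value) ⇒ C276 v3 FAILS, C291 v2 and C70 v2 HOLD, every
edge valid. [cite: HuangEtAl2024BailyBorel, p0002:L39-40, p0022:L11-14 (v2); HWang2019LevelLowering, Rem. 30 (separating models; bookkeeping proved here)] [claim: KalethaMinguezShinWhite2014, under-review] -/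
theorem c121_rows_denied_top :
    (Implications121 μtop κtop c₂noBLMM (canon₂₈ νtop μtop κtop) (canon₁₂₁W μtop κtop c₂noBLMM (canon₂₈ νtop μtop κtop)) ∧
        ¬ (canon₁₂₁W μtop κtop c₂noBLMM (canon₂₈ νtop μtop κtop)).HLMYpicardOneV2 ∧
        (canon₁₂₁W μtop κtop c₂noBLMM (canon₂₈ νtop μtop κtop)).HWangLevelLoweringV3 ∧ (canon₁₂₁W μtop κtop c₂noBLMM (canon₂₈ νtop μtop κtop)).HMYBallQuotientsV2) ∧
      (Implications121 μtop κtop (canon₂ νtop μtop κtop) (canon₂₈noC191 νtop μtop κtop) (canon₁₂₁W μtop κtop (canon₂ νtop μtop κtop) (canon₂₈noC191 νtop μtop κtop)) ∧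
        ¬ (canon₁₂₁W μtop κtop (canon₂ νtop μtop κtop) (canon₂₈noC191 νtop μtop κtop)).HWangLevelLoweringV3 ∧
        (canon₁₂₁W μtop κtop (canon₂ νtop μtop κtop) (canon₂₈noC191 νtop μtop κtop)).HLMYpicardOneV2 ∧
        (canon₁₂₁W μtop κtop (canon₂ νtop μtop κtop) (canon₂₈noC191 νtop μtop κtop)).HMYBallQuotientsV2) :=
  have b : ∀ N, νtop.Everything N := bookInputs_top.everything
  have KQ := kmswInputs_top μtop
  have f : ∀ N, κtop.Full N := KQ.1.full mokInputs_top KQ.2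
  have mf : (∀ N, μtop.Everything N) ∧ (∀ N, κtop.Full N) := ⟨mokInputs_top.everything, f⟩
  ⟨⟨canon_implications₁₂₁W _ _ _ _, fun h => h, ⟨b, b⟩, mf⟩, ⟨canon_implications₁₂₁W _ _ _ _, fun h => h, b, mf⟩⟩

/-- MOK SIDE, EXACT SUPPORT AS TYPED: in the Mok countermodel of ANY of the 29 leaves `l` (book at the top; KMSW WITHOUT its Mok import, `κnoMok`) every edge holds; C70 v2 FAILS
(Mok's `Everything`, `not_M_cm`); C291 v2 and C276 v3 HOLD (book only, through C99 / C191 and row A4): ALL 29 Mok leaves are load-bearing for `HMYBallQuotientsV2`, none for the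
two others. [cite: HorinagaMaedaYamauchi2025Kodaira, Rem. 5.9 (v2, p0022:L7-11); HuangEtAl2024BailyBorel, Thm 1.2; HWang2019LevelLowering, Thms 1-2 (bookkeeping proved here)] [claim: KalethaMinguezShinWhite2014, under-review] -/
theorem c121_mok_cm (l : Mok2015.LeafSupport.Leaf) :
    ¬ (Mok2015.LeafSupport.mkN (Mok2015.LeafSupport.cm l)).leaf l ∧
      Implications121 (Mok2015.LeafSupport.mkN (Mok2015.LeafSupport.cm l)) κnoMok (canon₂ νtop (Mok2015.LeafSupport.mkN (Mok2015.LeafSupport.cm l)) κnoMok)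
        (canon₂₈ νtop (Mok2015.LeafSupport.mkN (Mok2015.LeafSupport.cm l)) κnoMok) (canon₁₂₁ νtop (Mok2015.LeafSupport.mkN (Mok2015.LeafSupport.cm l)) κnoMok) ∧
      ¬ (canon₁₂₁ νtop (Mok2015.LeafSupport.mkN (Mok2015.LeafSupport.cm l)) κnoMok).HMYBallQuotientsV2 ∧
      ((canon₁₂₁ νtop (Mok2015.LeafSupport.mkN (Mok2015.LeafSupport.cm l)) κnoMok).HLMYpicardOneV2 ∧
        (canon₁₂₁ νtop (Mok2015.LeafSupport.mkN (Mok2015.LeafSupport.cm l)) κnoMok).HWangLevelLoweringV3) :=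
  have cmod := Mok2015.LeafSupport.countermodel l
  have b : ∀ N, νtop.Everything N := bookInputs_top.everything
  ⟨cmod.2.2.1, canon_implications₁₂₁W _ _ _ _, fun h => not_M_cm l h.1, ⟨b, ⟨b, b⟩⟩⟩

/-- KMSW SIDE, EXACT SUPPORT AS TYPED: in KMSW's countermodel of ANY of its 14 leaves `l'` — the two unwritten sequels `KMS_A` / `KMS_B` and `AubertSS` INCLUDED — with book and
Mok at the top, every edge holds; C70 v2 FAILS (KMSW's starred Theorem 1.7.1 in full fails at every rank in every leaf countermodel); C291 v2 and C276 v3 HOLD: ALL 14 KMSW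
leaves are load-bearing for `HMYBallQuotientsV2` — v2's Remark 5.9 « most of the required results have now been established in [AGI+24] » notwithstanding, the typed
premise is KMSW in full, sequels and all (as for v1, section 71). [cite: HorinagaMaedaYamauchi2025Kodaira, Thm 1.1, Rem. 5.9 (v2) (bookkeeping proved here)] [claim: KalethaMinguezShinWhite2014, under-review] -/
theorem c121_kmsw_cm (l' : KMSW2014.LeafSupport.Leaf) :
    ¬ (KMSW2014.LeafSupport.mkN (KMSW2014.LeafSupport.cm l')).leaf l' ∧
      Implications121 μtop (KMSW2014.LeafSupport.mkN (KMSW2014.LeafSupport.cm l')) (canon₂ νtop μtop (KMSW2014.LeafSupport.mkN (KMSW2014.LeafSupport.cm l')))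
        (canon₂₈ νtop μtop (KMSW2014.LeafSupport.mkN (KMSW2014.LeafSupport.cm l'))) (canon₁₂₁ νtop μtop (KMSW2014.LeafSupport.mkN (KMSW2014.LeafSupport.cm l'))) ∧
      ¬ (canon₁₂₁ νtop μtop (KMSW2014.LeafSupport.mkN (KMSW2014.LeafSupport.cm l'))).HMYBallQuotientsV2 ∧
      ((canon₁₂₁ νtop μtop (KMSW2014.LeafSupport.mkN (KMSW2014.LeafSupport.cm l'))).HLMYpicardOneV2 ∧
        (canon₁₂₁ νtop μtop (KMSW2014.LeafSupport.mkN (KMSW2014.LeafSupport.cm l'))).HWangLevelLoweringV3) :=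
  have cmod := KMSW2014.LeafSupport.countermodel l'
  have b : ∀ N, νtop.Everything N := bookInputs_top.everything
  have nf : ¬ ∀ N, (KMSW2014.LeafSupport.mkN (KMSW2014.LeafSupport.cm l')).Full N :=
    fun h => KMSW2014.LeafSupport.not_full_of_noFull (cmod.2.2.2 0) (h 0)
  ⟨cmod.2.2.1, canon_implications₁₂₁W _ _ _ _, fun h => nf h.2, ⟨b, ⟨b, b⟩⟩⟩

/-- THE HUNDRED-AND-TWENTY-FIRST TRANCHE REGRADED, in one statement: (i) at the top all three rewritten statements hold; (ii) in the book countermodel of ANY of the 24 leaves C291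
v2 and C276 v3 fail, C70 v2 holds; (iii) C99 denied: only C291 v2 fails; C191 denied: only C276 v3 fails; (iv) in every Mok countermodel and (v) in every KMSW leaf countermodel
C70 v2 fails and the two others hold.  Supports — UNCHANGED by the rewrites (sections 114, 71, 111 for the v1 / v1 / v1–v2 fields): support(`HLMYpicardOneV2`) = all 24 book
leaves through C99, no Mok / KMSW leaf; support(`HWangLevelLoweringV3`) = all 24 book leaves through C191 (and A4), no Mok / KMSW leaf; support(`HMYBallQuotientsV2`) = all 29
Mok leaves ∧ all 14 KMSW leaves (the two unwritten sequels included), no book leaf. [cite: HuangEtAl2024BailyBorel, Thm 1.2; HorinagaMaedaYamauchi2025Kodaira, Thm 1.1; HWang2019LevelLowering, Thms 1-2 (bookkeeping proved here)] [claim: KalethaMinguezShinWhite2014, under-review] -/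
theorem c121_regraded :
    ((canon₁₂₁ νtop μtop κtop).HLMYpicardOneV2 ∧ (canon₁₂₁ νtop μtop κtop).HMYBallQuotientsV2 ∧ (canon₁₂₁ νtop μtop κtop).HWangLevelLoweringV3) ∧
      (∀ l : LeafSupport.Leaf, ¬ (LeafSupport.mkN (LeafSupport.cm l)).leaf l ∧
        ¬ (canon₁₂₁ (LeafSupport.mkN (LeafSupport.cm l)) μtop κtop).HLMYpicardOneV2 ∧ ¬ (canon₁₂₁ (LeafSupport.mkN (LeafSupport.cm l)) μtop κtop).HWangLevelLoweringV3 ∧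
        (canon₁₂₁ (LeafSupport.mkN (LeafSupport.cm l)) μtop κtop).HMYBallQuotientsV2) ∧
      (¬ (canon₁₂₁W μtop κtop c₂noBLMM (canon₂₈ νtop μtop κtop)).HLMYpicardOneV2 ∧ (canon₁₂₁W μtop κtop c₂noBLMM (canon₂₈ νtop μtop κtop)).HWangLevelLoweringV3) ∧
      (¬ (canon₁₂₁W μtop κtop (canon₂ νtop μtop κtop) (canon₂₈noC191 νtop μtop κtop)).HWangLevelLoweringV3 ∧
        (canon₁₂₁W μtop κtop (canon₂ νtop μtop κtop) (canon₂₈noC191 νtop μtop κtop)).HLMYpicardOneV2) ∧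
      (∀ l : Mok2015.LeafSupport.Leaf, ¬ (Mok2015.LeafSupport.mkN (Mok2015.LeafSupport.cm l)).leaf l ∧
        ¬ (canon₁₂₁ νtop (Mok2015.LeafSupport.mkN (Mok2015.LeafSupport.cm l)) κnoMok).HMYBallQuotientsV2 ∧
        (canon₁₂₁ νtop (Mok2015.LeafSupport.mkN (Mok2015.LeafSupport.cm l)) κnoMok).HLMYpicardOneV2) ∧
      (∀ l' : KMSW2014.LeafSupport.Leaf, ¬ (KMSW2014.LeafSupport.mkN (KMSW2014.LeafSupport.cm l')).leaf l' ∧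
        ¬ (canon₁₂₁ νtop μtop (KMSW2014.LeafSupport.mkN (KMSW2014.LeafSupport.cm l'))).HMYBallQuotientsV2 ∧
        (canon₁₂₁ νtop μtop (KMSW2014.LeafSupport.mkN (KMSW2014.LeafSupport.cm l'))).HWangLevelLoweringV3) :=
  ⟨hundredtwentyfirst_holds_top,
    fun l => have h := c121_book_cm l
      ⟨h.1, h.2.2.2.1.1, h.2.2.2.1.2, h.2.2.2.2⟩,
    ⟨c121_rows_denied_top.1.2.1, c121_rows_denied_top.1.2.2.1⟩,
    ⟨c121_rows_denied_top.2.2.1, c121_rows_denied_top.2.2.2.1⟩,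
    fun l => have h := c121_mok_cm l
      ⟨h.1, h.2.2.1, h.2.2.2.1⟩,
    fun l' => have h := c121_kmsw_cm l'
      ⟨h.1, h.2.2.1, h.2.2.2.2⟩⟩


/-! ## 125. Hundred-and-twenty-second tranche (v2 of this file, after `Downstream35.lean` v5; unit `pub-arthur-down-g52`'s LATEST arXiv TEXT STATES, II): supports of row B107
Liu – Shahidi v2 (`LiuShahidiJiangV2` ⇐ the book; `LiuShahidiLargeP` ⇐ book ∧ it ∧ row B14 `Consumers40.AtobeCiubotaruWF` — the NEW edge B14 → B107; `LiuShahidi113V2` ⇐ book ∧ it ∧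
row B26's `Consumers42.HLLSunipQS`) and of row B100 Hazeltine – Jiang – Liu – Lo – Zhang v4 (`HJLLZv4` ⇐ book ∧ C168 ∧ B75 ∧ B5 ∧ B101 ∧ B43 ∧ B38 ∧ B99 ∧ B35; `HJLLZv4incl` ⇐
book ∧ C168 ∧ B23). -/

section Canon122

variable (ν : Nodes) (μ : Mok2015.Nodes) (κ : KMSW2014.Nodes)

/-- The parametrised canonical reading of the hundred-and-twenty-second tranche: the assignments of tranches 45 / 5 / 25 / 26 / 33 / 40 / 42 / 54 / 63 are the parameters;
each statement := the conjunction its edge receives (the book at every rank ∧ the values of the rows it cites; `LiuShahidiLargeP` and `LiuShahidi113V2` receive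
`LiuShahidiJiangV2` = the book again). [cite: LiuShahidi2026Jiang, Thm 1.9 (1)-(3), Thm 1.13 (arXiv v2); HazeltineEtAl2024, Thm 1.2 / Algorithm 8.5, Thm 5.11 (arXiv v4) (canonical model; bookkeeping)] -/
abbrev canon₁₂₂W (c₄₅ : Consumers45) (c₅ : Consumers5) (c₂₅ : Consumers25) (c₂₆ : Consumers26) (c₃₃ : Consumers33) (c₄₀ : Consumers40) (c₄₂ : Consumers42)
    (c₅₄ : Consumers54) (c₆₃ : Consumers63) : Consumers122 where
  LiuShahidiJiangV2 := ∀ N, ν.Everything N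
  LiuShahidiLargeP := (∀ N, ν.Everything N) ∧ (∀ N, ν.Everything N) ∧ c₄₀.AtobeCiubotaruWF
  LiuShahidi113V2 := (∀ N, ν.Everything N) ∧ (∀ N, ν.Everything N) ∧ c₄₂.HLLSunipQS
  HJLLZv4 := (∀ N, ν.Everything N) ∧ c₅₄.MoeglinImage ∧ c₄₅.MoeglinMult1 ∧ c₅.AtobeApackets ∧ c₂₆.HLL ∧ c₃₃.AtobeDerivatives ∧ c₃₃.AtobeSocles ∧ c₂₅.BosnjakStadler ∧
    c₃₃.AtobeMinguezUnitary
  HJLLZv4incl := (∀ N, ν.Everything N) ∧ c₅₄.MoeglinImage ∧ c₆₃.HJLLZComplementary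

/-- The canonical instance over sections 48 / 8 / 28 / 29 / 36 / 43 / 45 / 57 / 66's readings of the cited rows. [cite: LiuShahidi2026Jiang, Thm 1.9 (v2); HazeltineEtAl2024, Thm 1.2 (v4) (canonical model; bookkeeping)] -/
abbrev canon₁₂₂ : Consumers122 :=
  canon₁₂₂W ν (canon₄₅ ν) (canon₅ ν μ κ) (canon₂₅ ν μ κ) (canon₂₆ ν μ κ) (canon₃₃ ν μ κ) (canon₄₀ ν μ κ) (canon₄₂ ν μ κ) (canon₅₄ ν) (canon₆₃ ν μ κ)

/-- Every hundred-and-twenty-second-tranche edge holds in the parametrised reading, for arbitrary ν and EVERY assignment of the nine cited tranches. [cite: LiuShahidi2026Jiang, Thm 1.9, Thm 1.13 (v2); HazeltineEtAl2024, Thm 1.2, Thm 5.11 (v4) (bookkeeping proved here)] -/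
theorem canon_implications₁₂₂W (c₄₅ : Consumers45) (c₅ : Consumers5) (c₂₅ : Consumers25) (c₂₆ : Consumers26) (c₃₃ : Consumers33) (c₄₀ : Consumers40)
    (c₄₂ : Consumers42) (c₅₄ : Consumers54) (c₆₃ : Consumers63) :
    Implications122 ν c₄₅ c₅ c₂₅ c₂₆ c₃₃ c₄₀ c₄₂ c₅₄ c₆₃ (canon₁₂₂W ν c₄₅ c₅ c₂₅ c₂₆ c₃₃ c₄₀ c₄₂ c₅₄ c₆₃) where
  lsV2 := fun b => b
  lsLargeP := fun b j a => ⟨b, j, a⟩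
  ls113V2 := fun b j u => ⟨b, j, u⟩
  hjllzV4 := fun b i m a h d s bs am => ⟨b, i, m, a, h, d, s, bs, am⟩
  hjllzV4incl := fun b i c => ⟨b, i, c⟩

/-- The edges hold in the canonical instance, for arbitrary ν, μ, κ. [cite: LiuShahidi2026Jiang, Thm 1.9 (v2); HazeltineEtAl2024, Thm 1.2 (v4) (bookkeeping proved here)] -/
theorem canon_implications₁₂₂ :
    Implications122 ν (canon₄₅ ν) (canon₅ ν μ κ) (canon₂₅ ν μ κ) (canon₂₆ ν μ κ) (canon₃₃ ν μ κ) (canon₄₀ ν μ κ) (canon₄₂ ν μ κ) (canon₅₄ ν) (canon₆₃ ν μ κ)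
      (canon₁₂₂ ν μ κ) :=
  canon_implications₁₂₂W ν _ _ _ _ _ _ _ _ _

end Canon122

/-- At the top (every input of the book's DAG; Mok and KMSW at the top, read only through tranche 40's quasi-split node) all five statements hold — through the tranche's own
`hundredtwentysecond_of_inputs` fed by the cited rows' top values (sections 43, 45, 57, 48, 8, 29, 36, 28, 66: `fortieth_holds_top`, `fortysecond_holds_top`,
`fiftyfourth_holds_top`, `fortyfifth_holds_top`, `twentysixth_holds_top`, `thirtythird_holds_top`, `twentyfifth_holds_top`, `sixtythird_holds_top`). [cite: LiuShahidi2026Jiang, Thm 1.9, Thm 1.13 (v2); HazeltineEtAl2024, Thm 1.2, Thm 5.11 (v4) (bookkeeping proved here)] -/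
theorem hundredtwentysecond_holds_top :
    ((canon₁₂₂ νtop μtop κtop).LiuShahidiJiangV2 ∧ (canon₁₂₂ νtop μtop κtop).LiuShahidiLargeP ∧ (canon₁₂₂ νtop μtop κtop).LiuShahidi113V2) ∧
      ((canon₁₂₂ νtop μtop κtop).HJLLZv4 ∧ (canon₁₂₂ νtop μtop κtop).HJLLZv4incl) :=
  have b : ∀ N, νtop.Everything N := bookInputs_top.everything
  hundredtwentysecond_of_inputs (canon_implications₁₂₂ νtop μtop κtop) b fortieth_holds_top.2.2 fortysecond_holds_top.1 fiftyfourth_holds_top.1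
    fortyfifth_holds_top.2.2.1 b twentysixth_holds_top.1.2.1 thirtythird_holds_top.1.2.2.1 thirtythird_holds_top.1.1 twentyfifth_holds_top.1.2.2.2.1
    thirtythird_holds_top.1.2.2.2.2 sixtythird_holds_top.2.1

/-- BOOK SIDE, EXACT SUPPORT AS TYPED: in the book countermodel of ANY of the 24 leaves `l` (Mok and KMSW at the top; the nine cited tranches read canonically, every edge valid)
ALL FIVE statements FAIL (each receives the book at every rank, `not_B_cm`): ALL 24 book leaves are load-bearing for B107's three v2 statements and B100's two v4 statements.
[cite: LiuShahidi2026Jiang, Thm 1.9 (v2, p0006:L32); HazeltineEtAl2024, Thm 1.2 (v4) (bookkeeping proved here)] -/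
theorem c122_book_cm (l : LeafSupport.Leaf) :
    ¬ (LeafSupport.mkN (LeafSupport.cm l)).leaf l ∧
      Implications122 (LeafSupport.mkN (LeafSupport.cm l)) (canon₄₅ (LeafSupport.mkN (LeafSupport.cm l))) (canon₅ (LeafSupport.mkN (LeafSupport.cm l)) μtop κtop) (canon₂₅ (LeafSupport.mkN (LeafSupport.cm l)) μtop κtop) (canon₂₆ (LeafSupport.mkN (LeafSupport.cm l)) μtop κtop) (canon₃₃ (LeafSupport.mkN (LeafSupport.cm l)) μtop κtop) (canon₄₀ (LeafSupport.mkN (LeafSupport.cm l)) μtop κtop)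
        (canon₄₂ (LeafSupport.mkN (LeafSupport.cm l)) μtop κtop) (canon₅₄ (LeafSupport.mkN (LeafSupport.cm l))) (canon₆₃ (LeafSupport.mkN (LeafSupport.cm l)) μtop κtop) (canon₁₂₂ (LeafSupport.mkN (LeafSupport.cm l)) μtop κtop) ∧
      (¬ (canon₁₂₂ (LeafSupport.mkN (LeafSupport.cm l)) μtop κtop).LiuShahidiJiangV2 ∧ ¬ (canon₁₂₂ (LeafSupport.mkN (LeafSupport.cm l)) μtop κtop).LiuShahidiLargeP ∧ ¬ (canon₁₂₂ (LeafSupport.mkN (LeafSupport.cm l)) μtop κtop).LiuShahidi113V2 ∧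
        ¬ (canon₁₂₂ (LeafSupport.mkN (LeafSupport.cm l)) μtop κtop).HJLLZv4 ∧ ¬ (canon₁₂₂ (LeafSupport.mkN (LeafSupport.cm l)) μtop κtop).HJLLZv4incl) :=
  have cmod := LeafSupport.countermodel l
  have n := not_B_cm l
  ⟨cmod.2.2.1, canon_implications₁₂₂ _ _ _, ⟨n, fun h => n h.1, fun h => n h.1, fun h => n h.1, fun h => n h.1⟩⟩

/-- Row B14 DENIED at the top: the assignment of tranche 40 with `AtobeCiubotaruWF := False`, every other fortieth-tranche field at its canonical top value. [cite: AtobeCiubotaru2026Wavefront, Thm 1.4 (separating model; bookkeeping)] -/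
abbrev c₄₀noB14 : Consumers40 := { canon₄₀ νtop μtop κtop with AtobeCiubotaruWF := False }

/-- Row C168 DENIED at the top: the assignment of tranche 54 with `MoeglinImage := False`, every other fifty-fourth-tranche field at its canonical top value. [cite: Moeglin2011Image, Thm (separating model; bookkeeping)] -/
abbrev c₅₄noC168 : Consumers54 := { canon₅₄ νtop with MoeglinImage := False }

/-- THE NEW PREMISES ARE LOAD-BEARING EXACTLY AS TYPED (reading-level separation at the top, every edge valid): (a) ROW B14 DENIED (`c₄₀noB14`, every other row at its top value) ⇒
`LiuShahidiLargeP` FAILS while B107's two other v2 statements and B100's two HOLD — the NEW edge B14 → B107 of v2 (« directly implied by [AC26, Theorem 1.4(2)] »); (b) ROW C168 DENIED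
(`c₅₄noC168`) ⇒ B100's `HJLLZv4` and `HJLLZv4incl` FAIL while B107's three HOLD. [cite: LiuShahidi2026Jiang, Thm 1.9 (2) (v2); HazeltineEtAl2024, Thm 5.11 (v4) (separating models; bookkeeping proved here)] -/
theorem c122_rows_denied_top :
    (Implications122 νtop (canon₄₅ νtop) (canon₅ νtop μtop κtop) (canon₂₅ νtop μtop κtop) (canon₂₆ νtop μtop κtop) (canon₃₃ νtop μtop κtop) c₄₀noB14 (canon₄₂ νtop μtop κtop)
          (canon₅₄ νtop) (canon₆₃ νtop μtop κtop) (canon₁₂₂W νtop (canon₄₅ νtop) (canon₅ νtop μtop κtop) (canon₂₅ νtop μtop κtop) (canon₂₆ νtop μtop κtop) (canon₃₃ νtop μtop κtop) c₄₀noB14 (canon₄₂ νtop μtop κtop) (canon₅₄ νtop) (canon₆₃ νtop μtop κtop)) ∧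
        ¬ (canon₁₂₂W νtop (canon₄₅ νtop) (canon₅ νtop μtop κtop) (canon₂₅ νtop μtop κtop) (canon₂₆ νtop μtop κtop) (canon₃₃ νtop μtop κtop) c₄₀noB14 (canon₄₂ νtop μtop κtop) (canon₅₄ νtop) (canon₆₃ νtop μtop κtop)).LiuShahidiLargeP ∧ (canon₁₂₂W νtop (canon₄₅ νtop) (canon₅ νtop μtop κtop) (canon₂₅ νtop μtop κtop) (canon₂₆ νtop μtop κtop) (canon₃₃ νtop μtop κtop) c₄₀noB14 (canon₄₂ νtop μtop κtop) (canon₅₄ νtop) (canon₆₃ νtop μtop κtop)).LiuShahidiJiangV2 ∧ (canon₁₂₂W νtop (canon₄₅ νtop) (canon₅ νtop μtop κtop) (canon₂₅ νtop μtop κtop) (canon₂₆ νtop μtop κtop) (canon₃₃ νtop μtop κtop) c₄₀noB14 (canon₄₂ νtop μtop κtop) (canon₅₄ νtop) (canon₆₃ νtop μtop κtop)).LiuShahidi113V2 ∧ (canon₁₂₂W νtop (canon₄₅ νtop) (canon₅ νtop μtop κtop) (canon₂₅ νtop μtop κtop) (canon₂₆ νtop μtop κtop) (canon₃₃ νtop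 μtop κtop) c₄₀noB14 (canon₄₂ νtop μtop κtop) (canon₅₄ νtop) (canon₆₃ νtop μtop κtop)).HJLLZv4 ∧ (canon₁₂₂W νtop (canon₄₅ νtop) (canon₅ νtop μtop κtop) (canon₂₅ νtop μtop κtop) (canon₂₆ νtop μtop κtop) (canon₃₃ νtop μtop κtop) c₄₀noB14 (canon₄₂ νtop μtop κtop) (canon₅₄ νtop) (canon₆₃ νtop μtop κtop)).HJLLZv4incl) ∧
      (Implications122 νtop (canon₄₅ νtop) (canon₅ νtop μtop κtop) (canon₂₅ νtop μtop κtop) (canon₂₆ νtop μtop κtop) (canon₃₃ νtop μtop κtop) (canon₄₀ νtop μtop κtop)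
          (canon₄₂ νtop μtop κtop) c₅₄noC168 (canon₆₃ νtop μtop κtop) (canon₁₂₂W νtop (canon₄₅ νtop) (canon₅ νtop μtop κtop) (canon₂₅ νtop μtop κtop) (canon₂₆ νtop μtop κtop) (canon₃₃ νtop μtop κtop) (canon₄₀ νtop μtop κtop) (canon₄₂ νtop μtop κtop) c₅₄noC168 (canon₆₃ νtop μtop κtop)) ∧
        ¬ (canon₁₂₂W νtop (canon₄₅ νtop) (canon₅ νtop μtop κtop) (canon₂₅ νtop μtop κtop) (canon₂₆ νtop μtop κtop) (canon₃₃ νtop μtop κtop) (canon₄₀ νtop μtop κtop) (canon₄₂ νtop μtop κtop) c₅₄noC168 (canon₆₃ νtop μtop κtop)).HJLLZv4 ∧ ¬ (canon₁₂₂W νtop (canon₄₅ νtop) (canon₅ νtop μtop κtop) (canon₂₅ νtop μtop κtop) (canon₂₆ νtop μtop κtop) (canon₃₃ νtop μtop κtop) (canon₄₀ νtop μtop κtop) (canon₄₂ νtop μtop κtop) c₅₄noC168 (canon₆₃ νtop μtop κtop)).HJLLZv4incl ∧ (canon₁₂₂W νtop (canon₄₅ νtop) (canon₅ νtop μtop κtop)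 (canon₂₅ νtop μtop κtop) (canon₂₆ νtop μtop κtop) (canon₃₃ νtop μtop κtop) (canon₄₀ νtop μtop κtop) (canon₄₂ νtop μtop κtop) c₅₄noC168 (canon₆₃ νtop μtop κtop)).LiuShahidiJiangV2 ∧ (canon₁₂₂W νtop (canon₄₅ νtop) (canon₅ νtop μtop κtop) (canon₂₅ νtop μtop κtop) (canon₂₆ νtop μtop κtop) (canon₃₃ νtop μtop κtop) (canon₄₀ νtop μtop κtop) (canon₄₂ νtop μtop κtop) c₅₄noC168 (canon₆₃ νtop μtop κtop)).LiuShahidiLargeP ∧ (canon₁₂₂W νtop (canon₄₅ νtop) (canon₅ νtop μtop κtop) (canon₂₅ νtop μtop κtop) (canon₂₆ νtop μtop κtop) (canon₃₃ νtop μtop κtop) (canon₄₀ νtop μtop κtop) (canon₄₂ νtop μtop κtop) c₅₄noC168 (canon₆₃ νtop μtop κtop)).LiuShahidi113V2) :=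
  have b : ∀ N, νtop.Everything N := bookInputs_top.everything
  have t := hundredtwentysecond_holds_top
  ⟨⟨canon_implications₁₂₂W νtop _ _ _ _ _ _ _ _ _, fun h => h.2.2, b, t.1.2.2, t.2.1, t.2.2⟩,
    ⟨canon_implications₁₂₂W νtop _ _ _ _ _ _ _ _ _, fun h => h.2.1, fun h => h.2.1, b, t.1.2.1, t.1.2.2⟩⟩

/-- MOK SIDE, AS TYPED: in the Mok countermodel of ANY of the 29 leaves `l` (book at the top; KMSW without its Mok import) every edge holds; B107's Theorem 1.9 v2 (1)–(3) and its
large-p part, and B100's two v4 statements HOLD; B107's Theorem 1.13 v2 FAILS — as section 45 recorded for v1's Theorem 1.14: Mok's leaves reach this Sp_{2n} / SO_{2n+1}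
statement only through tranche 40's quasi-split node `HLLSHypQS` (⇐ book ∧ Mok after B26's uniform sentence for all quasi-split classical groups), an artefact of B26's
assumption, not a use of Mok's theorems by Liu – Shahidi. [cite: LiuShahidi2026Jiang, Thm 1.13 with [HLLS24, Theorem 11.4] (v2); HazeltineLiuLoShahidi2024Wavefront, §6.1 (bookkeeping proved here)] -/
theorem c122_mok_cm (l : Mok2015.LeafSupport.Leaf) :
    ¬ (Mok2015.LeafSupport.mkN (Mok2015.LeafSupport.cm l)).leaf l ∧
      Implications122 νtop (canon₄₅ νtop) (canon₅ νtop (Mok2015.LeafSupport.mkN (Mok2015.LeafSupport.cm l)) κnoMok) (canon₂₅ νtop (Mok2015.LeafSupport.mkN (Mok2015.LeafSupport.cm l)) κnoMok) (canon₂₆ νtop (Mok2015.LeafSupport.mkN (Mok2015.LeafSupport.cm l)) κnoMok) (canon₃₃ νtop (Mok2015.LeafSupport.mkN (Mok2015.LeafSupport.cm l)) κnoMok) (canon₄₀ νtop (Mok2015.LeafSupport.mkN (Mok2015.LeafSupport.cm l)) κnoMok)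
        (canon₄₂ νtop (Mok2015.LeafSupport.mkN (Mok2015.LeafSupport.cm l)) κnoMok) (canon₅₄ νtop) (canon₆₃ νtop (Mok2015.LeafSupport.mkN (Mok2015.LeafSupport.cm l)) κnoMok) (canon₁₂₂ νtop (Mok2015.LeafSupport.mkN (Mok2015.LeafSupport.cm l)) κnoMok) ∧
      ¬ (canon₁₂₂ νtop (Mok2015.LeafSupport.mkN (Mok2015.LeafSupport.cm l)) κnoMok).LiuShahidi113V2 ∧
      ((canon₁₂₂ νtop (Mok2015.LeafSupport.mkN (Mok2015.LeafSupport.cm l)) κnoMok).LiuShahidiJiangV2 ∧ (canon₁₂₂ νtop (Mok2015.LeafSupport.mkN (Mok2015.LeafSupport.cm l)) κnoMok).LiuShahidiLargeP ∧ (canon₁₂₂ νtop (Mok2015.LeafSupport.mkN (Mok2015.LeafSupport.cm l)) κnoMok).HJLLZv4 ∧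
        (canon₁₂₂ νtop (Mok2015.LeafSupport.mkN (Mok2015.LeafSupport.cm l)) κnoMok).HJLLZv4incl) :=
  have cmod := Mok2015.LeafSupport.countermodel l
  have nm := not_M_cm l
  have b : ∀ N, νtop.Everything N := bookInputs_top.everything
  have t := hundredtwentysecond_holds_top
  ⟨cmod.2.2.1, canon_implications₁₂₂ _ _ _, fun h => nm h.2.2.1.2, ⟨b, ⟨b, b, b⟩, t.2.1, t.2.2⟩⟩

/-- KMSW SIDE: in KMSW's countermodel of ANY leaf `l'` (book and Mok at the top) every edge holds and B107's Theorem 1.9 v2, its large-p part and B100's two v4 statements HOLD —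
no KMSW premise (Theorem 1.13 v2's value through tranche 40 / 41's readings is not re-read here; section 45 records it for v1). [cite: LiuShahidi2026Jiang, Thm 1.9 (v2); HazeltineEtAl2024, Thm 1.2 (v4) (bookkeeping proved here)] [claim: KalethaMinguezShinWhite2014, under-review] -/
theorem c122_kmsw (l' : KMSW2014.LeafSupport.Leaf) :
    ¬ (KMSW2014.LeafSupport.mkN (KMSW2014.LeafSupport.cm l')).leaf l' ∧
      Implications122 νtop (canon₄₅ νtop) (canon₅ νtop μtop (KMSW2014.LeafSupport.mkN (KMSW2014.LeafSupport.cm l'))) (canon₂₅ νtop μtop (KMSW2014.LeafSupport.mkN (KMSW2014.LeafSupport.cm l'))) (canon₂₆ νtop μtop (KMSW2014.LeafSupport.mkN (KMSW2014.LeafSupport.cm l'))) (canon₃₃ νtop μtop (KMSW2014.LeafSupport.mkN (KMSW2014.LeafSupport.cm l'))) (canon₄₀ νtop μtop (KMSW2014.LeafSupport.mkN (KMSW2014.LeafSupport.cm l')))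
        (canon₄₂ νtop μtop (KMSW2014.LeafSupport.mkN (KMSW2014.LeafSupport.cm l'))) (canon₅₄ νtop) (canon₆₃ νtop μtop (KMSW2014.LeafSupport.mkN (KMSW2014.LeafSupport.cm l'))) (canon₁₂₂ νtop μtop (KMSW2014.LeafSupport.mkN (KMSW2014.LeafSupport.cm l'))) ∧
      ((canon₁₂₂ νtop μtop (KMSW2014.LeafSupport.mkN (KMSW2014.LeafSupport.cm l'))).LiuShahidiJiangV2 ∧ (canon₁₂₂ νtop μtop (KMSW2014.LeafSupport.mkN (KMSW2014.LeafSupport.cm l'))).LiuShahidiLargeP ∧ (canon₁₂₂ νtop μtop (KMSW2014.LeafSupport.mkN (KMSW2014.LeafSupport.cm l'))).HJLLZv4 ∧ (canon₁₂₂ νtop μtop (KMSW2014.LeafSupport.mkN (KMSW2014.LeafSupport.cm l'))).HJLLZv4incl) :=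
  have cmod := KMSW2014.LeafSupport.countermodel l'
  have b : ∀ N, νtop.Everything N := bookInputs_top.everything
  have t := hundredtwentysecond_holds_top
  ⟨cmod.2.2.1, canon_implications₁₂₂ _ _ _, ⟨b, ⟨b, b, b⟩, t.2.1, t.2.2⟩⟩

/-- THE HUNDRED-AND-TWENTY-SECOND TRANCHE REGRADED, in one statement: (i) at the top all five rewritten statements hold; (ii) in the book countermodel of ANY of the 24 leaves all
five fail, every edge valid; (iii) B14 denied: only `LiuShahidiLargeP` fails; C168 denied: exactly B100's two fail; (iv) in every Mok countermodel only Theorem 1.13 v2 fails (the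
B26-node artefact); (v) in every KMSW leaf countermodel the four Mok-free statements hold.  Supports: support(`LiuShahidiJiangV2`) = all 24 book leaves; support(`LiuShahidiLargeP`) =
all 24 book leaves, with row B14 load-bearing (the NEW edge of v2); support(`HJLLZv4`) = support(`HJLLZv4incl`) = all 24 book leaves through C168 and the cited rows, no Mok / KMSW
leaf; support(`LiuShahidi113V2`) = all 24 book leaves ∧ (through B26's quasi-split node) Mok's 29 — as for v1's Theorem 1.14 (section 45). [cite: LiuShahidi2026Jiang, Thms 1.9, 1.13 (v2); HazeltineEtAl2024, Thms 1.2, 5.11 (v4) (bookkeeping proved here)] [claim: KalethaMinguezShinWhite2014, under-review] -/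
theorem c122_regraded :
    (((canon₁₂₂ νtop μtop κtop).LiuShahidiJiangV2 ∧ (canon₁₂₂ νtop μtop κtop).LiuShahidiLargeP ∧ (canon₁₂₂ νtop μtop κtop).LiuShahidi113V2) ∧
        ((canon₁₂₂ νtop μtop κtop).HJLLZv4 ∧ (canon₁₂₂ νtop μtop κtop).HJLLZv4incl)) ∧
      (∀ l : LeafSupport.Leaf, ¬ (LeafSupport.mkN (LeafSupport.cm l)).leaf l ∧ ¬ (canon₁₂₂ (LeafSupport.mkN (LeafSupport.cm l)) μtop κtop).LiuShahidiJiangV2 ∧ ¬ (canon₁₂₂ (LeafSupport.mkN (LeafSupport.cm l)) μtop κtop).LiuShahidiLargeP ∧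
        ¬ (canon₁₂₂ (LeafSupport.mkN (LeafSupport.cm l)) μtop κtop).HJLLZv4 ∧ ¬ (canon₁₂₂ (LeafSupport.mkN (LeafSupport.cm l)) μtop κtop).HJLLZv4incl) ∧
      (¬ (canon₁₂₂W νtop (canon₄₅ νtop) (canon₅ νtop μtop κtop) (canon₂₅ νtop μtop κtop) (canon₂₆ νtop μtop κtop) (canon₃₃ νtop μtop κtop) c₄₀noB14 (canon₄₂ νtop μtop κtop) (canon₅₄ νtop) (canon₆₃ νtop μtop κtop)).LiuShahidiLargeP ∧ (canon₁₂₂W νtop (canon₄₅ νtop) (canon₅ νtop μtop κtop) (canon₂₅ νtop μtop κtop) (canon₂₆ νtop μtop κtop) (canon₃₃ νtop μtop κtop) c₄₀noB14 (canon₄₂ νtop μtop κtop) (canon₅₄ νtop) (canon₆₃ νtop μtop κtop)).LiuShahidiJiangV2 ∧ (canon₁₂₂W νtop (canon₄₅ νtop) (canon₅ νtop μtop κtop) (canon₂₅ νtop μtop κtop) (canon₂₆ νtop μtop κtop) (canon₃₃ νtop μtop κtop) c₄₀noB14 (canon₄₂ νtop μtop κtop) (canon₅₄ νtop) (canon₆₃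 νtop μtop κtop)).HJLLZv4) ∧
      (¬ (canon₁₂₂W νtop (canon₄₅ νtop) (canon₅ νtop μtop κtop) (canon₂₅ νtop μtop κtop) (canon₂₆ νtop μtop κtop) (canon₃₃ νtop μtop κtop) (canon₄₀ νtop μtop κtop) (canon₄₂ νtop μtop κtop) c₅₄noC168 (canon₆₃ νtop μtop κtop)).HJLLZv4 ∧ ¬ (canon₁₂₂W νtop (canon₄₅ νtop) (canon₅ νtop μtop κtop) (canon₂₅ νtop μtop κtop) (canon₂₆ νtop μtop κtop) (canon₃₃ νtop μtop κtop) (canon₄₀ νtop μtop κtop) (canon₄₂ νtop μtop κtop) c₅₄noC168 (canon₆₃ νtop μtop κtop)).HJLLZv4incl ∧ (canon₁₂₂W νtop (canon₄₅ νtop) (canon₅ νtop μtop κtop) (canon₂₅ νtop μtop κtop) (canon₂₆ νtop μtop κtop) (canon₃₃ νtop μtop κtop) (canon₄₀ νtop μtop κtop) (canon₄₂ νtop μtop κtop) c₅₄noC168 (canon₆₃ νtop μtop κtop)).LiuShahidiLargeP) ∧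
      (∀ l : Mok2015.LeafSupport.Leaf, ¬ (Mok2015.LeafSupport.mkN (Mok2015.LeafSupport.cm l)).leaf l ∧ ¬ (canon₁₂₂ νtop (Mok2015.LeafSupport.mkN (Mok2015.LeafSupport.cm l)) κnoMok).LiuShahidi113V2 ∧
        (canon₁₂₂ νtop (Mok2015.LeafSupport.mkN (Mok2015.LeafSupport.cm l)) κnoMok).LiuShahidiLargeP ∧ (canon₁₂₂ νtop (Mok2015.LeafSupport.mkN (Mok2015.LeafSupport.cm l)) κnoMok).HJLLZv4) ∧
      (∀ l' : KMSW2014.LeafSupport.Leaf, ¬ (KMSW2014.LeafSupport.mkN (KMSW2014.LeafSupport.cm l')).leaf l' ∧ (canon₁₂₂ νtop μtop (KMSW2014.LeafSupport.mkN (KMSW2014.LeafSupport.cm l'))).LiuShahidiLargeP ∧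
        (canon₁₂₂ νtop μtop (KMSW2014.LeafSupport.mkN (KMSW2014.LeafSupport.cm l'))).HJLLZv4) :=
  ⟨hundredtwentysecond_holds_top,
    fun l => have h := c122_book_cm l
      ⟨h.1, h.2.2.1, h.2.2.2.1, h.2.2.2.2.2.1, h.2.2.2.2.2.2⟩,
    ⟨c122_rows_denied_top.1.2.1, c122_rows_denied_top.1.2.2.1, c122_rows_denied_top.1.2.2.2.2.1⟩,
    ⟨c122_rows_denied_top.2.2.1, c122_rows_denied_top.2.2.2.1, c122_rows_denied_top.2.2.2.2.2.1⟩,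
    fun l => have h := c122_mok_cm l
      ⟨h.1, h.2.2.1, h.2.2.2.2.1, h.2.2.2.2.2.1⟩,
    fun l' => have h := c122_kmsw l'
      ⟨h.1, h.2.2.2.1, h.2.2.2.2.1⟩⟩


/-! ## 126. Hundred-and-twenty-third tranche (v2 of this file, after `Downstream35.lean` v7; unit `pub-arthur-down-g53`'s LATEST arXiv TEXT STATES, III): support of row C104
D. Disegni, J. Number Theory 270 (2025) = arXiv:2303.17817v2, Theorem A (`DisegniThetaV2` ⇐ Mok ∧ C13 `Consumers.LTXZZ` ∧ C19 `Consumers2.LiLiu` ∧ C20 `Consumers5.DisegniLiu` ∧ B18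
`Consumers33.GanIchinoGP` ∧ B19 `Consumers35.AtobeGenericU` — tranche 35's inputs with the locators v2 adds). -/

section Canon123

variable (ν : Nodes) (μ : Mok2015.Nodes) (κ : KMSW2014.Nodes)

/-- The parametrised canonical reading of the hundred-and-twenty-third tranche: the assignments of tranches 1 / 2 / 5 / 33 / 35 are the parameters; Theorem A (v2) := Mok's
`Everything` at every rank ∧ the values of C13, C19, C20, B18 and B19 (unitary instance). [cite: Disegni2025Theta, Thm A (arXiv v2) (canonical model; bookkeeping)] -/
abbrev canon₁₂₃W (c : Consumers) (c₂ : Consumers2) (c₅ : Consumers5) (c₃₃ : Consumers33) (c₃₅ : Consumers35) : Consumers123 where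
  DisegniThetaV2 := (∀ N, μ.Everything N) ∧ c.LTXZZ ∧ c₂.LiLiu ∧ c₅.DisegniLiu ∧ c₃₃.GanIchinoGP ∧ c₃₅.AtobeGenericU

/-- The canonical instance over the first support file's `canon` / `canon₂` / `canon₅` (C13, C19 := KMSW's proved scope; C20 := Mok ∧ that) and sections 36 / 38's `canon₃₃` /
`canon₃₅` (B18 := Mok ∧ KMSW's proved scope; B19 unitary := Mok). [cite: Disegni2025Theta, Thm A (v2); LiuEtAl2022, Prop 12.3.1; GanIchino2016, Thm 1.3 (canonical model; bookkeeping)] [claim: KalethaMinguezShinWhite2014, under-review] -/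
abbrev canon₁₂₃ : Consumers123 := canon₁₂₃W μ (canon ν μ κ) (canon₂ ν μ κ) (canon₅ ν μ κ) (canon₃₃ ν μ κ) (canon₃₅ ν μ κ)

/-- The hundred-and-twenty-third-tranche edge holds in the parametrised reading, for arbitrary μ and EVERY assignment of the five cited tranches. [cite: Disegni2025Theta, Thm A (v2) (bookkeeping proved here)] -/
theorem canon_implications₁₂₃W (c : Consumers) (c₂ : Consumers2) (c₅ : Consumers5) (c₃₃ : Consumers33) (c₃₅ : Consumers35) :
    Implications123 μ c c₂ c₅ c₃₃ c₃₅ (canon₁₂₃W μ c c₂ c₅ c₃₃ c₃₅) where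
  disegniThetaV2 := fun m t l d g a => ⟨m, t, l, d, g, a⟩

/-- The edge holds in the canonical instance, for arbitrary ν, μ, κ. [cite: Disegni2025Theta, Thm A (v2) (bookkeeping proved here)] [claim: KalethaMinguezShinWhite2014, under-review] -/
theorem canon_implications₁₂₃ : Implications123 μ (canon ν μ κ) (canon₂ ν μ κ) (canon₅ ν μ κ) (canon₃₃ ν μ κ) (canon₃₅ ν μ κ) (canon₁₂₃ ν μ κ) :=
  canon_implications₁₂₃W μ _ _ _ _ _

end Canon123

/-- At the top (Mok and KMSW at the top; the book does not occur in the reading) Theorem A (v2) holds — through the tranche's own `disegniThetaV2_of_outputs_and_rows` fed by Mok's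
top value and KMSW's proved scope at the top (`KMSWInputs.scope`). [cite: Disegni2025Theta, Thm A (v2) (bookkeeping proved here)] [claim: KalethaMinguezShinWhite2014, under-review] -/
theorem hundredtwentythird_holds_top : (canon₁₂₃ νtop μtop κtop).DisegniThetaV2 :=
  have m : ∀ N, μtop.Everything N := mokInputs_top.everything
  have s : ∀ N, κtop.Scope N := (kmswInputs_top μtop).1.scope mokInputs_top
  disegniThetaV2_of_outputs_and_rows (canon_implications₁₂₃ νtop μtop κtop) m s s ⟨m, s⟩ ⟨m, s⟩ m

/-- BOOK SIDE: the book's nodes do not occur — in the book countermodel of ANY of the 24 leaves (Mok, KMSW at the top; every edge valid) Theorem A (v2) HOLDS: no book leaf is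
load-bearing for row C104 (unitary groups throughout). [cite: Disegni2025Theta, Thm A (v2) (bookkeeping proved here)] [claim: KalethaMinguezShinWhite2014, under-review] -/
theorem c123_book_cm (l : LeafSupport.Leaf) :
    ¬ (LeafSupport.mkN (LeafSupport.cm l)).leaf l ∧
      Implications123 μtop (canon (LeafSupport.mkN (LeafSupport.cm l)) μtop κtop) (canon₂ (LeafSupport.mkN (LeafSupport.cm l)) μtop κtop) (canon₅ (LeafSupport.mkN (LeafSupport.cm l)) μtop κtop) (canon₃₃ (LeafSupport.mkN (LeafSupport.cm l)) μtop κtop) (canon₃₅ (LeafSupport.mkN (LeafSupport.cm l)) μtop κtop) (canon₁₂₃ (LeafSupport.mkN (LeafSupport.cm l)) μtop κtop) ∧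
      (canon₁₂₃ (LeafSupport.mkN (LeafSupport.cm l)) μtop κtop).DisegniThetaV2 :=
  have cmod := LeafSupport.countermodel l
  ⟨cmod.2.2.1, canon_implications₁₂₃ _ _ _, hundredtwentythird_holds_top⟩

/-- MOK SIDE, EXACT SUPPORT AS TYPED: in the Mok countermodel of ANY of the 29 leaves `l` (book at the top; KMSW WITHOUT its Mok import, `κnoMok`) every edge holds and Theorem A (v2)
FAILS (« [Mok15, Lemma 2.2.1] », Mok's `Everything`, `not_M_cm`): ALL 29 Mok leaves are load-bearing. [cite: Disegni2025Theta, Thm A with [Mok15, Lemma 2.2.1] (v2) (bookkeeping proved here)] [claim: KalethaMinguezShinWhite2014, under-review] -/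
theorem c123_mok_cm (l : Mok2015.LeafSupport.Leaf) :
    ¬ (Mok2015.LeafSupport.mkN (Mok2015.LeafSupport.cm l)).leaf l ∧
      Implications123 (Mok2015.LeafSupport.mkN (Mok2015.LeafSupport.cm l)) (canon νtop (Mok2015.LeafSupport.mkN (Mok2015.LeafSupport.cm l)) κnoMok) (canon₂ νtop (Mok2015.LeafSupport.mkN (Mok2015.LeafSupport.cm l)) κnoMok) (canon₅ νtop (Mok2015.LeafSupport.mkN (Mok2015.LeafSupport.cm l)) κnoMok) (canon₃₃ νtop (Mok2015.LeafSupport.mkN (Mok2015.LeafSupport.cm l)) κnoMok) (canon₃₅ νtop (Mok2015.LeafSupport.mkN (Mok2015.LeafSupport.cm l)) κnoMok)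
        (canon₁₂₃ νtop (Mok2015.LeafSupport.mkN (Mok2015.LeafSupport.cm l)) κnoMok) ∧
      ¬ (canon₁₂₃ νtop (Mok2015.LeafSupport.mkN (Mok2015.LeafSupport.cm l)) κnoMok).DisegniThetaV2 :=
  have cmod := Mok2015.LeafSupport.countermodel l
  ⟨cmod.2.2.1, canon_implications₁₂₃ _ _ _, fun h => not_M_cm l h.1⟩

/-- KMSW SIDE (i): with Mok at the top but KMSW WITHOUT its Mok import (`κnoMok`: the proved scope fails at every rank), the edge valid, Theorem A (v2) FAILS — through C13 / C19 /
C20 / B18, the second-order KMSW consumers it cites. [cite: Disegni2025Theta, Thm A with [LTX+22, Prop. C.3.1], [LL21], [DL24], [GI16, Thm 4.1] (v2) (separating model; bookkeeping proved here)] [claim: KalethaMinguezShinWhite2014, under-review] -/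
theorem c123_kmsw_importDenied :
    Implications123 μtop (canon νtop μtop κnoMok) (canon₂ νtop μtop κnoMok) (canon₅ νtop μtop κnoMok) (canon₃₃ νtop μtop κnoMok) (canon₃₅ νtop μtop κnoMok)
        (canon₁₂₃ νtop μtop κnoMok) ∧
      ¬ (canon₁₂₃ νtop μtop κnoMok).DisegniThetaV2 :=
  have ns : ∀ N, ¬ κnoMok.Scope N := κnoMok_facts.2.2.2.2.2.1
  ⟨canon_implications₁₂₃ _ _ _, fun h => ns 0 (h.2.1 0)⟩

/-- KMSW SIDE (ii), EXACT PROVED-SCOPE SUPPORT: in KMSW's countermodel of the leaf `l'` (book and Mok at the top; the edge valid) Theorem A (v2) HOLDS iff `l'` is one of `AubertSS`,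
`KMS_A`, `KMS_B` — the three leaves only the starred statements in full consume — and FAILS for the eleven proved-scope leaves: C104 inherits KMSW's PROVED scope (generic
parameters), not the sequels, exactly as tranche 35's v1 field (section 38). [cite: Disegni2025Theta, Thm A (v2); Disegni2025Theta, Thm 1 (v1) (bookkeeping proved here)] [claim: KalethaMinguezShinWhite2014, under-review] -/
theorem c123_kmsw_cm_iff (l' : KMSW2014.LeafSupport.Leaf) :
    Implications123 μtop (canon νtop μtop (KMSW2014.LeafSupport.mkN (KMSW2014.LeafSupport.cm l'))) (canon₂ νtop μtop (KMSW2014.LeafSupport.mkN (KMSW2014.LeafSupport.cm l'))) (canon₅ νtop μtop (KMSW2014.LeafSupport.mkN (KMSW2014.LeafSupport.cm l'))) (canon₃₃ νtop μtop (KMSW2014.LeafSupport.mkN (KMSW2014.LeafSupport.cm l'))) (canon₃₅ νtop μtop (KMSW2014.LeafSupport.mkN (KMSW2014.LeafSupport.cm l'))) (canon₁₂₃ νtop μtop (KMSW2014.LeafSupport.mkN (KMSW2014.LeafSupport.cm l'))) ∧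
      ((canon₁₂₃ νtop μtop (KMSW2014.LeafSupport.mkN (KMSW2014.LeafSupport.cm l'))).DisegniThetaV2 ↔ l'.onlyFull = true) := by
  refine ⟨canon_implications₁₂₃ _ _ _, ⟨fun h => ?_, fun h => ?_⟩⟩
  · cases hb : l'.onlyFull
    · exact absurd (h.2.1 0) (KMSW2014.LeafSupport.not_scope_of (KMSW2014.LeafSupport.scope_fails l' hb 0))
    · rfl
  · have m : ∀ N, μtop.Everything N := mokInputs_top.everything
    have s := scope_of_onlyFull l' h
    exact ⟨m, s, s, ⟨m, s⟩, ⟨m, s⟩, m⟩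

/-- THE HUNDRED-AND-TWENTY-THIRD TRANCHE REGRADED, in one statement: (i) at the top Theorem A (v2) holds; (ii) in the book countermodel of any leaf it holds; (iii) in every Mok
countermodel it fails; (iv) with KMSW's Mok import denied it fails; (v) in KMSW's countermodel of leaf `l'` it holds iff `l'` ∈ {`AubertSS`, `KMS_A`, `KMS_B`}.  Support:
support(`DisegniThetaV2`) = all 29 leaves of Mok's memoir ∧ KMSW's eleven proved-scope leaves (through C13, C19, C20, B18), NO book leaf, NOT the two unwritten sequels —
the same support as the v1 field `Consumers35.DisegniTheta` (section 38): v2 redistributes the hypotheses of Theorem A, not its inheritance. [cite: Disegni2025Theta, Thm A (v2) (bookkeeping proved here)] [claim: KalethaMinguezShinWhite2014, under-review] -/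
theorem c123_regraded :
    (canon₁₂₃ νtop μtop κtop).DisegniThetaV2 ∧
      (∀ l : LeafSupport.Leaf, ¬ (LeafSupport.mkN (LeafSupport.cm l)).leaf l ∧ (canon₁₂₃ (LeafSupport.mkN (LeafSupport.cm l)) μtop κtop).DisegniThetaV2) ∧
      (∀ l : Mok2015.LeafSupport.Leaf, ¬ (Mok2015.LeafSupport.mkN (Mok2015.LeafSupport.cm l)).leaf l ∧ ¬ (canon₁₂₃ νtop (Mok2015.LeafSupport.mkN (Mok2015.LeafSupport.cm l)) κnoMok).DisegniThetaV2) ∧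
      ¬ (canon₁₂₃ νtop μtop κnoMok).DisegniThetaV2 ∧
      (∀ l' : KMSW2014.LeafSupport.Leaf, (canon₁₂₃ νtop μtop (KMSW2014.LeafSupport.mkN (KMSW2014.LeafSupport.cm l'))).DisegniThetaV2 ↔ l'.onlyFull = true) :=
  ⟨hundredtwentythird_holds_top,
    fun l => have h := c123_book_cm l
      ⟨h.1, h.2.2⟩,
    fun l => have h := c123_mok_cm l
      ⟨h.1, h.2.2⟩,
    c123_kmsw_importDenied.2,
    fun l' => (c123_kmsw_cm_iff l').2⟩

/-! ## 127. Hundred-and-twenty-fourth tranche (v2 of this file, after `Downstream35.lean` v8; unit `pub-arthur-down-g54`'s LATEST arXiv TEXT STATES, IV): supports of row B12 H. Atobe,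
Math. Ann. 371 (2018) in its arXiv v3 (node `AtobeFJHypV3` = the printed assumptions ⇐ tranche 56's node `AtobeFJHyp`; Theorem 1.3 `AtobeFJv3` ⇐ the node), row B48 M. Oi, Publ. RIMS 55
(2019) in its arXiv v2 (`OiUliftV2` ⇐ Mok ∧ E43 `Consumers45.MoeglinUnitaryDS`), row B115 Bin Xu, manuscripta math. 154 (2017), Theorem 11.1 (`XuJordIrreducible` ⇐ the book) and row C35
J. Haan, Math. Ann. 389 (2024) in its arXiv v7 (`HaanGGPv7` ⇐ Mok ∧ KMSW's proved scope). -/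

section Canon124

variable (ν : Nodes) (μ : Mok2015.Nodes) (κ : KMSW2014.Nodes)

/-- The parametrised canonical reading of the hundred-and-twenty-fourth tranche: `h` is the value of tranche 56's node `AtobeFJHyp` (granted `True` in section 59's `canon₅₆`),
`c₄₅` the assignment of tranche 45; B12's v3 node and Theorem 1.3 := `h`; B48's v2 lifting theorem := Mok's `Everything` ∧ E43's value; B115's Theorem 11.1 := everything the book
establishes; C35's v7 theorem := Mok's `Everything` ∧ KMSW's proved scope. [cite: Atobe2018FJ, (LLC)/(GPR)/(B) + Thm 1.3 (arXiv v3); Oi2019SimpleU, Thm 1.1 (arXiv v2); Xu2017CuspidalSupport, Thm 11.1; Haan2023, main theorem (arXiv v7) (canonical model; bookkeeping)] [claim: KalethaMinguezShinWhite2014, under-review] -/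
abbrev canon₁₂₄W (h : Prop) (c₄₅ : Consumers45) : Consumers124 where
  AtobeFJHypV3 := h
  AtobeFJv3 := h
  OiUliftV2 := (∀ N, μ.Everything N) ∧ c₄₅.MoeglinUnitaryDS
  XuJordIrreducible := ∀ N, ν.Everything N
  HaanGGPv7 := (∀ N, μ.Everything N) ∧ (∀ N, κ.Scope N)

/-- The canonical instance: the node GRANTED, E43 read by section 48's `canon₄₅` (:= the five published leaves `LLC_GLN`, `FL`, `Transfer`, `InvariantTF`, `TwistedTF`). [cite: Atobe2018FJ, (LLC)/(GPR)/(B) (arXiv v3); Moeglin2007Unitary, Thm (canonical model; bookkeeping)] [claim: KalethaMinguezShinWhite2014, under-review] -/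
abbrev canon₁₂₄ : Consumers124 := canon₁₂₄W ν μ κ True (canon₄₅ ν)

/-- The NODE-DENIED reading: B12's hypothesis node false (and Theorem 1.3 v3 with it), everything else canonical. [cite: Atobe2018FJ, (LLC)/(GPR)/(B) (arXiv v3) (separating model; bookkeeping)] [claim: KalethaMinguezShinWhite2014, under-review] -/
abbrev canon₁₂₄noH : Consumers124 := canon₁₂₄W ν μ κ False (canon₄₅ ν)

/-- Every hundred-and-twenty-fourth-tranche edge holds in the parametrised reading over ANY tranche-56 assignment whose node has the value `h` and any tranche-45 assignment, for
arbitrary ν, μ, κ. [cite: Atobe2018FJ, Thm 1.3 (arXiv v3); Oi2019SimpleU, Thm 1.1 (arXiv v2); Xu2017CuspidalSupport, Thm 11.1; Haan2023, main theorem (arXiv v7) (bookkeeping proved here)] [claim: KalethaMinguezShinWhite2014, under-review] -/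
theorem canon_implications₁₂₄W (h : Prop) (c₄₅ : Consumers45) (c₅₆ : Consumers56) (hh : c₅₆.AtobeFJHyp ↔ h) :
    Implications124 ν c₄₅ μ κ c₅₆ (canon₁₂₄W ν μ κ h c₄₅) where
  atobeHyp := fun x => hh.1 x
  atobeFJv3 := fun x => x
  oiUliftV2 := fun m e => ⟨m, e⟩
  xuJord := fun b => b
  haanGGPv7 := fun m s => ⟨m, s⟩

/-- The edges hold in the canonical instance over sections 48 / 59's `canon₄₅` / `canon₅₆`, for arbitrary ν, μ, κ. [cite: Atobe2018FJ, Thm 1.3 (arXiv v3); Oi2019SimpleU, Thm 1.1 (arXiv v2); Xu2017CuspidalSupport, Thm 11.1; Haan2023, main theorem (arXiv v7) (bookkeeping proved here)] [claim: KalethaMinguezShinWhite2014, under-review] -/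
theorem canon_implications₁₂₄ : Implications124 ν (canon₄₅ ν) μ κ (canon₅₆ ν μ) (canon₁₂₄ ν μ κ) :=
  canon_implications₁₂₄W ν μ κ True _ _ Iff.rfl

/-- The edges hold in the node-denied reading over the node-denied tranche-56 reading `canon₅₆noH` of section 59. [cite: Atobe2018FJ, (LLC)/(GPR)/(B) (arXiv v3) (bookkeeping proved here)] [claim: KalethaMinguezShinWhite2014, under-review] -/
theorem canon_implications₁₂₄noH : Implications124 ν (canon₄₅ ν) μ κ (canon₅₆noH ν μ) (canon₁₂₄noH ν μ κ) :=
  canon_implications₁₂₄W ν μ κ False _ _ Iff.rfl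

end Canon124

/-- At the top (every input of the three DAGs; the node granted) all five fields hold — the four theorems through the tranche's own `hundredtwentyfourth_of_inputs` fed by section
48's `canon_implications₄₅`, `bookInputs_top`, `mokInputs_top`, `kmswInputs_top`, and the node by its grant. [cite: Atobe2018FJ, Thm 1.3 (arXiv v3); Oi2019SimpleU, Thm 1.1 (arXiv v2); Xu2017CuspidalSupport, Thm 11.1; Haan2023, main theorem (arXiv v7) (bookkeeping proved here)] [claim: KalethaMinguezShinWhite2014, under-review] -/
theorem hundredtwentyfourth_holds_top :
    (canon₁₂₄ νtop μtop κtop).AtobeFJHypV3 ∧ (canon₁₂₄ νtop μtop κtop).AtobeFJv3 ∧ (canon₁₂₄ νtop μtop κtop).OiUliftV2 ∧ (canon₁₂₄ νtop μtop κtop).XuJordIrreducible ∧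
      (canon₁₂₄ νtop μtop κtop).HaanGGPv7 :=
  have h := hundredtwentyfourth_of_inputs (canon_implications₁₂₄ νtop μtop κtop) (canon_implications₄₅ νtop μtop κtop) bookInputs_top mokInputs_top
    (kmswInputs_top μtop).1 True.intro
  ⟨True.intro, h⟩

/-- NODE GRANTED / DENIED: with B12's hypothesis node granted Theorem 1.3 (v3) HOLDS for EVERY assignment of the three DAGs; with it denied the theorem FAILS, every edge valid — the
node is the whole support of `AtobeFJv3` as typed (as for tranche 56's field `AtobeFJ`, section 59). [cite: Atobe2018FJ, (LLC)/(GPR)/(B) + Thm 1.3 (arXiv v3) (separating models; bookkeeping proved here)] [claim: KalethaMinguezShinWhite2014, under-review] -/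
theorem c124_node (ν : Nodes) (μ : Mok2015.Nodes) (κ : KMSW2014.Nodes) :
    (canon₁₂₄ ν μ κ).AtobeFJv3 ∧ (Implications124 ν (canon₄₅ ν) μ κ (canon₅₆noH ν μ) (canon₁₂₄noH ν μ κ) ∧ ¬ (canon₁₂₄noH ν μ κ).AtobeFJv3) :=
  ⟨True.intro, canon_implications₁₂₄noH ν μ κ, fun h => h⟩

/-- BOOK SIDE, EXACT SUPPORT AS TYPED: in the book countermodel of ANY of the 24 leaves `l` (Mok, KMSW at the top; node granted; every edge of tranches 45 / 124 valid) B115's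
Theorem 11.1 FAILS (`not_B_cm`) while B12's node / theorem and C35's v7 theorem HOLD; B48's v2 lifting HOLDS when `l` is none of E43's five published leaves and FAILS when it is
one of them (section 48's `moeglinUnitaryDS_cm_holds` / `_cm_fails`). [cite: Xu2017CuspidalSupport, Thm 11.1; Oi2019SimpleU, Thm 1.1 (arXiv v2) with Moeglin2007Unitary; Haan2023, main theorem (arXiv v7) (bookkeeping proved here)] [claim: KalethaMinguezShinWhite2014, under-review] -/
theorem c124_book_cm (l : LeafSupport.Leaf) :
    ¬ (LeafSupport.mkN (LeafSupport.cm l)).leaf l ∧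
      Implications124 (LeafSupport.mkN (LeafSupport.cm l)) (canon₄₅ (LeafSupport.mkN (LeafSupport.cm l))) μtop κtop (canon₅₆ (LeafSupport.mkN (LeafSupport.cm l)) μtop) (canon₁₂₄ (LeafSupport.mkN (LeafSupport.cm l)) μtop κtop) ∧
      ¬ (canon₁₂₄ (LeafSupport.mkN (LeafSupport.cm l)) μtop κtop).XuJordIrreducible ∧
      ((canon₁₂₄ (LeafSupport.mkN (LeafSupport.cm l)) μtop κtop).AtobeFJv3 ∧ (canon₁₂₄ (LeafSupport.mkN (LeafSupport.cm l)) μtop κtop).HaanGGPv7) ∧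
      ((l ≠ .LLC_GLN → l ≠ .FL → l ≠ .Transfer → l ≠ .InvariantTF → l ≠ .TwistedTF → (canon₁₂₄ (LeafSupport.mkN (LeafSupport.cm l)) μtop κtop).OiUliftV2) ∧
        (l = .LLC_GLN ∨ l = .FL ∨ l = .Transfer ∨ l = .InvariantTF ∨ l = .TwistedTF → ¬ (canon₁₂₄ (LeafSupport.mkN (LeafSupport.cm l)) μtop κtop).OiUliftV2)) :=
  have cmod := LeafSupport.countermodel l
  have m : ∀ N, μtop.Everything N := mokInputs_top.everything
  have s : ∀ N, κtop.Scope N := (kmswInputs_top μtop).1.scope mokInputs_top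
  ⟨cmod.2.2.1, canon_implications₁₂₄ _ _ _, not_B_cm l, ⟨True.intro, ⟨m, s⟩⟩,
    ⟨fun h₁ h₂ h₃ h₄ h₅ => ⟨m, moeglinUnitaryDS_cm_holds l h₁ h₂ h₃ h₄ h₅⟩, fun hl h => (moeglinUnitaryDS_cm_fails l hl).2 h.2⟩⟩

/-- MOK SIDE, EXACT SUPPORT AS TYPED: in the Mok countermodel of ANY of the 29 leaves `l` (book at the top; KMSW WITHOUT its Mok import) every edge holds; B48's v2 lifting and C35's
v7 theorem FAIL (Mok's `Everything`, `not_M_cm`); B12's node / theorem and B115's statement HOLD: ALL 29 Mok leaves are load-bearing for `OiUliftV2` and `HaanGGPv7`. [cite: Oi2019SimpleU, Thm 1.1 (arXiv v2); Haan2023, main theorem (arXiv v7) (bookkeeping proved here)] [claim: KalethaMinguezShinWhite2014, under-review] -/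
theorem c124_mok_cm (l : Mok2015.LeafSupport.Leaf) :
    ¬ (Mok2015.LeafSupport.mkN (Mok2015.LeafSupport.cm l)).leaf l ∧
      Implications124 νtop (canon₄₅ νtop) (Mok2015.LeafSupport.mkN (Mok2015.LeafSupport.cm l)) κnoMok (canon₅₆ νtop (Mok2015.LeafSupport.mkN (Mok2015.LeafSupport.cm l))) (canon₁₂₄ νtop (Mok2015.LeafSupport.mkN (Mok2015.LeafSupport.cm l)) κnoMok) ∧
      (¬ (canon₁₂₄ νtop (Mok2015.LeafSupport.mkN (Mok2015.LeafSupport.cm l)) κnoMok).OiUliftV2 ∧ ¬ (canon₁₂₄ νtop (Mok2015.LeafSupport.mkN (Mok2015.LeafSupport.cm l)) κnoMok).HaanGGPv7) ∧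
      ((canon₁₂₄ νtop (Mok2015.LeafSupport.mkN (Mok2015.LeafSupport.cm l)) κnoMok).AtobeFJv3 ∧ (canon₁₂₄ νtop (Mok2015.LeafSupport.mkN (Mok2015.LeafSupport.cm l)) κnoMok).XuJordIrreducible) :=
  have cmod := Mok2015.LeafSupport.countermodel l
  have nm := not_M_cm l
  ⟨cmod.2.2.1, canon_implications₁₂₄ _ _ _, ⟨fun h => nm h.1, fun h => nm h.1⟩, ⟨True.intro, bookInputs_top.everything⟩⟩

/-- KMSW SIDE, EXACT PROVED-SCOPE SUPPORT: in KMSW's countermodel of the leaf `l'` (book and Mok at the top; every edge valid) C35's v7 theorem HOLDS iff `l'` ∈ {`AubertSS`, `KMS_A`,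
`KMS_B`} (the proved scope, not the sequels); B48's v2 lifting, B12's node / theorem and B115's statement HOLD for every `l'`. [cite: Haan2023, main theorem (arXiv v7); Oi2019SimpleU, Thm 1.1 (arXiv v2) (bookkeeping proved here)] [claim: KalethaMinguezShinWhite2014, under-review] -/
theorem c124_kmsw_cm_iff (l' : KMSW2014.LeafSupport.Leaf) :
    Implications124 νtop (canon₄₅ νtop) μtop (KMSW2014.LeafSupport.mkN (KMSW2014.LeafSupport.cm l')) (canon₅₆ νtop μtop) (canon₁₂₄ νtop μtop (KMSW2014.LeafSupport.mkN (KMSW2014.LeafSupport.cm l'))) ∧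
      ((canon₁₂₄ νtop μtop (KMSW2014.LeafSupport.mkN (KMSW2014.LeafSupport.cm l'))).HaanGGPv7 ↔ l'.onlyFull = true) ∧
      ((canon₁₂₄ νtop μtop (KMSW2014.LeafSupport.mkN (KMSW2014.LeafSupport.cm l'))).OiUliftV2 ∧ (canon₁₂₄ νtop μtop (KMSW2014.LeafSupport.mkN (KMSW2014.LeafSupport.cm l'))).AtobeFJv3 ∧ (canon₁₂₄ νtop μtop (KMSW2014.LeafSupport.mkN (KMSW2014.LeafSupport.cm l'))).XuJordIrreducible) := by
  refine ⟨canon_implications₁₂₄ _ _ _, ⟨fun h => ?_, fun h => ⟨mokInputs_top.everything, scope_of_onlyFull l' h⟩⟩,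
    ⟨⟨mokInputs_top.everything, fortyfifth_holds_top.2.2.2.2.2⟩, True.intro, bookInputs_top.everything⟩⟩
  cases hb : l'.onlyFull
  · exact absurd (h.2 0) (KMSW2014.LeafSupport.not_scope_of (KMSW2014.LeafSupport.scope_fails l' hb 0))
  · rfl

/-- THE HUNDRED-AND-TWENTY-FOURTH TRANCHE REGRADED, in one statement: (i) at the top all five fields hold; (ii) node granted / denied: B12's Theorem 1.3 (v3) holds for every
assignment / fails; (iii) in the book countermodel of any of the 24 leaves B115's Theorem 11.1 fails, B12's and C35's statements hold, B48's holds off E43's five published leaves and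
fails on them; (iv) in every Mok countermodel B48's and C35's fail; (v) in KMSW's countermodel of `l'` C35's holds iff `l'` ∈ {`AubertSS`, `KMS_A`, `KMS_B`}, B48's holds throughout.  Supports:
support(`AtobeFJv3`) = the node alone; support(`XuJordIrreducible`) = all 24 book leaves; support(`OiUliftV2`) = all 29 Mok leaves ∧ the book's five published leaves `LLC_GLN`, `FL`,
`Transfer`, `InvariantTF`, `TwistedTF` (through E43) — NO open leaf of the book; support(`HaanGGPv7`) = all 29 Mok leaves ∧ KMSW's eleven proved-scope leaves, not the sequels.
[cite: Atobe2018FJ, Thm 1.3 (arXiv v3); Oi2019SimpleU, Thm 1.1 (arXiv v2); Xu2017CuspidalSupport, Thm 11.1; Haan2023, main theorem (arXiv v7) (bookkeeping proved here)] [claim: KalethaMinguezShinWhite2014, under-review] -/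
theorem c124_regraded :
    ((canon₁₂₄ νtop μtop κtop).AtobeFJHypV3 ∧ (canon₁₂₄ νtop μtop κtop).AtobeFJv3 ∧ (canon₁₂₄ νtop μtop κtop).OiUliftV2 ∧ (canon₁₂₄ νtop μtop κtop).XuJordIrreducible ∧
        (canon₁₂₄ νtop μtop κtop).HaanGGPv7) ∧
      (∀ (ν : Nodes) (μ : Mok2015.Nodes) (κ : KMSW2014.Nodes), (canon₁₂₄ ν μ κ).AtobeFJv3 ∧ ¬ (canon₁₂₄noH ν μ κ).AtobeFJv3) ∧
      (∀ l : LeafSupport.Leaf, ¬ (LeafSupport.mkN (LeafSupport.cm l)).leaf l ∧ ¬ (canon₁₂₄ (LeafSupport.mkN (LeafSupport.cm l)) μtop κtop).XuJordIrreducible ∧ (canon₁₂₄ (LeafSupport.mkN (LeafSupport.cm l)) μtop κtop).HaanGGPv7 ∧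
        (l = .LLC_GLN ∨ l = .FL ∨ l = .Transfer ∨ l = .InvariantTF ∨ l = .TwistedTF → ¬ (canon₁₂₄ (LeafSupport.mkN (LeafSupport.cm l)) μtop κtop).OiUliftV2)) ∧
      (∀ l : Mok2015.LeafSupport.Leaf, ¬ (Mok2015.LeafSupport.mkN (Mok2015.LeafSupport.cm l)).leaf l ∧ ¬ (canon₁₂₄ νtop (Mok2015.LeafSupport.mkN (Mok2015.LeafSupport.cm l)) κnoMok).OiUliftV2 ∧
        ¬ (canon₁₂₄ νtop (Mok2015.LeafSupport.mkN (Mok2015.LeafSupport.cm l)) κnoMok).HaanGGPv7) ∧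
      (∀ l' : KMSW2014.LeafSupport.Leaf, ((canon₁₂₄ νtop μtop (KMSW2014.LeafSupport.mkN (KMSW2014.LeafSupport.cm l'))).HaanGGPv7 ↔ l'.onlyFull = true) ∧ (canon₁₂₄ νtop μtop (KMSW2014.LeafSupport.mkN (KMSW2014.LeafSupport.cm l'))).OiUliftV2) :=
  ⟨hundredtwentyfourth_holds_top,
    fun ν μ κ => have h := c124_node ν μ κ
      ⟨h.1, h.2.2⟩,
    fun l => have h := c124_book_cm l
      ⟨h.1, h.2.2.1, h.2.2.2.1.2, h.2.2.2.2.2⟩,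
    fun l => have h := c124_mok_cm l
      ⟨h.1, h.2.2.1.1, h.2.2.1.2⟩,
    fun l' => have h := c124_kmsw_cm_iff l'
      ⟨h.2.1, h.2.2.1⟩⟩


/-! ## 128. Hundred-and-twenty-fifth tranche (v3 of this file, after `Downstream36.lean` v1; unit `pub-arthur-down-g54`'s LATEST arXiv TEXT STATES, V): supports of row B31
Hazeltine – Liu – Lo – Zhang in its arXiv v2 (`HLLZclosureV2` ⇐ book ∧ A2 ∧ A5 ∧ A42 ∧ B101 ∧ C168), row B44 Mœglin – Renard in its arXiv v2 (`MRsymmetricV2` ⇐ A8 ∧ B24), row C16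
Jiang – Zhang's Theorem 5.1 = B.2 (`JZnlio` ⇐ book ∧ Mok ∧ KMSW's proved scope ∧ the Chapter-9 leaf; its unitary instance `JZnlioU` ⇐ Mok ∧ KMSW's proved scope, and ⇐ `JZnlio`)
and row C36 Zhu in its arXiv v3 (`ZhuIHv3` ⇐ book ∧ A3 ∧ B1 ∧ tranche 69's node `ZhuHyp202`). -/

section Canon125

variable (ν : Nodes) (μ : Mok2015.Nodes) (κ : KMSW2014.Nodes)

/-- The parametrised canonical reading of the hundred-and-twenty-fifth tranche over assignments of tranches 1, 2, 5, 8, 26, 53, 54, 69: each statement := exactly the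
conjunction of the premises of its typed edge (the unitary instance `JZnlioU` := Mok's `Everything` ∧ KMSW's proved scope, which `JZnlio`'s value contains).
[cite: HazeltineLiuLoZhang2025Closure, Thm 1.3 (arXiv v2); MoeglinRenard2020Symetriques, Cor. 4.2 (arXiv v2); JiangZhang2020, Thm 5.1 = Thm B.2; Zhu2018FrobeniusHecke, Thm 9.7.5 (arXiv v3) (canonical model; bookkeeping)] [claim: KalethaMinguezShinWhite2014, under-review] -/
abbrev canon₁₂₅W (c : Consumers) (c₂ : Consumers2) (c₅ : Consumers5) (c₈ : Consumers8) (c₂₆ : Consumers26) (c₅₃ : Consumers53) (c₅₄ : Consumers54)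
    (c₆₉ : Consumers69) : Consumers125 where
  HLLZclosureV2 := (∀ N, ν.Everything N) ∧ c₂.XuMoeglinParam ∧ c₅.AtobeApackets ∧ c₅.AtobeMinguez ∧ c₂₆.HLL ∧ c₅₄.MoeglinImage
  MRsymmetricV2 := c₂.MoeglinRenard ∧ c₅₃.MRunitaryReal
  JZnlio := (∀ N, ν.Everything N) ∧ (∀ N, μ.Everything N) ∧ (∀ N, κ.Scope N) ∧ c₈.InnerTwists
  JZnlioU := (∀ N, μ.Everything N) ∧ (∀ N, κ.Scope N)
  ZhuIHv3 := (∀ N, ν.Everything N) ∧ c.TaibiInner ∧ c.AMR ∧ c₆₉.ZhuHyp202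

/-- The canonical instance over `canon`, `canon₂`, `canon₅`, `canon₈` (Chapter-9 leaf granted), `canon₂₆`, `canon₅₃`, `canon₅₄`, `canon₆₉` (node `ZhuHyp202` granted).
[cite: JiangZhang2020, Thm 5.1 = Thm B.2; Zhu2018FrobeniusHecke, Hypothesis 9.1.2 (= the node `ZhuHyp202`) + Thm 9.7.5 (arXiv v3) (canonical model; bookkeeping)] [claim: KalethaMinguezShinWhite2014, under-review] -/
abbrev canon₁₂₅ : Consumers125 :=
  canon₁₂₅W ν μ κ (canon ν μ κ) (canon₂ ν μ κ) (canon₅ ν μ κ) (canon₈ ν μ κ) (canon₂₆ ν μ κ) (canon₅₃ ν μ κ) (canon₅₄ ν) (canon₆₉ ν μ κ)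

/-- The reading with the CHAPTER-9 LEAF DENIED (`canon₈no`): C16's Theorem 5.1 = B.2 false with it, everything else canonical. [cite: JiangZhang2020, Thm 5.1 = Thm B.2 with Arthur2013, Foreword p. xvii (separating model; bookkeeping)] [claim: KalethaMinguezShinWhite2014, under-review] -/
abbrev canon₁₂₅noCh9 : Consumers125 :=
  canon₁₂₅W ν μ κ (canon ν μ κ) (canon₂ ν μ κ) (canon₅ ν μ κ) (canon₈no ν μ) (canon₂₆ ν μ κ) (canon₅₃ ν μ κ) (canon₅₄ ν) (canon₆₉ ν μ κ)

/-- The reading with tranche 69's NODE `ZhuHyp202` DENIED (`canon₆₉no`): C36's v3 theorem false with it, everything else canonical. [cite: Zhu2018FrobeniusHecke, Hypothesis 9.1.2 (arXiv v3; = the node `ZhuHyp202`) (separating model; bookkeeping)] [claim: KalethaMinguezShinWhite2014, under-review] -/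
abbrev canon₁₂₅noZ : Consumers125 :=
  canon₁₂₅W ν μ κ (canon ν μ κ) (canon₂ ν μ κ) (canon₅ ν μ κ) (canon₈ ν μ κ) (canon₂₆ ν μ κ) (canon₅₃ ν μ κ) (canon₅₄ ν) (canon₆₉no ν μ κ)

/-- Every hundred-and-twenty-fifth-tranche edge holds in the parametrised reading over ANY assignments of the premise tranches, for arbitrary ν, μ, κ. [cite: HazeltineLiuLoZhang2025Closure, Thm 1.3 (arXiv v2); MoeglinRenard2020Symetriques, Cor. 4.2 (arXiv v2); JiangZhang2020, Thm 5.1 = Thm B.2; Zhu2018FrobeniusHecke, Thm 9.7.5 (arXiv v3) (bookkeeping proved here)] [claim: KalethaMinguezShinWhite2014, under-review] -/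
theorem canon_implications₁₂₅W (c : Consumers) (c₂ : Consumers2) (c₅ : Consumers5) (c₈ : Consumers8) (c₂₆ : Consumers26) (c₅₃ : Consumers53)
    (c₅₄ : Consumers54) (c₆₉ : Consumers69) : Implications125 ν μ κ c c₂ c₅ c₈ c₂₆ c₅₃ c₅₄ c₆₉ (canon₁₂₅W ν μ κ c c₂ c₅ c₈ c₂₆ c₅₃ c₅₄ c₆₉) where
  hllzClosureV2 := fun b x a q h i => ⟨b, x, a, q, h, i⟩
  mrSymmetricV2 := fun a u => ⟨a, u⟩
  jzNlio := fun b m k n => ⟨b, m, k, n⟩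
  jzNlioU := fun m k => ⟨m, k⟩
  jzNlioInstance := fun h => ⟨h.2.1, h.2.2.1⟩
  zhuIHv3 := fun b t a z => ⟨b, t, a, z⟩

/-- The edges hold in the canonical instance, for arbitrary ν, μ, κ. [cite: HazeltineLiuLoZhang2025Closure, Thm 1.3 (arXiv v2); JiangZhang2020, Thm 5.1 = Thm B.2 (bookkeeping proved here)] [claim: KalethaMinguezShinWhite2014, under-review] -/
theorem canon_implications₁₂₅ :
    Implications125 ν μ κ (canon ν μ κ) (canon₂ ν μ κ) (canon₅ ν μ κ) (canon₈ ν μ κ) (canon₂₆ ν μ κ) (canon₅₃ ν μ κ) (canon₅₄ ν) (canon₆₉ ν μ κ) (canon₁₂₅ ν μ κ) :=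
  canon_implications₁₂₅W ν μ κ _ _ _ _ _ _ _ _

/-- The edges hold in the Chapter-9-denied reading. [cite: JiangZhang2020, Thm 5.1 = Thm B.2 (bookkeeping proved here)] [claim: KalethaMinguezShinWhite2014, under-review] -/
theorem canon_implications₁₂₅noCh9 :
    Implications125 ν μ κ (canon ν μ κ) (canon₂ ν μ κ) (canon₅ ν μ κ) (canon₈no ν μ) (canon₂₆ ν μ κ) (canon₅₃ ν μ κ) (canon₅₄ ν) (canon₆₉ ν μ κ) (canon₁₂₅noCh9 ν μ κ) :=
  canon_implications₁₂₅W ν μ κ _ _ _ _ _ _ _ _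

/-- The edges hold in the node-denied reading. [cite: Zhu2018FrobeniusHecke, Thm 9.7.5 (arXiv v3) (bookkeeping proved here)] [claim: KalethaMinguezShinWhite2014, under-review] -/
theorem canon_implications₁₂₅noZ :
    Implications125 ν μ κ (canon ν μ κ) (canon₂ ν μ κ) (canon₅ ν μ κ) (canon₈ ν μ κ) (canon₂₆ ν μ κ) (canon₅₃ ν μ κ) (canon₅₄ ν) (canon₆₉no ν μ κ) (canon₁₂₅noZ ν μ κ) :=
  canon_implications₁₂₅W ν μ κ _ _ _ _ _ _ _ _

end Canon125

/-- At the top (every input of the three DAGs; Chapter-9 leaf and node granted) all five statements hold — through the tranche's own `hundredtwentyfifth_of_inputs` fed by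
`canon_implications`, `canon_implications₂`, `canon_implications₅`, `canon_implications₂₆`, `bookInputs_top`, `mokInputs_top`, `kmswInputs_top`, C168's value from section 57's
`fiftyfourth_holds_top`, A8's from the book at the top, B24's from section 56's `fiftythird_holds_top`, the Chapter-9 leaf and the node by their grants. [cite: HazeltineLiuLoZhang2025Closure, Thm 1.3 (arXiv v2); MoeglinRenard2020Symetriques, Cor. 4.2 (arXiv v2); JiangZhang2020, Thm 5.1 = Thm B.2; Zhu2018FrobeniusHecke, Thm 9.7.5 (arXiv v3) (bookkeeping proved here)] [claim: KalethaMinguezShinWhite2014, under-review] -/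
theorem hundredtwentyfifth_holds_top :
    (canon₁₂₅ νtop μtop κtop).HLLZclosureV2 ∧ (canon₁₂₅ νtop μtop κtop).MRsymmetricV2 ∧ (canon₁₂₅ νtop μtop κtop).JZnlio ∧ (canon₁₂₅ νtop μtop κtop).JZnlioU ∧
      (canon₁₂₅ νtop μtop κtop).ZhuIHv3 :=
  hundredtwentyfifth_of_inputs (canon_implications₁₂₅ νtop μtop κtop) (canon_implications νtop μtop κtop) (canon_implications₂ νtop μtop κtop)
    (canon_implications₅ νtop μtop κtop) (canon_implications₂₆ νtop μtop κtop) bookInputs_top mokInputs_top (kmswInputs_top μtop).1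
    fiftyfourth_holds_top.1 bookInputs_top.everything fiftythird_holds_top.2.1 True.intro True.intro

/-- CHAPTER-9 LEAF and NODE, GRANTED / DENIED, for EVERY assignment of the three DAGs: with the Chapter-9 leaf denied C16's Theorem 5.1 = B.2 FAILS while its unitary instance keeps
the value Mok ∧ KMSW-scope (at the top: holds); with the node `ZhuHyp202` denied C36's v3 theorem FAILS; every edge valid in both readings. [cite: JiangZhang2020, Thm 5.1 = Thm B.2; Zhu2018FrobeniusHecke, Hypothesis 9.1.2 (= the node `ZhuHyp202`) + Thm 9.7.5 (arXiv v3) (separating models; bookkeeping proved here)] [claim: KalethaMinguezShinWhite2014, under-review] -/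
theorem c125_leaf9_and_node_denied (ν : Nodes) (μ : Mok2015.Nodes) (κ : KMSW2014.Nodes) :
    (Implications125 ν μ κ (canon ν μ κ) (canon₂ ν μ κ) (canon₅ ν μ κ) (canon₈no ν μ) (canon₂₆ ν μ κ) (canon₅₃ ν μ κ) (canon₅₄ ν) (canon₆₉ ν μ κ) (canon₁₂₅noCh9 ν μ κ) ∧
        ¬ (canon₁₂₅noCh9 ν μ κ).JZnlio) ∧
      (Implications125 ν μ κ (canon ν μ κ) (canon₂ ν μ κ) (canon₅ ν μ κ) (canon₈ ν μ κ) (canon₂₆ ν μ κ) (canon₅₃ ν μ κ) (canon₅₄ ν) (canon₆₉no ν μ κ) (canon₁₂₅noZ ν μ κ) ∧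
        ¬ (canon₁₂₅noZ ν μ κ).ZhuIHv3) ∧
      (canon₁₂₅noCh9 νtop μtop κtop).JZnlioU :=
  ⟨⟨canon_implications₁₂₅noCh9 ν μ κ, fun h => h.2.2.2⟩, ⟨canon_implications₁₂₅noZ ν μ κ, fun h => h.2.2.2⟩,
    ⟨mokInputs_top.everything, (kmswInputs_top μtop).1.scope mokInputs_top⟩⟩

/-- BOOK SIDE, EXACT SUPPORT AS TYPED — in the book countermodel of ANY of the 24 leaves `l` (Mok, KMSW at the top; leaf 9 and node granted; every edge valid): B31 v2, B44 v2,
C16's Theorem 5.1 and C36 v3 FAIL (each value contains the book's `Everything` at every rank — « [Art13, Theorem 1.5.1] », [Art] through A8 / B24, « [3] », « [Art13] »),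
while C16's unitary instance HOLDS. [cite: HazeltineLiuLoZhang2025Closure, Thm 1.3 (arXiv v2); MoeglinRenard2020Symetriques, Cor. 4.2 (arXiv v2); JiangZhang2020, Thm 5.1 = Thm B.2; Zhu2018FrobeniusHecke, Thm 9.7.5 (arXiv v3) (bookkeeping proved here)] [claim: KalethaMinguezShinWhite2014, under-review] -/
theorem c125_book_cm (l : LeafSupport.Leaf) :
    ¬ (LeafSupport.mkN (LeafSupport.cm l)).leaf l ∧
      Implications125 (LeafSupport.mkN (LeafSupport.cm l)) μtop κtop (canon (LeafSupport.mkN (LeafSupport.cm l)) μtop κtop) (canon₂ (LeafSupport.mkN (LeafSupport.cm l)) μtop κtop)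
        (canon₅ (LeafSupport.mkN (LeafSupport.cm l)) μtop κtop) (canon₈ (LeafSupport.mkN (LeafSupport.cm l)) μtop κtop) (canon₂₆ (LeafSupport.mkN (LeafSupport.cm l)) μtop κtop)
        (canon₅₃ (LeafSupport.mkN (LeafSupport.cm l)) μtop κtop) (canon₅₄ (LeafSupport.mkN (LeafSupport.cm l))) (canon₆₉ (LeafSupport.mkN (LeafSupport.cm l)) μtop κtop)
        (canon₁₂₅ (LeafSupport.mkN (LeafSupport.cm l)) μtop κtop) ∧
      (¬ (canon₁₂₅ (LeafSupport.mkN (LeafSupport.cm l)) μtop κtop).HLLZclosureV2 ∧ ¬ (canon₁₂₅ (LeafSupport.mkN (LeafSupport.cm l)) μtop κtop).MRsymmetricV2 ∧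
        ¬ (canon₁₂₅ (LeafSupport.mkN (LeafSupport.cm l)) μtop κtop).JZnlio ∧ ¬ (canon₁₂₅ (LeafSupport.mkN (LeafSupport.cm l)) μtop κtop).ZhuIHv3) ∧
      (canon₁₂₅ (LeafSupport.mkN (LeafSupport.cm l)) μtop κtop).JZnlioU :=
  have cmod := LeafSupport.countermodel l
  have n := not_B_cm l
  ⟨cmod.2.2.1, canon_implications₁₂₅ _ _ _, ⟨fun h => n h.1, fun h => n h.1, fun h => n h.1, fun h => n h.1⟩,
    ⟨mokInputs_top.everything, (kmswInputs_top μtop).1.scope mokInputs_top⟩⟩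

/-- MOK SIDE, EXACT SUPPORT AS TYPED — in the Mok countermodel of ANY of the 29 leaves `l` (book at the top; KMSW WITHOUT its Mok import; every edge valid): B44 v2 (through B24's
unitary inputs), C16's Theorem 5.1 and its unitary instance FAIL; B31 v2 and C36 v3 HOLD. [cite: MoeglinRenard2020Symetriques, Cor. 4.2 (arXiv v2); JiangZhang2020, Thm 5.1 = Thm B.2 (bookkeeping proved here)] [claim: KalethaMinguezShinWhite2014, under-review] -/
theorem c125_mok_cm (l : Mok2015.LeafSupport.Leaf) :
    ¬ (Mok2015.LeafSupport.mkN (Mok2015.LeafSupport.cm l)).leaf l ∧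
      Implications125 νtop (Mok2015.LeafSupport.mkN (Mok2015.LeafSupport.cm l)) κnoMok (canon νtop (Mok2015.LeafSupport.mkN (Mok2015.LeafSupport.cm l)) κnoMok)
        (canon₂ νtop (Mok2015.LeafSupport.mkN (Mok2015.LeafSupport.cm l)) κnoMok) (canon₅ νtop (Mok2015.LeafSupport.mkN (Mok2015.LeafSupport.cm l)) κnoMok)
        (canon₈ νtop (Mok2015.LeafSupport.mkN (Mok2015.LeafSupport.cm l)) κnoMok) (canon₂₆ νtop (Mok2015.LeafSupport.mkN (Mok2015.LeafSupport.cm l)) κnoMok)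
        (canon₅₃ νtop (Mok2015.LeafSupport.mkN (Mok2015.LeafSupport.cm l)) κnoMok) (canon₅₄ νtop) (canon₆₉ νtop (Mok2015.LeafSupport.mkN (Mok2015.LeafSupport.cm l)) κnoMok)
        (canon₁₂₅ νtop (Mok2015.LeafSupport.mkN (Mok2015.LeafSupport.cm l)) κnoMok) ∧
      (¬ (canon₁₂₅ νtop (Mok2015.LeafSupport.mkN (Mok2015.LeafSupport.cm l)) κnoMok).MRsymmetricV2 ∧ ¬ (canon₁₂₅ νtop (Mok2015.LeafSupport.mkN (Mok2015.LeafSupport.cm l)) κnoMok).JZnlio ∧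
        ¬ (canon₁₂₅ νtop (Mok2015.LeafSupport.mkN (Mok2015.LeafSupport.cm l)) κnoMok).JZnlioU) ∧
      ((canon₁₂₅ νtop (Mok2015.LeafSupport.mkN (Mok2015.LeafSupport.cm l)) κnoMok).HLLZclosureV2 ∧ (canon₁₂₅ νtop (Mok2015.LeafSupport.mkN (Mok2015.LeafSupport.cm l)) κnoMok).ZhuIHv3) :=
  have cmod := Mok2015.LeafSupport.countermodel l
  have nm := not_M_cm l
  have b : ∀ N, νtop.Everything N := bookInputs_top.everything
  ⟨cmod.2.2.1, canon_implications₁₂₅ _ _ _, ⟨fun h => nm h.2.1, fun h => nm h.2.1, fun h => nm h.1⟩,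
    ⟨⟨b, b, b, b, ⟨b, b⟩, fiftyfourth_holds_top.1⟩, ⟨b, b, b, True.intro⟩⟩⟩

/-- KMSW SIDE — (i) with KMSW's Mok import DENIED (`κnoMok`; book, Mok at the top) C16's Theorem 5.1, its unitary instance and B44 v2 FAIL; (ii) in KMSW's countermodel of the leaf `l'`
(book, Mok at the top) C16's Theorem 5.1 and its instance HOLD iff `l'` ∈ {`AubertSS`, `KMS_A`, `KMS_B`} (the proved scope), B44 v2 FAILS for every `l'` (B24 consumes the starred
statements in full), B31 v2 and C36 v3 HOLD throughout. [cite: JiangZhang2020, Thm 5.1 = Thm B.2; MoeglinRenard2020Symetriques, Cor. 4.2 (arXiv v2) (bookkeeping proved here)] [claim: KalethaMinguezShinWhite2014, under-review] -/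
theorem c125_kmsw (l' : KMSW2014.LeafSupport.Leaf) :
    (¬ (canon₁₂₅ νtop μtop κnoMok).JZnlio ∧ ¬ (canon₁₂₅ νtop μtop κnoMok).JZnlioU ∧ ¬ (canon₁₂₅ νtop μtop κnoMok).MRsymmetricV2) ∧
      Implications125 νtop μtop (KMSW2014.LeafSupport.mkN (KMSW2014.LeafSupport.cm l')) (canon νtop μtop (KMSW2014.LeafSupport.mkN (KMSW2014.LeafSupport.cm l')))
        (canon₂ νtop μtop (KMSW2014.LeafSupport.mkN (KMSW2014.LeafSupport.cm l'))) (canon₅ νtop μtop (KMSW2014.LeafSupport.mkN (KMSW2014.LeafSupport.cm l')))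
        (canon₈ νtop μtop (KMSW2014.LeafSupport.mkN (KMSW2014.LeafSupport.cm l'))) (canon₂₆ νtop μtop (KMSW2014.LeafSupport.mkN (KMSW2014.LeafSupport.cm l')))
        (canon₅₃ νtop μtop (KMSW2014.LeafSupport.mkN (KMSW2014.LeafSupport.cm l'))) (canon₅₄ νtop) (canon₆₉ νtop μtop (KMSW2014.LeafSupport.mkN (KMSW2014.LeafSupport.cm l')))
        (canon₁₂₅ νtop μtop (KMSW2014.LeafSupport.mkN (KMSW2014.LeafSupport.cm l'))) ∧
      (((canon₁₂₅ νtop μtop (KMSW2014.LeafSupport.mkN (KMSW2014.LeafSupport.cm l'))).JZnlio ↔ l'.onlyFull = true) ∧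
        ((canon₁₂₅ νtop μtop (KMSW2014.LeafSupport.mkN (KMSW2014.LeafSupport.cm l'))).JZnlioU ↔ l'.onlyFull = true)) ∧
      ¬ (canon₁₂₅ νtop μtop (KMSW2014.LeafSupport.mkN (KMSW2014.LeafSupport.cm l'))).MRsymmetricV2 ∧
      ((canon₁₂₅ νtop μtop (KMSW2014.LeafSupport.mkN (KMSW2014.LeafSupport.cm l'))).HLLZclosureV2 ∧ (canon₁₂₅ νtop μtop (KMSW2014.LeafSupport.mkN (KMSW2014.LeafSupport.cm l'))).ZhuIHv3) := by
  have ns : ∀ N, ¬ κnoMok.Scope N := κnoMok_facts.2.2.2.2.2.1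
  have nfk : ∀ N, ¬ κnoMok.Full N := κnoMok_facts.2.2.2.2.2.2
  have cmod := KMSW2014.LeafSupport.countermodel l'
  have b : ∀ N, νtop.Everything N := bookInputs_top.everything
  have m : ∀ N, μtop.Everything N := mokInputs_top.everything
  have nf : ¬ ∀ N, (KMSW2014.LeafSupport.mkN (KMSW2014.LeafSupport.cm l')).Full N :=
    fun h => KMSW2014.LeafSupport.not_full_of_noFull (cmod.2.2.2 0) (h 0)
  have sc : (∀ N, (KMSW2014.LeafSupport.mkN (KMSW2014.LeafSupport.cm l')).Scope N) ↔ l'.onlyFull = true := by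
    refine ⟨fun h => ?_, fun h => scope_of_onlyFull l' h⟩
    cases hb : l'.onlyFull
    · exact absurd (h 0) (KMSW2014.LeafSupport.not_scope_of (KMSW2014.LeafSupport.scope_fails l' hb 0))
    · rfl
  exact ⟨⟨fun h => ns 0 (h.2.2.1 0), fun h => ns 0 (h.2 0), fun h => nfk 0 (h.2.2.1 0)⟩, canon_implications₁₂₅ _ _ _,
    ⟨⟨fun h => sc.1 h.2.2.1, fun h => ⟨b, m, sc.2 h, True.intro⟩⟩, ⟨fun h => sc.1 h.2, fun h => ⟨m, sc.2 h⟩⟩⟩, fun h => nf h.2.2.1,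
    ⟨⟨b, b, b, b, ⟨b, b⟩, fiftyfourth_holds_top.1⟩, ⟨b, b, b, True.intro⟩⟩⟩

/-- THE HUNDRED-AND-TWENTY-FIFTH TRANCHE REGRADED, in one statement: (i) at the top all five hold; (ii) leaf 9 denied: C16's Theorem 5.1 fails; node denied: C36 v3 fails; (iii) in
the book countermodel of any of the 24 leaves B31 v2, B44 v2, C16's Theorem 5.1, C36 v3 fail and C16's unitary instance holds; (iv) in every Mok countermodel B44 v2, C16's theorem
and its instance fail, B31 v2 and C36 v3 hold; (v) in KMSW's countermodel of `l'` C16's theorem and instance hold iff `l'` ∈ {`AubertSS`, `KMS_A`, `KMS_B`}, B44 v2 fails for all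
fourteen.  Supports: support(`HLLZclosureV2`) = all 24 book leaves (C168 read through section 57's canonical `MoeglinImage` = the book ∧ its five published leaves), no Mok / KMSW
leaf; support(`MRsymmetricV2`) = all 24 book leaves ∧ all 29 Mok leaves ∧ all 14 KMSW leaves (B24's starred statements in full); support(`JZnlio`) = all 24 book leaves ∧ all 29
Mok leaves ∧ KMSW's proved scope ∧ the Chapter-9 leaf; support(`JZnlioU`) = all 29 Mok leaves ∧ KMSW's proved scope; support(`ZhuIHv3`) = all 24 book leaves ∧ the node.
[cite: HazeltineLiuLoZhang2025Closure, Thm 1.3 (arXiv v2); MoeglinRenard2020Symetriques, Cor. 4.2 (arXiv v2); JiangZhang2020, Thm 5.1 = Thm B.2; Zhu2018FrobeniusHecke, Thm 9.7.5 (arXiv v3) (bookkeeping proved here)] [claim: KalethaMinguezShinWhite2014, under-review] -/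
theorem c125_regraded :
    ((canon₁₂₅ νtop μtop κtop).HLLZclosureV2 ∧ (canon₁₂₅ νtop μtop κtop).MRsymmetricV2 ∧ (canon₁₂₅ νtop μtop κtop).JZnlio ∧ (canon₁₂₅ νtop μtop κtop).JZnlioU ∧
        (canon₁₂₅ νtop μtop κtop).ZhuIHv3) ∧
      (∀ (ν : Nodes) (μ : Mok2015.Nodes) (κ : KMSW2014.Nodes), ¬ (canon₁₂₅noCh9 ν μ κ).JZnlio ∧ ¬ (canon₁₂₅noZ ν μ κ).ZhuIHv3) ∧
      (∀ l : LeafSupport.Leaf, ¬ (LeafSupport.mkN (LeafSupport.cm l)).leaf l ∧ ¬ (canon₁₂₅ (LeafSupport.mkN (LeafSupport.cm l)) μtop κtop).HLLZclosureV2 ∧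
        ¬ (canon₁₂₅ (LeafSupport.mkN (LeafSupport.cm l)) μtop κtop).MRsymmetricV2 ∧ ¬ (canon₁₂₅ (LeafSupport.mkN (LeafSupport.cm l)) μtop κtop).JZnlio ∧
        ¬ (canon₁₂₅ (LeafSupport.mkN (LeafSupport.cm l)) μtop κtop).ZhuIHv3 ∧ (canon₁₂₅ (LeafSupport.mkN (LeafSupport.cm l)) μtop κtop).JZnlioU) ∧
      (∀ l : Mok2015.LeafSupport.Leaf, ¬ (Mok2015.LeafSupport.mkN (Mok2015.LeafSupport.cm l)).leaf l ∧ ¬ (canon₁₂₅ νtop (Mok2015.LeafSupport.mkN (Mok2015.LeafSupport.cm l)) κnoMok).MRsymmetricV2 ∧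
        ¬ (canon₁₂₅ νtop (Mok2015.LeafSupport.mkN (Mok2015.LeafSupport.cm l)) κnoMok).JZnlio ∧ ¬ (canon₁₂₅ νtop (Mok2015.LeafSupport.mkN (Mok2015.LeafSupport.cm l)) κnoMok).JZnlioU ∧
        (canon₁₂₅ νtop (Mok2015.LeafSupport.mkN (Mok2015.LeafSupport.cm l)) κnoMok).HLLZclosureV2 ∧ (canon₁₂₅ νtop (Mok2015.LeafSupport.mkN (Mok2015.LeafSupport.cm l)) κnoMok).ZhuIHv3) ∧
      (∀ l' : KMSW2014.LeafSupport.Leaf, ((canon₁₂₅ νtop μtop (KMSW2014.LeafSupport.mkN (KMSW2014.LeafSupport.cm l'))).JZnlio ↔ l'.onlyFull = true) ∧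
        ((canon₁₂₅ νtop μtop (KMSW2014.LeafSupport.mkN (KMSW2014.LeafSupport.cm l'))).JZnlioU ↔ l'.onlyFull = true) ∧
        ¬ (canon₁₂₅ νtop μtop (KMSW2014.LeafSupport.mkN (KMSW2014.LeafSupport.cm l'))).MRsymmetricV2) :=
  ⟨hundredtwentyfifth_holds_top,
    fun ν μ κ => have h := c125_leaf9_and_node_denied ν μ κ
      ⟨h.1.2, h.2.1.2⟩,
    fun l => have h := c125_book_cm l
      ⟨h.1, h.2.2.1.1, h.2.2.1.2.1, h.2.2.1.2.2.1, h.2.2.1.2.2.2, h.2.2.2⟩,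
    fun l => have h := c125_mok_cm l
      ⟨h.1, h.2.2.1.1, h.2.2.1.2.1, h.2.2.1.2.2, h.2.2.2.1, h.2.2.2.2⟩,
    fun l' => have h := c125_kmsw l'
      ⟨h.2.2.1.1, h.2.2.1.2, h.2.2.2.1⟩⟩


/-! ## 129. Hundred-and-twenty-sixth tranche (v3 of this file, after `Downstream36.lean` v2; unit `pub-arthur-down-g54`'s LATEST arXiv TEXT STATES, VI): supports of row C62
H. Peng in its arXiv v4 — Theorem C (`PengThmCv4` ⇐ book ∧ Mok ∧ KMSW's proved scope ∧ A5 ∧ A6 ∧ A12 ∧ B62), the node Hypothesis 4.5.8 (`PengHyp458`), its instance over ℚ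
(`PengHyp458OQ` ⇐ the node, and ⇐ C36 v3 = tranche 125's `ZhuIHv3`), the ℚ_p-corollary (`PengKottwitzSOQp` ⇐ Theorem C ∧ the instance) and Theorem 7.3.5 (`PengKottwitzV4` ⇐
Theorem C ∧ the node). -/

section Canon126

variable (ν : Nodes) (μ : Mok2015.Nodes) (κ : KMSW2014.Nodes)

/-- The value of C62 v4's Theorem C in the parametrised reading: the conjunction of the seven premises of `E_PengThmCv4` over assignments of tranches 1, 4, 27.
[cite: Peng2025FS, Thm C (arXiv v4) (canonical model; bookkeeping)] [claim: KalethaMinguezShinWhite2014, under-review] -/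
abbrev pengThmCv4W (c : Consumers) (c₄ : Consumers4) (c₂₇ : Consumers27) : Prop :=
  (∀ N, ν.Everything N) ∧ (∀ N, μ.Everything N) ∧ (∀ N, κ.Scope N) ∧ c.IshimotoGeneric ∧ c.ChenZou ∧ c₄.Peng ∧ c₂₇.PengFS

/-- The parametrised canonical reading of the hundred-and-twenty-sixth tranche: `h` is the value of the node Hypothesis 4.5.8; Theorem C := its seven premises; the instance
over ℚ := the node ∨ C36 v3's value (both printed routes); the ℚ_p-corollary := Theorem C ∧ the instance; Theorem 7.3.5 := Theorem C ∧ the node.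
[cite: Peng2025FS, Thm C, Hypothesis 4.5.8, Remark 4.5.9, Thm 7.3.5 (arXiv v4) (canonical model; bookkeeping)] [claim: KalethaMinguezShinWhite2014, under-review] -/
abbrev canon₁₂₆W (h : Prop) (c : Consumers) (c₄ : Consumers4) (c₂₇ : Consumers27) (c₁₂₅ : Consumers125) : Consumers126 where
  PengThmCv4 := pengThmCv4W ν μ κ c c₄ c₂₇
  PengKottwitzV4 := pengThmCv4W ν μ κ c c₄ c₂₇ ∧ h
  PengHyp458 := h
  PengHyp458OQ := h ∨ c₁₂₅.ZhuIHv3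
  PengKottwitzSOQp := pengThmCv4W ν μ κ c c₄ c₂₇ ∧ (h ∨ c₁₂₅.ZhuIHv3)

/-- The canonical instance: node GRANTED, tranches 1 / 4 / 27 canonical, C36 v3 read by section 128's `canon₁₂₅` (its node granted). [cite: Peng2025FS, Hypothesis 4.5.8 (arXiv v4) (canonical model; bookkeeping)] [claim: KalethaMinguezShinWhite2014, under-review] -/
abbrev canon₁₂₆ : Consumers126 := canon₁₂₆W ν μ κ True (canon ν μ κ) (canon₄ ν μ κ) (canon₂₇ ν μ κ) (canon₁₂₅ ν μ κ)

/-- NODE DENIED, C36's route open: Hypothesis 4.5.8 false, C36 v3 canonical (node `ZhuHyp202` granted). [cite: Peng2025FS, Hypothesis 4.5.8, Remark 4.5.9 (arXiv v4) (separating model; bookkeeping)] [claim: KalethaMinguezShinWhite2014, under-review] -/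
abbrev canon₁₂₆noH : Consumers126 := canon₁₂₆W ν μ κ False (canon ν μ κ) (canon₄ ν μ κ) (canon₂₇ ν μ κ) (canon₁₂₅ ν μ κ)

/-- BOTH ROUTES DENIED: Hypothesis 4.5.8 false and C36 v3 false (section 128's `canon₁₂₅noZ`, node `ZhuHyp202` denied). [cite: Peng2025FS, Hypothesis 4.5.8, Remark 4.5.9 (arXiv v4) with Zhu2018FrobeniusHecke, Hypothesis 9.1.2 (arXiv v3; = the node `ZhuHyp202`) (separating model; bookkeeping)] [claim: KalethaMinguezShinWhite2014, under-review] -/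
abbrev canon₁₂₆noHnoZ : Consumers126 := canon₁₂₆W ν μ κ False (canon ν μ κ) (canon₄ ν μ κ) (canon₂₇ ν μ κ) (canon₁₂₅noZ ν μ κ)

/-- Every hundred-and-twenty-sixth-tranche edge holds in the parametrised reading over ANY node value and any assignments of tranches 1, 4, 27, 125, for arbitrary ν, μ, κ.
[cite: Peng2025FS, Thm C, Thm 7.3.5, Remark 4.5.9 (arXiv v4) (bookkeeping proved here)] [claim: KalethaMinguezShinWhite2014, under-review] -/
theorem canon_implications₁₂₆W (h : Prop) (c : Consumers) (c₄ : Consumers4) (c₂₇ : Consumers27) (c₁₂₅ : Consumers125) :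
    Implications126 ν μ κ c c₄ c₂₇ c₁₂₅ (canon₁₂₆W ν μ κ h c c₄ c₂₇ c₁₂₅) where
  pengThmCv4 := fun b m k i z p f => ⟨b, m, k, i, z, p, f⟩
  pengKottwitzV4 := fun t hh => ⟨t, hh⟩
  pengHyp458Instance := fun hh => Or.inl hh
  pengHyp458OQ := fun z => Or.inr z
  pengKottwitzSOQp := fun t o => ⟨t, o⟩

/-- The edges hold in the canonical instance. [cite: Peng2025FS, Thm C (arXiv v4) (bookkeeping proved here)] [claim: KalethaMinguezShinWhite2014, under-review] -/
theorem canon_implications₁₂₆ : Implications126 ν μ κ (canon ν μ κ) (canon₄ ν μ κ) (canon₂₇ ν μ κ) (canon₁₂₅ ν μ κ) (canon₁₂₆ ν μ κ) :=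
  canon_implications₁₂₆W ν μ κ True _ _ _ _

/-- The edges hold with the node denied. [cite: Peng2025FS, Remark 4.5.9 (arXiv v4) (bookkeeping proved here)] [claim: KalethaMinguezShinWhite2014, under-review] -/
theorem canon_implications₁₂₆noH : Implications126 ν μ κ (canon ν μ κ) (canon₄ ν μ κ) (canon₂₇ ν μ κ) (canon₁₂₅ ν μ κ) (canon₁₂₆noH ν μ κ) :=
  canon_implications₁₂₆W ν μ κ False _ _ _ _

/-- The edges hold with both routes denied (over section 128's node-denied `canon₁₂₅noZ`). [cite: Peng2025FS, Remark 4.5.9 (arXiv v4) (bookkeeping proved here)] [claim: KalethaMinguezShinWhite2014, under-review] -/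
theorem canon_implications₁₂₆noHnoZ : Implications126 ν μ κ (canon ν μ κ) (canon₄ ν μ κ) (canon₂₇ ν μ κ) (canon₁₂₅noZ ν μ κ) (canon₁₂₆noHnoZ ν μ κ) :=
  canon_implications₁₂₆W ν μ κ False _ _ _ _

end Canon126

/-- At the top (every input of the three DAGs; both nodes granted) all five fields hold — Theorem C, the instance, the corollary and Theorem 7.3.5 through the tranche's own
`hundredtwentysixth_of_inputs` fed by section 128's `canon_implications₁₂₅`, `canon_implications₂₇`, `canon_implications`, `canon_implications₄`, `bookInputs_top`, `mokInputs_top`,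
`kmswInputs_top` and the grant of `ZhuHyp202`; the node by its grant. [cite: Peng2025FS, Thm C, Thm 7.3.5, Remark 4.5.9 (arXiv v4) (bookkeeping proved here)] [claim: KalethaMinguezShinWhite2014, under-review] -/
theorem hundredtwentysixth_holds_top :
    (canon₁₂₆ νtop μtop κtop).PengThmCv4 ∧ (canon₁₂₆ νtop μtop κtop).PengKottwitzV4 ∧ (canon₁₂₆ νtop μtop κtop).PengHyp458 ∧ (canon₁₂₆ νtop μtop κtop).PengHyp458OQ ∧
      (canon₁₂₆ νtop μtop κtop).PengKottwitzSOQp :=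
  have h := hundredtwentysixth_of_inputs (canon_implications₁₂₆ νtop μtop κtop) (canon_implications₁₂₅ νtop μtop κtop) (canon_implications₂₇ νtop μtop κtop)
    (canon_implications νtop μtop κtop) (canon_implications₄ νtop μtop κtop) bookInputs_top mokInputs_top (kmswInputs_top μtop).1 True.intro
  ⟨h.1, h.2.2.2 True.intro, True.intro, h.2.1, h.2.2.1⟩

/-- THE NODE AND THE TWO ROUTES TO THE ℚ-INSTANCE, for EVERY assignment of the three DAGs: with Hypothesis 4.5.8 denied, Theorem 7.3.5 FAILS and the ℚ-instance takes exactly the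
value of C36 v3 (so it HOLDS at the top through Zhu's route); with BOTH the node and `ZhuHyp202` denied the ℚ-instance and the ℚ_p-corollary FAIL; every edge valid in each reading.
[cite: Peng2025FS, Hypothesis 4.5.8, Remark 4.5.9, Thm 7.3.5 (arXiv v4) (separating models; bookkeeping proved here)] [claim: KalethaMinguezShinWhite2014, under-review] -/
theorem c126_nodes (ν : Nodes) (μ : Mok2015.Nodes) (κ : KMSW2014.Nodes) :
    (Implications126 ν μ κ (canon ν μ κ) (canon₄ ν μ κ) (canon₂₇ ν μ κ) (canon₁₂₅ ν μ κ) (canon₁₂₆noH ν μ κ) ∧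
        ¬ (canon₁₂₆noH ν μ κ).PengHyp458 ∧ ¬ (canon₁₂₆noH ν μ κ).PengKottwitzV4 ∧ ((canon₁₂₆noH ν μ κ).PengHyp458OQ ↔ (canon₁₂₅ ν μ κ).ZhuIHv3)) ∧
      (canon₁₂₆noH νtop μtop κtop).PengHyp458OQ ∧
      (Implications126 ν μ κ (canon ν μ κ) (canon₄ ν μ κ) (canon₂₇ ν μ κ) (canon₁₂₅noZ ν μ κ) (canon₁₂₆noHnoZ ν μ κ) ∧
        ¬ (canon₁₂₆noHnoZ ν μ κ).PengHyp458OQ ∧ ¬ (canon₁₂₆noHnoZ ν μ κ).PengKottwitzSOQp) :=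
  ⟨⟨canon_implications₁₂₆noH ν μ κ, fun h => h, fun h => h.2, ⟨fun h => h.elim (fun f => f.elim) (fun z => z), fun z => Or.inr z⟩⟩,
    Or.inr hundredtwentyfifth_holds_top.2.2.2.2,
    ⟨canon_implications₁₂₆noHnoZ ν μ κ, fun h => h.elim (fun f => f) (fun z => z.2.2.2), fun h => h.2.elim (fun f => f) (fun z => z.2.2.2)⟩⟩

/-- BOOK SIDE, EXACT SUPPORT AS TYPED — in the book countermodel of ANY of the 24 leaves `l` (Mok, KMSW at the top; nodes granted; every edge valid): Theorem C, Theorem 7.3.5 and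
the ℚ_p-corollary FAIL (« using the endoscopic classification … ([Art13, Theorem 1.5.1], [Mok15, Theorem 2.5.1], [KMSW14, Theorem 1.6.1]) »), the node and the ℚ-instance hold
by the grant; with the node DENIED the ℚ-instance FAILS too (Zhu's route consumes the book). [cite: Peng2025FS, Thm C, Thm 7.3.5, Remark 4.5.9 (arXiv v4) (bookkeeping proved here)] [claim: KalethaMinguezShinWhite2014, under-review] -/
theorem c126_book_cm (l : LeafSupport.Leaf) :
    ¬ (LeafSupport.mkN (LeafSupport.cm l)).leaf l ∧
      Implications126 (LeafSupport.mkN (LeafSupport.cm l)) μtop κtop (canon (LeafSupport.mkN (LeafSupport.cm l)) μtop κtop) (canon₄ (LeafSupport.mkN (LeafSupport.cm l)) μtop κtop)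
        (canon₂₇ (LeafSupport.mkN (LeafSupport.cm l)) μtop κtop) (canon₁₂₅ (LeafSupport.mkN (LeafSupport.cm l)) μtop κtop) (canon₁₂₆ (LeafSupport.mkN (LeafSupport.cm l)) μtop κtop) ∧
      (¬ (canon₁₂₆ (LeafSupport.mkN (LeafSupport.cm l)) μtop κtop).PengThmCv4 ∧ ¬ (canon₁₂₆ (LeafSupport.mkN (LeafSupport.cm l)) μtop κtop).PengKottwitzV4 ∧
        ¬ (canon₁₂₆ (LeafSupport.mkN (LeafSupport.cm l)) μtop κtop).PengKottwitzSOQp) ∧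
      ((canon₁₂₆ (LeafSupport.mkN (LeafSupport.cm l)) μtop κtop).PengHyp458 ∧ (canon₁₂₆ (LeafSupport.mkN (LeafSupport.cm l)) μtop κtop).PengHyp458OQ) ∧
      ¬ (canon₁₂₆noH (LeafSupport.mkN (LeafSupport.cm l)) μtop κtop).PengHyp458OQ :=
  have cmod := LeafSupport.countermodel l
  have n := not_B_cm l
  ⟨cmod.2.2.1, canon_implications₁₂₆ _ _ _, ⟨fun h => n h.1, fun h => n h.1.1, fun h => n h.1.1⟩, ⟨True.intro, Or.inl True.intro⟩,
    fun h => h.elim (fun f => f) (fun z => n z.1)⟩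

/-- MOK SIDE, EXACT SUPPORT AS TYPED — in the Mok countermodel of ANY of the 29 leaves `l` (book at the top; KMSW WITHOUT its Mok import; every edge valid): Theorem C, Theorem 7.3.5
and the ℚ_p-corollary FAIL (« [Mok15, Theorem 2.5.1] »); the node and the ℚ-instance hold (by the grant, and by Zhu's book-only route even with the node denied).
[cite: Peng2025FS, Thm C, Thm 7.3.5, Remark 4.5.9 (arXiv v4) (bookkeeping proved here)] [claim: KalethaMinguezShinWhite2014, under-review] -/
theorem c126_mok_cm (l : Mok2015.LeafSupport.Leaf) :
    ¬ (Mok2015.LeafSupport.mkN (Mok2015.LeafSupport.cm l)).leaf l ∧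
      Implications126 νtop (Mok2015.LeafSupport.mkN (Mok2015.LeafSupport.cm l)) κnoMok (canon νtop (Mok2015.LeafSupport.mkN (Mok2015.LeafSupport.cm l)) κnoMok)
        (canon₄ νtop (Mok2015.LeafSupport.mkN (Mok2015.LeafSupport.cm l)) κnoMok) (canon₂₇ νtop (Mok2015.LeafSupport.mkN (Mok2015.LeafSupport.cm l)) κnoMok)
        (canon₁₂₅ νtop (Mok2015.LeafSupport.mkN (Mok2015.LeafSupport.cm l)) κnoMok) (canon₁₂₆ νtop (Mok2015.LeafSupport.mkN (Mok2015.LeafSupport.cm l)) κnoMok) ∧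
      (¬ (canon₁₂₆ νtop (Mok2015.LeafSupport.mkN (Mok2015.LeafSupport.cm l)) κnoMok).PengThmCv4 ∧ ¬ (canon₁₂₆ νtop (Mok2015.LeafSupport.mkN (Mok2015.LeafSupport.cm l)) κnoMok).PengKottwitzV4 ∧
        ¬ (canon₁₂₆ νtop (Mok2015.LeafSupport.mkN (Mok2015.LeafSupport.cm l)) κnoMok).PengKottwitzSOQp) ∧
      ((canon₁₂₆ νtop (Mok2015.LeafSupport.mkN (Mok2015.LeafSupport.cm l)) κnoMok).PengHyp458OQ ∧ (canon₁₂₆noH νtop (Mok2015.LeafSupport.mkN (Mok2015.LeafSupport.cm l)) κnoMok).PengHyp458OQ) :=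
  have cmod := Mok2015.LeafSupport.countermodel l
  have nm := not_M_cm l
  have b : ∀ N, νtop.Everything N := bookInputs_top.everything
  ⟨cmod.2.2.1, canon_implications₁₂₆ _ _ _, ⟨fun h => nm h.2.1, fun h => nm h.1.2.1, fun h => nm h.1.2.1⟩, ⟨Or.inl True.intro, Or.inr ⟨b, b, b, True.intro⟩⟩⟩

/-- KMSW SIDE — (i) with KMSW's Mok import DENIED (`κnoMok`; book, Mok at the top) Theorem C FAILS (« [KMSW14, Theorem 1.6.1] », the proved scope); (ii) in KMSW's countermodel of the
leaf `l'` (book, Mok at the top; nodes granted) Theorem C, Theorem 7.3.5 and the ℚ_p-corollary HOLD iff `l'` ∈ {`AubertSS`, `KMS_A`, `KMS_B`}: C62 v4 inherits KMSW's PROVED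
scope, not the sequels; the ℚ-instance holds throughout. [cite: Peng2025FS, Thm C, Thm 7.3.5, Remark 4.5.9 (arXiv v4) (bookkeeping proved here)] [claim: KalethaMinguezShinWhite2014, under-review] -/
theorem c126_kmsw (l' : KMSW2014.LeafSupport.Leaf) :
    ¬ (canon₁₂₆ νtop μtop κnoMok).PengThmCv4 ∧
      Implications126 νtop μtop (KMSW2014.LeafSupport.mkN (KMSW2014.LeafSupport.cm l')) (canon νtop μtop (KMSW2014.LeafSupport.mkN (KMSW2014.LeafSupport.cm l')))
        (canon₄ νtop μtop (KMSW2014.LeafSupport.mkN (KMSW2014.LeafSupport.cm l'))) (canon₂₇ νtop μtop (KMSW2014.LeafSupport.mkN (KMSW2014.LeafSupport.cm l')))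
        (canon₁₂₅ νtop μtop (KMSW2014.LeafSupport.mkN (KMSW2014.LeafSupport.cm l'))) (canon₁₂₆ νtop μtop (KMSW2014.LeafSupport.mkN (KMSW2014.LeafSupport.cm l'))) ∧
      (((canon₁₂₆ νtop μtop (KMSW2014.LeafSupport.mkN (KMSW2014.LeafSupport.cm l'))).PengThmCv4 ↔ l'.onlyFull = true) ∧
        ((canon₁₂₆ νtop μtop (KMSW2014.LeafSupport.mkN (KMSW2014.LeafSupport.cm l'))).PengKottwitzV4 ↔ l'.onlyFull = true) ∧
        ((canon₁₂₆ νtop μtop (KMSW2014.LeafSupport.mkN (KMSW2014.LeafSupport.cm l'))).PengKottwitzSOQp ↔ l'.onlyFull = true)) ∧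
      (canon₁₂₆ νtop μtop (KMSW2014.LeafSupport.mkN (KMSW2014.LeafSupport.cm l'))).PengHyp458OQ := by
  have ns : ∀ N, ¬ κnoMok.Scope N := κnoMok_facts.2.2.2.2.2.1
  have b : ∀ N, νtop.Everything N := bookInputs_top.everything
  have m : ∀ N, μtop.Everything N := mokInputs_top.everything
  have sc : (∀ N, (KMSW2014.LeafSupport.mkN (KMSW2014.LeafSupport.cm l')).Scope N) ↔ l'.onlyFull = true := by
    refine ⟨fun h => ?_, fun h => scope_of_onlyFull l' h⟩
    cases hb : l'.onlyFull
    · exact absurd (h 0) (KMSW2014.LeafSupport.not_scope_of (KMSW2014.LeafSupport.scope_fails l' hb 0))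
    · rfl
  have tc : pengThmCv4W νtop μtop (KMSW2014.LeafSupport.mkN (KMSW2014.LeafSupport.cm l')) (canon νtop μtop (KMSW2014.LeafSupport.mkN (KMSW2014.LeafSupport.cm l')))
      (canon₄ νtop μtop (KMSW2014.LeafSupport.mkN (KMSW2014.LeafSupport.cm l'))) (canon₂₇ νtop μtop (KMSW2014.LeafSupport.mkN (KMSW2014.LeafSupport.cm l'))) ↔
      l'.onlyFull = true :=
    ⟨fun h => sc.1 h.2.2.1, fun h => have s := sc.2 h
      ⟨b, m, s, b, ⟨b, m⟩, ⟨b, m⟩, ⟨b, m, s, b, ⟨b, m⟩, ⟨b, m⟩⟩⟩⟩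
  exact ⟨fun h => ns 0 (h.2.2.1 0), canon_implications₁₂₆ _ _ _,
    ⟨tc, ⟨fun h => tc.1 h.1, fun h => ⟨tc.2 h, True.intro⟩⟩, ⟨fun h => tc.1 h.1, fun h => ⟨tc.2 h, Or.inl True.intro⟩⟩⟩, Or.inl True.intro⟩

/-- THE HUNDRED-AND-TWENTY-SIXTH TRANCHE REGRADED, in one statement: (i) at the top all five fields hold; (ii) node denied: Theorem 7.3.5 fails for every assignment while the
ℚ-instance survives at the top through C36 v3; both routes denied: the ℚ-instance and the ℚ_p-corollary fail for every assignment; (iii) in the book countermodel of any of the 24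
leaves Theorem C, Theorem 7.3.5, the corollary fail — and, node denied, the ℚ-instance; (iv) in every Mok countermodel Theorem C, Theorem 7.3.5, the corollary fail, the ℚ-instance
holds by either route; (v) in KMSW's countermodel of `l'` Theorem C, Theorem 7.3.5 and the corollary hold iff `l'` ∈ {`AubertSS`, `KMS_A`, `KMS_B`}; with the Mok import denied
Theorem C fails.  Supports: support(`PengThmCv4`) = all 24 book leaves ∧ all 29 Mok leaves ∧ KMSW's proved scope (A5, A6, A12, B62 inside it); support(`PengKottwitzV4`) = that ∧
the node Hypothesis 4.5.8; support(`PengHyp458OQ`) = the node OR (all 24 book leaves ∧ `ZhuHyp202`); support(`PengKottwitzSOQp`) = support(`PengThmCv4`) ∧ support(`PengHyp458OQ`).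
[cite: Peng2025FS, Thm C, Thm 7.3.5, Hypothesis 4.5.8, Remark 4.5.9 (arXiv v4) (bookkeeping proved here)] [claim: KalethaMinguezShinWhite2014, under-review] -/
theorem c126_regraded :
    ((canon₁₂₆ νtop μtop κtop).PengThmCv4 ∧ (canon₁₂₆ νtop μtop κtop).PengKottwitzV4 ∧ (canon₁₂₆ νtop μtop κtop).PengHyp458 ∧ (canon₁₂₆ νtop μtop κtop).PengHyp458OQ ∧
        (canon₁₂₆ νtop μtop κtop).PengKottwitzSOQp) ∧
      ((∀ (ν : Nodes) (μ : Mok2015.Nodes) (κ : KMSW2014.Nodes), ¬ (canon₁₂₆noH ν μ κ).PengKottwitzV4 ∧ ¬ (canon₁₂₆noHnoZ ν μ κ).PengHyp458OQ ∧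
          ¬ (canon₁₂₆noHnoZ ν μ κ).PengKottwitzSOQp) ∧ (canon₁₂₆noH νtop μtop κtop).PengHyp458OQ) ∧
      (∀ l : LeafSupport.Leaf, ¬ (LeafSupport.mkN (LeafSupport.cm l)).leaf l ∧ ¬ (canon₁₂₆ (LeafSupport.mkN (LeafSupport.cm l)) μtop κtop).PengThmCv4 ∧
        ¬ (canon₁₂₆ (LeafSupport.mkN (LeafSupport.cm l)) μtop κtop).PengKottwitzV4 ∧ ¬ (canon₁₂₆ (LeafSupport.mkN (LeafSupport.cm l)) μtop κtop).PengKottwitzSOQp ∧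
        (canon₁₂₆ (LeafSupport.mkN (LeafSupport.cm l)) μtop κtop).PengHyp458OQ ∧ ¬ (canon₁₂₆noH (LeafSupport.mkN (LeafSupport.cm l)) μtop κtop).PengHyp458OQ) ∧
      (∀ l : Mok2015.LeafSupport.Leaf, ¬ (Mok2015.LeafSupport.mkN (Mok2015.LeafSupport.cm l)).leaf l ∧ ¬ (canon₁₂₆ νtop (Mok2015.LeafSupport.mkN (Mok2015.LeafSupport.cm l)) κnoMok).PengThmCv4 ∧
        ¬ (canon₁₂₆ νtop (Mok2015.LeafSupport.mkN (Mok2015.LeafSupport.cm l)) κnoMok).PengKottwitzSOQp ∧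
        (canon₁₂₆noH νtop (Mok2015.LeafSupport.mkN (Mok2015.LeafSupport.cm l)) κnoMok).PengHyp458OQ) ∧
      ((∀ l' : KMSW2014.LeafSupport.Leaf, ((canon₁₂₆ νtop μtop (KMSW2014.LeafSupport.mkN (KMSW2014.LeafSupport.cm l'))).PengThmCv4 ↔ l'.onlyFull = true) ∧
          ((canon₁₂₆ νtop μtop (KMSW2014.LeafSupport.mkN (KMSW2014.LeafSupport.cm l'))).PengKottwitzSOQp ↔ l'.onlyFull = true)) ∧
        ¬ (canon₁₂₆ νtop μtop κnoMok).PengThmCv4) :=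
  ⟨hundredtwentysixth_holds_top,
    ⟨fun ν μ κ => have h := c126_nodes ν μ κ
      ⟨h.1.2.2.1, h.2.2.2.1, h.2.2.2.2⟩, (c126_nodes νtop μtop κtop).2.1⟩,
    fun l => have h := c126_book_cm l
      ⟨h.1, h.2.2.1.1, h.2.2.1.2.1, h.2.2.1.2.2, h.2.2.2.1.2, h.2.2.2.2⟩,
    fun l => have h := c126_mok_cm l
      ⟨h.1, h.2.2.1.1, h.2.2.1.2.2, h.2.2.2.2⟩,
    ⟨fun l' => have h := c126_kmsw l'
      ⟨h.2.2.1.1, h.2.2.1.2.2⟩, (c126_kmsw .MokMain).1⟩⟩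

/-! ## 130. Hundred-and-twenty-seventh tranche (v3 of this file, after `Downstream36.lean` v3; unit `pub-arthur-down-g55`'s LATEST arXiv TEXT STATES, VII): supports of row C270
Hsieh – Yamana in its arXiv v2 — Theorem 1.4 (`HYthetaV2` ⇐ book ∧ C226 = tranche 89's `FMrefined`), Theorem 2.5 (`HYthetaV2gen` ⇐ book ∧ C226 ∧ the node `HYmultOneD`; Theorem 1.4
⇐ Theorem 2.5) — and of row C82 A. Weiss in its arXiv v5 — the node-theorem `WeissLiftGL4` ⇐ book ∧ A4 and Theorems 1.1 / 1.2 `WeissImagesV5` ⇐ C191 ∧ the node. Row C226 is read,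
as in sections 92 and 108, by section 92's parametrised `canon₈₉W` over `canon`, `canon₈no` and `canon₃₄`. -/

section Canon127

variable (ν : Nodes) (μ : Mok2015.Nodes) (κ : KMSW2014.Nodes)

/-- The parametrised canonical reading of the hundred-and-twenty-seventh tranche: `m` is the value of C270 v2's node (multiplicity one for 𝒜_cusp(PGU^D_2)); Theorem 2.5 := book ∧
C226's refined formula ∧ the node; Theorem 1.4 := book ∧ C226's refined formula; C82's lifting node := book ∧ A4; Theorems 1.1 / 1.2 := C191 ∧ the lifting node.
[cite: HsiehYamana2024BesselPeriods, Thms 1.4, 2.5, §9.1 (arXiv v2); WeissAriel2022Images, Thms 1.1, 1.2, §2.4 (arXiv v5) (canonical model; bookkeeping)] [claim: KalethaMinguezShinWhite2014, under-review] -/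
abbrev canon₁₂₇W (m : Prop) (c : Consumers) (c₂₈ : Consumers28) (c₈₉ : Consumers89) : Consumers127 where
  HYthetaV2gen := (∀ N, ν.Everything N) ∧ c₈₉.FMrefined ∧ m
  HYthetaV2 := (∀ N, ν.Everything N) ∧ c₈₉.FMrefined
  HYmultOneD := m
  WeissLiftGL4 := (∀ N, ν.Everything N) ∧ c.GeeTaibi
  WeissImagesV5 := c₂₈.MokGSp4 ∧ ((∀ N, ν.Everything N) ∧ c.GeeTaibi)

/-- The canonical instance: node GRANTED; tranche 1 / 28 canonical; C226 by section 92's `canon₈₉W` over `canon`, `canon₈no`, `canon₃₄`. [cite: HsiehYamana2024BesselPeriods, §9.1 (arXiv v2) (canonical model; bookkeeping)] [claim: KalethaMinguezShinWhite2014, under-review] -/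
abbrev canon₁₂₇ : Consumers127 :=
  canon₁₂₇W ν True (canon ν μ κ) (canon₂₈ ν μ κ) (canon₈₉W ν μ (canon ν μ κ) (canon₈no ν μ) (canon₃₄ μ κ))

/-- NODE DENIED: C270 v2's multiplicity-one hypothesis false (and Theorem 2.5 with it), everything else canonical. [cite: HsiehYamana2024BesselPeriods, §9.1 (arXiv v2) (separating model; bookkeeping)] [claim: KalethaMinguezShinWhite2014, under-review] -/
abbrev canon₁₂₇noM : Consumers127 :=
  canon₁₂₇W ν False (canon ν μ κ) (canon₂₈ ν μ κ) (canon₈₉W ν μ (canon ν μ κ) (canon₈no ν μ) (canon₃₄ μ κ))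

/-- Every hundred-and-twenty-seventh-tranche edge holds in the parametrised reading over ANY node value and any assignments of tranches 1, 28, 89, for arbitrary ν.
[cite: HsiehYamana2024BesselPeriods, Thms 1.4, 2.5 (arXiv v2); WeissAriel2022Images, Thms 1.1, 1.2 (arXiv v5) (bookkeeping proved here)] [claim: KalethaMinguezShinWhite2014, under-review] -/
theorem canon_implications₁₂₇W (m : Prop) (c : Consumers) (c₂₈ : Consumers28) (c₈₉ : Consumers89) :
    Implications127 ν c c₂₈ c₈₉ (canon₁₂₇W ν m c c₂₈ c₈₉) where
  hyV2gen := fun b r hm => ⟨b, r, hm⟩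
  hyV2 := fun b r => ⟨b, r⟩
  hyV2special := fun g => ⟨g.1, g.2.1⟩
  weissLift := fun b g => ⟨b, g⟩
  weissV5 := fun k l => ⟨k, l⟩

/-- The edges hold in the canonical instance, for arbitrary ν, μ, κ. [cite: HsiehYamana2024BesselPeriods, Thm 1.4 (arXiv v2); WeissAriel2022Images, Thm 1.1 (arXiv v5) (bookkeeping proved here)] [claim: KalethaMinguezShinWhite2014, under-review] -/
theorem canon_implications₁₂₇ :
    Implications127 ν (canon ν μ κ) (canon₂₈ ν μ κ) (canon₈₉W ν μ (canon ν μ κ) (canon₈no ν μ) (canon₃₄ μ κ)) (canon₁₂₇ ν μ κ) :=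
  canon_implications₁₂₇W ν True _ _ _

/-- The edges hold with the node denied. [cite: HsiehYamana2024BesselPeriods, Thm 1.4 (arXiv v2) (bookkeeping proved here)] [claim: KalethaMinguezShinWhite2014, under-review] -/
theorem canon_implications₁₂₇noM :
    Implications127 ν (canon ν μ κ) (canon₂₈ ν μ κ) (canon₈₉W ν μ (canon ν μ κ) (canon₈no ν μ) (canon₃₄ μ κ)) (canon₁₂₇noM ν μ κ) :=
  canon_implications₁₂₇W ν False _ _ _

end Canon127

/-- At the top (every input of the three DAGs; node granted; C226 over the Chapter-9-denied `canon₈no`, which its refined formula does not consume) all five fields hold — the four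
theorems through the tranche's own `hundredtwentyseventh_of_inputs` fed by section 92's `canon_implications₈₉W`, `canon_implications₃₄`, `canon_implications₂₈`, `canon_implications`,
`bookInputs_top`, `mokInputs_top`, `kmswInputs_top`; the node by its grant. [cite: HsiehYamana2024BesselPeriods, Thms 1.4, 2.5 (arXiv v2); WeissAriel2022Images, Thms 1.1, 1.2 (arXiv v5) (bookkeeping proved here)] [claim: KalethaMinguezShinWhite2014, under-review] -/
theorem hundredtwentyseventh_holds_top :
    (canon₁₂₇ νtop μtop κtop).HYthetaV2gen ∧ (canon₁₂₇ νtop μtop κtop).HYthetaV2 ∧ (canon₁₂₇ νtop μtop κtop).HYmultOneD ∧ (canon₁₂₇ νtop μtop κtop).WeissLiftGL4 ∧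
      (canon₁₂₇ νtop μtop κtop).WeissImagesV5 :=
  have h := hundredtwentyseventh_of_inputs (canon_implications₁₂₇ νtop μtop κtop) (canon_implications₈₉W νtop μtop (canon νtop μtop κtop) (canon₈no νtop μtop) (canon₃₄ μtop κtop))
    (canon_implications₃₄ νtop μtop κtop) (canon_implications₂₈ νtop μtop κtop) (canon_implications νtop μtop κtop) bookInputs_top mokInputs_top (kmswInputs_top μtop).1
  ⟨h.2.1 True.intro, h.1, True.intro, h.2.2.1, h.2.2.2⟩

/-- NODE GRANTED / DENIED, for EVERY assignment of the three DAGs: with C270 v2's multiplicity-one node denied Theorem 2.5 FAILS while Theorem 1.4 keeps its value; every edge valid.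
[cite: HsiehYamana2024BesselPeriods, §9.1 + Thm 2.5 (arXiv v2) (separating model; bookkeeping proved here)] [claim: KalethaMinguezShinWhite2014, under-review] -/
theorem c127_node (ν : Nodes) (μ : Mok2015.Nodes) (κ : KMSW2014.Nodes) :
    Implications127 ν (canon ν μ κ) (canon₂₈ ν μ κ) (canon₈₉W ν μ (canon ν μ κ) (canon₈no ν μ) (canon₃₄ μ κ)) (canon₁₂₇noM ν μ κ) ∧
      ¬ (canon₁₂₇noM ν μ κ).HYmultOneD ∧ ¬ (canon₁₂₇noM ν μ κ).HYthetaV2gen ∧ ((canon₁₂₇noM ν μ κ).HYthetaV2 ↔ (canon₁₂₇ ν μ κ).HYthetaV2) :=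
  ⟨canon_implications₁₂₇noM ν μ κ, fun h => h, fun h => h.2.2, Iff.rfl⟩

/-- BOOK SIDE, EXACT SUPPORT AS TYPED — in the book countermodel of ANY of the 24 leaves `l` (Mok, KMSW at the top; node granted; every edge valid): C270 v2's Theorems 1.4 / 2.5 and
C82 v5's node-theorem and Theorems 1.1 / 1.2 all FAIL (« thanks to the work of Arthur », the book by name; C191 / A4 through the book); the node holds by its grant.
[cite: HsiehYamana2024BesselPeriods, Thms 1.4, 2.5, §9.1 (arXiv v2); WeissAriel2022Images, Thms 1.1, 1.2, §2.4 (arXiv v5) (bookkeeping proved here)] [claim: KalethaMinguezShinWhite2014, under-review] -/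
theorem c127_book_cm (l : LeafSupport.Leaf) :
    ¬ (LeafSupport.mkN (LeafSupport.cm l)).leaf l ∧
      Implications127 (LeafSupport.mkN (LeafSupport.cm l)) (canon (LeafSupport.mkN (LeafSupport.cm l)) μtop κtop) (canon₂₈ (LeafSupport.mkN (LeafSupport.cm l)) μtop κtop)
        (canon₈₉W (LeafSupport.mkN (LeafSupport.cm l)) μtop (canon (LeafSupport.mkN (LeafSupport.cm l)) μtop κtop) (canon₈no (LeafSupport.mkN (LeafSupport.cm l)) μtop) (canon₃₄ μtop κtop))
        (canon₁₂₇ (LeafSupport.mkN (LeafSupport.cm l)) μtop κtop) ∧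
      (¬ (canon₁₂₇ (LeafSupport.mkN (LeafSupport.cm l)) μtop κtop).HYthetaV2gen ∧ ¬ (canon₁₂₇ (LeafSupport.mkN (LeafSupport.cm l)) μtop κtop).HYthetaV2 ∧
        ¬ (canon₁₂₇ (LeafSupport.mkN (LeafSupport.cm l)) μtop κtop).WeissLiftGL4 ∧ ¬ (canon₁₂₇ (LeafSupport.mkN (LeafSupport.cm l)) μtop κtop).WeissImagesV5) ∧
      (canon₁₂₇ (LeafSupport.mkN (LeafSupport.cm l)) μtop κtop).HYmultOneD :=
  have cmod := LeafSupport.countermodel l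
  have n := not_B_cm l
  ⟨cmod.2.2.1, canon_implications₁₂₇ _ _ _, ⟨fun h => n h.1, fun h => n h.1, fun h => n h.1, fun h => n h.2.1⟩, True.intro⟩

/-- MOK SIDE, EXACT SUPPORT AS TYPED — in the Mok countermodel of ANY of the 29 leaves `l` (book at the top; KMSW WITHOUT its Mok import; every edge valid): C270 v2's Theorems 1.4 / 2.5
FAIL (C226's refined formula consumes Mok), C82 v5's node-theorem and Theorems 1.1 / 1.2 HOLD (book-only through A4 / C191). [cite: HsiehYamana2024BesselPeriods, Thm 1.4 (arXiv v2) with FurusawaMorimoto2024SO5; WeissAriel2022Images, Thms 1.1, 1.2 (arXiv v5) (bookkeeping proved here)] [claim: KalethaMinguezShinWhite2014, under-review] -/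
theorem c127_mok_cm (l : Mok2015.LeafSupport.Leaf) :
    ¬ (Mok2015.LeafSupport.mkN (Mok2015.LeafSupport.cm l)).leaf l ∧
      Implications127 νtop (canon νtop (Mok2015.LeafSupport.mkN (Mok2015.LeafSupport.cm l)) κnoMok) (canon₂₈ νtop (Mok2015.LeafSupport.mkN (Mok2015.LeafSupport.cm l)) κnoMok)
        (canon₈₉W νtop (Mok2015.LeafSupport.mkN (Mok2015.LeafSupport.cm l)) (canon νtop (Mok2015.LeafSupport.mkN (Mok2015.LeafSupport.cm l)) κnoMok)
          (canon₈no νtop (Mok2015.LeafSupport.mkN (Mok2015.LeafSupport.cm l))) (canon₃₄ (Mok2015.LeafSupport.mkN (Mok2015.LeafSupport.cm l)) κnoMok))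
        (canon₁₂₇ νtop (Mok2015.LeafSupport.mkN (Mok2015.LeafSupport.cm l)) κnoMok) ∧
      (¬ (canon₁₂₇ νtop (Mok2015.LeafSupport.mkN (Mok2015.LeafSupport.cm l)) κnoMok).HYthetaV2gen ∧ ¬ (canon₁₂₇ νtop (Mok2015.LeafSupport.mkN (Mok2015.LeafSupport.cm l)) κnoMok).HYthetaV2) ∧
      ((canon₁₂₇ νtop (Mok2015.LeafSupport.mkN (Mok2015.LeafSupport.cm l)) κnoMok).WeissLiftGL4 ∧ (canon₁₂₇ νtop (Mok2015.LeafSupport.mkN (Mok2015.LeafSupport.cm l)) κnoMok).WeissImagesV5) :=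
  have cmod := Mok2015.LeafSupport.countermodel l
  have nm := not_M_cm l
  have b : ∀ N, νtop.Everything N := bookInputs_top.everything
  ⟨cmod.2.2.1, canon_implications₁₂₇ _ _ _, ⟨fun h => nm h.2.1.1, fun h => nm h.2.1⟩, ⟨⟨b, b⟩, ⟨⟨b, b⟩, ⟨b, b⟩⟩⟩⟩

/-- KMSW SIDE — (i) with KMSW's Mok import DENIED (`κnoMok`; book, Mok at the top) C270 v2's Theorems 1.4 / 2.5 FAIL (C226 runs on Beuzart-Plessis = C67 / C24, KMSW's proved scope);
(ii) in KMSW's countermodel of the leaf `l'` (book, Mok at the top; node granted) they HOLD iff `l'` ∈ {`AubertSS`, `KMS_A`, `KMS_B`}; C82 v5's statements hold throughout.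
[cite: HsiehYamana2024BesselPeriods, Thms 1.4, 2.5 (arXiv v2) with FurusawaMorimoto2024SO5; WeissAriel2022Images, Thms 1.1, 1.2 (arXiv v5) (bookkeeping proved here)] [claim: KalethaMinguezShinWhite2014, under-review] -/
theorem c127_kmsw (l' : KMSW2014.LeafSupport.Leaf) :
    (¬ (canon₁₂₇ νtop μtop κnoMok).HYthetaV2 ∧ ¬ (canon₁₂₇ νtop μtop κnoMok).HYthetaV2gen) ∧
      Implications127 νtop (canon νtop μtop (KMSW2014.LeafSupport.mkN (KMSW2014.LeafSupport.cm l'))) (canon₂₈ νtop μtop (KMSW2014.LeafSupport.mkN (KMSW2014.LeafSupport.cm l')))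
        (canon₈₉W νtop μtop (canon νtop μtop (KMSW2014.LeafSupport.mkN (KMSW2014.LeafSupport.cm l'))) (canon₈no νtop μtop) (canon₃₄ μtop (KMSW2014.LeafSupport.mkN (KMSW2014.LeafSupport.cm l'))))
        (canon₁₂₇ νtop μtop (KMSW2014.LeafSupport.mkN (KMSW2014.LeafSupport.cm l'))) ∧
      (((canon₁₂₇ νtop μtop (KMSW2014.LeafSupport.mkN (KMSW2014.LeafSupport.cm l'))).HYthetaV2 ↔ l'.onlyFull = true) ∧
        ((canon₁₂₇ νtop μtop (KMSW2014.LeafSupport.mkN (KMSW2014.LeafSupport.cm l'))).HYthetaV2gen ↔ l'.onlyFull = true)) ∧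
      ((canon₁₂₇ νtop μtop (KMSW2014.LeafSupport.mkN (KMSW2014.LeafSupport.cm l'))).WeissLiftGL4 ∧ (canon₁₂₇ νtop μtop (KMSW2014.LeafSupport.mkN (KMSW2014.LeafSupport.cm l'))).WeissImagesV5) := by
  have ns : ∀ N, ¬ κnoMok.Scope N := κnoMok_facts.2.2.2.2.2.1
  have b : ∀ N, νtop.Everything N := bookInputs_top.everything
  have m : ∀ N, μtop.Everything N := mokInputs_top.everything
  have sc : (∀ N, (KMSW2014.LeafSupport.mkN (KMSW2014.LeafSupport.cm l')).Scope N) ↔ l'.onlyFull = true := by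
    refine ⟨fun h => ?_, fun h => scope_of_onlyFull l' h⟩
    cases hb : l'.onlyFull
    · exact absurd (h 0) (KMSW2014.LeafSupport.not_scope_of (KMSW2014.LeafSupport.scope_fails l' hb 0))
    · rfl
  have v2 : (canon₁₂₇ νtop μtop (KMSW2014.LeafSupport.mkN (KMSW2014.LeafSupport.cm l'))).HYthetaV2 ↔ l'.onlyFull = true :=
    ⟨fun h => sc.1 h.2.2.2.2, fun h => have s := sc.2 h
      ⟨b, m, ⟨m, s, ⟨m, s⟩⟩, ⟨m, s⟩⟩⟩
  exact ⟨⟨fun h => ns 0 (h.2.2.2.2 0), fun h => ns 0 (h.2.1.2.2.2 0)⟩, canon_implications₁₂₇ _ _ _,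
    ⟨v2, ⟨fun h => v2.1 ⟨h.1, h.2.1⟩, fun h => have t := v2.2 h
      ⟨t.1, t.2, True.intro⟩⟩⟩, ⟨⟨b, b⟩, ⟨⟨b, b⟩, ⟨b, b⟩⟩⟩⟩

/-- THE HUNDRED-AND-TWENTY-SEVENTH TRANCHE REGRADED, in one statement: (i) at the top all five fields hold; (ii) node denied: Theorem 2.5 fails for every assignment, Theorem 1.4 keeps
its value; (iii) in the book countermodel of any of the 24 leaves all four theorems fail; (iv) in every Mok countermodel C270 v2's two theorems fail and C82 v5's hold; (v) in KMSW's
countermodel of `l'` C270 v2's theorems hold iff `l'` ∈ {`AubertSS`, `KMS_A`, `KMS_B`}, and fail with the Mok import denied; C82 v5's hold in every KMSW reading.  Supports: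
support(`HYthetaV2`) = all 24 book leaves ∧ all 29 Mok leaves ∧ KMSW's proved scope (through C226 ⇐ Mok ∧ C67 ∧ C24); support(`HYthetaV2gen`) = that ∧ the node `HYmultOneD`;
support(`WeissLiftGL4`) = support(`WeissImagesV5`) = all 24 book leaves (A4, C191 book-only), no Mok / KMSW leaf.
[cite: HsiehYamana2024BesselPeriods, Thms 1.4, 2.5, §9.1 (arXiv v2); WeissAriel2022Images, Thms 1.1, 1.2, §2.4 (arXiv v5) (bookkeeping proved here)] [claim: KalethaMinguezShinWhite2014, under-review] -/
theorem c127_regraded :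
    ((canon₁₂₇ νtop μtop κtop).HYthetaV2gen ∧ (canon₁₂₇ νtop μtop κtop).HYthetaV2 ∧ (canon₁₂₇ νtop μtop κtop).HYmultOneD ∧ (canon₁₂₇ νtop μtop κtop).WeissLiftGL4 ∧
        (canon₁₂₇ νtop μtop κtop).WeissImagesV5) ∧
      (∀ (ν : Nodes) (μ : Mok2015.Nodes) (κ : KMSW2014.Nodes), ¬ (canon₁₂₇noM ν μ κ).HYthetaV2gen ∧ ((canon₁₂₇noM ν μ κ).HYthetaV2 ↔ (canon₁₂₇ ν μ κ).HYthetaV2)) ∧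
      (∀ l : LeafSupport.Leaf, ¬ (LeafSupport.mkN (LeafSupport.cm l)).leaf l ∧ ¬ (canon₁₂₇ (LeafSupport.mkN (LeafSupport.cm l)) μtop κtop).HYthetaV2gen ∧
        ¬ (canon₁₂₇ (LeafSupport.mkN (LeafSupport.cm l)) μtop κtop).HYthetaV2 ∧ ¬ (canon₁₂₇ (LeafSupport.mkN (LeafSupport.cm l)) μtop κtop).WeissLiftGL4 ∧
        ¬ (canon₁₂₇ (LeafSupport.mkN (LeafSupport.cm l)) μtop κtop).WeissImagesV5) ∧
      (∀ l : Mok2015.LeafSupport.Leaf, ¬ (Mok2015.LeafSupport.mkN (Mok2015.LeafSupport.cm l)).leaf l ∧ ¬ (canon₁₂₇ νtop (Mok2015.LeafSupport.mkN (Mok2015.LeafSupport.cm l)) κnoMok).HYthetaV2 ∧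
        (canon₁₂₇ νtop (Mok2015.LeafSupport.mkN (Mok2015.LeafSupport.cm l)) κnoMok).WeissLiftGL4 ∧ (canon₁₂₇ νtop (Mok2015.LeafSupport.mkN (Mok2015.LeafSupport.cm l)) κnoMok).WeissImagesV5) ∧
      ((∀ l' : KMSW2014.LeafSupport.Leaf, ((canon₁₂₇ νtop μtop (KMSW2014.LeafSupport.mkN (KMSW2014.LeafSupport.cm l'))).HYthetaV2 ↔ l'.onlyFull = true) ∧
          (canon₁₂₇ νtop μtop (KMSW2014.LeafSupport.mkN (KMSW2014.LeafSupport.cm l'))).WeissImagesV5) ∧ ¬ (canon₁₂₇ νtop μtop κnoMok).HYthetaV2) :=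
  ⟨hundredtwentyseventh_holds_top,
    fun ν μ κ => have h := c127_node ν μ κ
      ⟨h.2.2.1, h.2.2.2⟩,
    fun l => have h := c127_book_cm l
      ⟨h.1, h.2.2.1.1, h.2.2.1.2.1, h.2.2.1.2.2.1, h.2.2.1.2.2.2⟩,
    fun l => have h := c127_mok_cm l
      ⟨h.1, h.2.2.1.2, h.2.2.2.1, h.2.2.2.2⟩,
    ⟨fun l' => have h := c127_kmsw l'
      ⟨h.2.2.1.1, h.2.2.2.2⟩, (c127_kmsw .MokMain).1.1⟩⟩


end Support

end Downstream

end Literature.NumberTheory.Automorphic.Arthur2013
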